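import Mathlib
import Literature.MathematicalPhysics.QuantumFieldTheory.Balaban1983to89.T4OutputRate
import Literature.MathematicalPhysics.QuantumFieldTheory.Dimock2015.AnalyticLipschitz

/-!
# T4CouplingAnalyticity — the ANALYTIC-DEPENDENCE ROUTE to the coupling-history Lipschitz shape NE9 of Bałaban's one-step
output functionals: Cauchy estimates give the moduli, a renewal inequality gives their fading memory (cell `pub-balaban`,
T4-DAG node U3, spine estimate NE9, prover row T4-U3.E-NE9-PROVE-P1*; typing + kernel bookkeeping only)

HONEST FRAMING (T4-DAG PAGE 1).  The cell's T4 target is rung (B)+1 — existence AND uniqueness of the ε → 0 limit of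
gauge-invariant observables of pure YM₄ on a FIXED finite torus — and NOT infinite volume, NOT a mass gap, NOT the Clay
problem.  NE9 = `T4OutputRate.NE9` (JOINT Lipschitz dependence of the scale-j term `E^{(j)}(X; g⃗, U)` on the preceding
couplings g₀, …, g_{j−1} with history moduli `Λ j i`) together with `T4OutputRate.FadingMemory` (`Λ j i ≤ C₉ω^{j−i}`) is a
cell NEW ESTIMATE: NOTHING OF IT IS PRINTED (cell GAPS G-t4-U3-3 and G-t4-U3-4; `T4OutputRate` header, "NOT PRINTED (b)").  This module
ASSERTS NOTHING about Bałaban's functionals.  Every `def … : Prop` below is a HYPOTHESIS SHAPE over abstract carriers (to be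
ASSUMED by a consumer, never used as a fact) and every `theorem` is kernel-checked bookkeeping (real-number inequalities and
two applications of the Cauchy estimate of `Dimock2015.AnalyticLipschitz`).  Its value is a REDUCTION: NE9 ∧ FadingMemory
follow BY NAME from three typed analytic hypotheses and one smallness condition, each of which is stated precisely enough to
be the exact missing inequality.  NOT summit progress.  The conditional hypotheses of the spine (`FlowStep.BetaPertH`, (B),
(B^μ)) are not touched by this module (nothing here depends on or hides them).

WHAT IS PRINTED ABOUT THE COUPLING DEPENDENCE (read by this seat on the ×2 journal-page renders
`b2b-balaban-ref1/pages/1987-cmp109-rg-I-small-field/…-p010/p017/p018/p019/p020-x2.png`; journal page = PDF page + 248).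
* [Balaban1987RG1] p. 263 (§1, the inductive assumptions on the actions = the hypotheses verified by Theorem 3, p. 264):
  *"It is a C^∞-function of g_{j−1} ∈ [0, γ], (or analytic), with a positive, absolute γ."* — the LAST coupling only,
  qualitative; p. 264 (Theorem 3): *"The constants ε₀, ε₁, α₀, α₁ depend on M and satisfy numerous restrictions, which will
  become clear in the proof. The constant γ depends on all other constants."*; p. 256: *"The function E_k depends also on
  the effective coupling constants g₀, …, g_{k−1}."* … *"In the second step a new expression of this type is created, in the
  old only a background field is changed."*
* [Balaban1987RG1] p. 265 (2.1) and the sentence after it: *"(T_kA_k)(W) = log N_k^{−1} ∫ dV δ(V̄W^{−1}) × χ_k exp[−(1/g_k²)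
  G(V) − (1/g_k²)A(U_k(V)) + E_k(U_k(V))]. (2.1)"*, *"The meaning of the function E_k is obvious, it is equal to
  (1/g_k²)A + A_k."* — so `E_k` collects the terms of the first k steps and does not contain g_k.
* [Balaban1987RG1] p. 266 (2.9) and the paragraph after it: *"Finally we can define the characteristic function χ_k
  χ_k = Π_{b∈T^{(k)}∖{b₀(c): c∈T^{(k+1)}}} χ({|B′(b)| < ε₁}). (2.9) Another possibility is to take g_k/γ_kε₁ instead of ε₁,
  where γ_k = C log(L^kε)^{−1} with C sufficiently large. It has the advantage that the functions E^{(j)}, β_j are analytic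
  functions of the effective coupling constants, but it has some disadvantages in perturbative calculations also. We have
  formulated the implications of both possibilities in the inductive description."*
* [Balaban1987RG1] p. 267 (2.10) and p. 267 bottom: *"(2.1) = log N_k′^{−1} ∫ dB′σ(B′)δ(Q̃(B′)) × χ_k exp[−(1/g_k²)G(B′) −
  (1/g_k²)A(U_{k+1}) − (1/g_k²)⟨H₁B′, J⟩ − (1/2g_k²)⟨H₁B′, Δ₁H₁B′⟩ − (1/g_k²)V(H₁B′) + E_k(U_k(exp iB′V^{(k)}))], (2.10)"*;
  *"Next we make the scaling transformation B = g_kB′. … Hence the only term with a negative power of g_k is the action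
  evaluated at the configuration U_{k+1}."*
* [Balaban1987RG1] p. 268 (2.12)–(2.13): after the rescaling every term of `P^{(k)}(g_k, U_{k+1}, B)` contains g_k through
  `g_kCB` inside the analytic functions σ, D̃, D̃₃, G₃, V (e.g. *"−(1/g_k²)G₃(g_kB)"*, *"−(1/g_k²)V(H₁(g_kCB − hD̃(g_kCB)))"*)
  and the previous action enters only through the curly bracket *"{E_k(U_k(exp i[g_kCB − hD̃(g_kCB)]V^{(k)})) −
  E_k(U_k(V^{(k)}))}"*; *"E^{(k+1)}(g_k, U_{k+1}) = log ∫ dμ_{C^{(k)}}(B)χ_k exp[P^{(k)}(g_k, U_{k+1}, B) + {…}]. (2.13) Let us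
  remark that the expression under the exponential above vanishes at g_k = 0"*.
* [Balaban1987RG1] p. 258 (0.29): *"|V^{(j)}(X, U_k)| ≤ O(1)(L^jη)^{4+α} exp(−κd_j(X)), α > 0, (0.29)"* — the printed
  IRRELEVANCE CONTRACTION of the renormalised old terms seen at a later scale (per-step factor L^{−α} per unit volume, (0.30)).
* [Balaban1988RG2Cluster] (journal page = PDF page; renders `…/1988-cmp116-rg-II-cluster/…-p009/p015/p018-x2.png` read by this
  seat) p. 9, Lemma 1: *"The second expression in the fluctuation field action in (I.2.13) is represented as the sum
  E_k(U_k(exp iB′V^{(k)})) − E_k(U_k(V^{(k)})) = Σ_{Y∈D_k} V′_k(Y, U_{k+1}, B). (1.33) For each term in the sum there exists a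
  function V′_k(Y, U, J, B), defined and analytic on the space U^c_{k+1}(Y, (1 + β)α₀, (1 + β)α₁, α₀) × {B: |B| < ε₁g_k^{−1}
  on Y}, (1.34) … There exist absolute constants C₁, C₂, q, for which |V′_k(Y, U, J, B)| ≤ E₀ε₁C₁M^q exp C₂κ₁ exp(−(1 −
  2δ)κd_k(Y)). (1.36)"*; p. 15, on the generic cluster-expansion term: *"For the pair (U, 0) the operators are symmetric, and
  the measure is positive, and then the estimates are simpler. The general case is handled by a perturbative argument."*, the
  first estimate (2.15) carrying the potentials only through the factor *"exp[Σ_{Y∈D} |τ(Y)||V_k(Y, B)|]"*; p. 18: *"Assuming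
  2E₀ε₁C₁α₄^{−1}α₆^{−1}M^q exp C₂κ₁ exp 5κ ≤ 1, we have"* (2.28), and after (2.31) *"for g_k², i.e. γ² sufficiently small,
  depending on M and κ."*
LOCATED STRUCTURE (this seat's reading, recorded in the cell file `t4/T4-EST-NE9-P1.md`; a READING, not a citation of a
result): (L1) the earlier couplings g_i, i < k, enter the new term E^{(k+1)} ONLY through the previous action E_k in the
curly bracket of (2.12), i.e. through a FLUCTUATION DIFFERENCE of the old terms; (L2) with the cut-off (2.9) the domain of
the rescaled fluctuation variable is `|CB(b)| < ε₁/g_k`, g_k-DEPENDENT, so E^{(k+1)} is not analytic in g_k on any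
g_k-independent complex disc in the printed scheme (only C^∞ — the p. 263 dichotomy), whereas with the ALTERNATIVE cut-off
`(g_k/γ_k)ε₁` of p. 266 the rescaled domain `|CB(b)| < ε₁/γ_k` is g_k-free and the integrand of (2.13) is a convergent
power series in g_k; the analyticity "in the effective coupling constants" printed on p. 266 is a one-sentence claim of the
manuscript under audit, with no radius and no bound, and is NOT used here as a fact; (L3) NO quantitative modulus, NO
complex radius in any g_i, NO bound of a g-difference of any E^{(j)} is printed in [Balaban1987RG1], [Balaban1988RG2Cluster],
[Balaban1988Convergent] (null searches of the cell records `t4/T4-EST-U3.md` §4 and `t4/T4-XREAD-U3.md`, re-run by this seat: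
"Lipschitz", "difference of the couplings", "g′", "analytic in g" over the three texts — no hit beyond the sentences above);
(L4) [Balaban1988RG2Cluster] located (v1.2): the g_k-DEPENDENT small-field domain of (L2) is PRINTED ((1.34): *"{B: |B| <
ε₁g_k^{−1} on Y}"*); the previous action enters the step only through the potentials V′_k of (1.33), the map E_k ↦ (V′_k(Y))_Y
being LINEAR (built from the terms of E_k by the decoupling expansions (1.10) and Cauchy-formula representations (1.23)) with
the modulus bound (1.36), itself linear in the inductive constant E₀, and §2 there uses the potentials only through |V_k| ((2.15))
— so the transfer hypothesis (AN-OLD) below is inspection-level, and the transfer coefficient is, up to resummation constants,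
the p. 18 combination 2ε₁C₁α₄^{−1}α₆^{−1}M^q e^{C₂κ₁}e^{5κ} WITHOUT E₀ (a linear channel's Lipschitz constant is an operator norm).
(L5) [v1.3, renders B12 p018 = p. 266–267 and B13 p012–p020 = pp. 12–20 re-read as images] THE LAST COUPLING IS A DILATION
PARAMETER: in the UNSCALED representation (2.10) p. 267 g_k enters the k-th step ONLY as the prefactor `1/g_k²` of the
classical fluctuation action over the cut-off (2.9) `χ_k = Π_{b ∈ T^{(k)}∖{b₀(c): c ∈ T^{(k+1)}}} χ({|B′(b)| < ε₁})`, which is g-FREE — so (L2)'s "g_k-dependent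
domain" is nothing but the printed real scaling (p. 267: *"Next we make the scaling transformation B = g_kB′."* — the
variable of (2.10) is g_k times the new one, so that the cut-off (2.9) `|B′(b)| < ε₁` becomes `|B(b)| < ε₁/g_k`, the threshold
of (2.3) p. 12 of [Balaban1988RG2Cluster]: `χ^c_{k,P} = Π_{b∈P} χ({|B(b)| ≥ ε₁/g_k})`; v1.3 wrote this scaling as "B′ = g_kB" with B the new variable — v1.4 (A1) quotes
the printed form), and a complex last coupling z (t = 1/z² complex) is, after that scaling at the REAL base point g_k, EXACTLY
the complex scalar dilation by `1 + ζ = g_k²/z² = t′/t_k` of the five `1/g_k²`-terms of (2.10) (`G(B′)`, `A(U_{k+1})`,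
`⟨H₁B′, J⟩`, `½⟨H₁B′, Δ₁H₁B′⟩`, `V(H₁B′)`; p. 267: *"Hence the only term with a negative power of g_k is the action evaluated
at the configuration U_{k+1}. Terms of the order 0 in g_k are"* (2.11)) — in particular `Δ ↦ (1 + ζ)Δ` for the Gaussian
form — while the Haar density `σ(B′)`, the δ-function `δ(Q̃(B′))`, the cut-off `χ_k` and the previous-action term
`𝐄_k(U_k(exp iB′V^{(k)}))` of (2.10) carry no g_k and are NOT dilated (v1.4 correction (O1) of v1.3's "`𝐏^{(k)} ↦ (1 + ζ)𝐏^{(k)}`",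
which over-dilated the measure and 𝐄_k contributions), with the cut-offs `|B(b)| < ε₁/g_k`, the curly bracket `Σ_Y 𝐕′_k(Y)`
and all thresholds UNCHANGED; the relative t-discs `|t′ − t| < c·t` are the ζ-discs `|ζ| < c` (whence §6).  WHERE THE DILATION MEETS THE PRINTED
EXPANSION of [Balaban1988RG2Cluster] §2 (inspection by this seat, equation by equation): (2.3) p. 12 expands the cut-offs
`χ_k = Σ_P (−1)^{|P|}χ_{k,Y₀}χ^c_{k,P}` with REAL thresholds — untouched; (2.5) p. 12 – (2.6) p. 13, outside Z₀, the change of variables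
`B′ = (C^{(k)})^{1/2}X` to the unit Gaussian dμ₀ absorbs a scalar factor ((1 + ζ)^{−1/2} on (C^{(k)})^{1/2}, i.e. Γ_k ↦
(1 + ζ)^{1/2}Γ_k in (2.6)), and the random-walk expansions (2.7) commute with scalars; inside Z₀ the printed treatment of
COMPLEX quadratic forms is an absolute-value bound — p. 15, on the generic term (2.14): *"We consider it as an analytic function of (U, J) in the
space U^c_{k+1}(X, α₀, α₁), and of the complex parameters σ(Z), τ. This complicates estimates of this expression, because the
operators in it are not symmetric, and the second measure is complex."* … *"For the pair (U, 0) the operators are symmetric,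
and the measure is positive, and then the estimates are simpler. The general case is handled by a perturbative argument."*
(v1.4 DOCFIX (M1): verbatim p. 15 sentences replacing v1.3's mis-located paraphrase), (2.15)–(2.17) pp. 15–16 (positive Gaussian
(Re C^{−1})^{−1} times a determinant ratio and error quadratic forms with exponentially decaying kernels, (2.17): *"hence
this factor can be estimated by exp((O(1)e^{−1/3δ₀M} + O(α₀ + α₁))|Z₀|)"*), (2.23) p. 17: *"where α₅ = O(1)e^{−1/3δ₀M} + O(α₀ +
α₁) + O(1)α₄ + γ₂"*, the volume factor `exp O(1)α₅|Z|` being absorbed on p. 20: *"We assume that (LM)⁴α₀, (LM)⁴α₁, (LM)⁴α₄,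
(LM)⁴γ₂ are bounded by a constant independent of M, for example by 1."*; a dilation `|ζ| ≤ c₀` enters these bounds exactly
where α₀, α₁ do (determinant ratio `(|1 + ζ|/Re(1 + ζ))^{N(Z₀)/2}`, error form `ζ·C₀^{−1}` of the type (2.16)), multiplies
the potential constants by `1 + c₀` ((2.18), ε₂ of (2.35) p. 19, C₃ of Lemma 3 (2.38) p. 20) and the large-field factors
`exp(−½γ₂ε₁²g_k^{−2}|P|)` of (2.26) p. 17 by `1 + Re ζ` in the exponent; the printed expansion ALREADY dilates the potentials by
the complex interpolation parameters τ(Y) on circles of radius |τ(Y)|^{−1}·(2.18) ≫ 1 and differentiates by the Cauchy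
formula (2.14) — so holomorphy of every term of (2.14) in ζ with ζ-uniform bounds, hence of E^{(k+1)}(X) by (2.13) and
uniform convergence (as for the printed (U, J)-analyticity, p. 15: *"Thus the activities in (2.13), and the whole
sum E^{(k+1)}(X), are analytic functions of (U, J), on the space U^c_{k+1}(X, α₀, α₁). This is the analyticity statement in
the inductive assumptions."* — v1.4 DOCFIX (M2), verbatim), is a PARAMETER-BOOKKEEPING VARIANT of the printed estimates with c₀ joining α₅
under the restriction `(LM)⁴c₀ ≤ 1`.  This is a READING (cell record `t4/T4-EST-NE9-P1.md` §9, GAPS G-ne9p1-6); the statement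
[H-dil] below is NOT PRINTED and is NOT asserted anywhere in this file.  CORRECTION of v1.2: clause 2 of (W1-t) ("PLUS the
cut-off insensitivity of E^{(k+1)} in g_k") is WITHDRAWN — there is nothing to be insensitive to, the cut-off being g-free in
the variables of (2.10); and the p. 266 alternative cut-off reads verbatim *"take g_k/γ_k ε₁ instead of ε₁, where γ_k = C log
(L^kε)^{−1} with C sufficiently large"* (its role is the g_k → 0 Taylor/analytic dichotomy of p. 263, not positive g_k; unused).

THE ROUTE, AND WHAT THIS FILE PROVES (kernel; Mathlib + the two imported tree modules; explicit constants).
§1 COORDINATE-DISC CAUCHY ⇒ NE9 (`CouplingAnalytic`, `ne9_of_couplingAnalytic`).  HYPOTHESIS SHAPE: for every admissible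
   history h ∈ `Window γ`, background U, domain X and coordinate i < j = scale X, the one-variable function
   s ↦ E(h[i := s], U, X) on ]0, γ] has a complex-analytic extension to a set containing the closed discs of radius `r j i`
   about ]0, γ], bounded there by `M·e^{−κd_j(X)}`.  THEOREM: this and the printed-in-words prefix dependence give
   `NE9 E (Window γ) κ (fun j i ↦ 4M / r j i)` — telescoping one coupling at a time inside the box and
   `Dimock2015.real_param_lipschitz` per coordinate.  REACH OF PURE ANALYTICITY: the moduli are the Cauchy constants 4M/r;
   they are UNIFORM iff the radii are (j, i)-independent and they DECAY in j − i iff the radii GROW geometrically — which they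
   do not (E^{(j)} is analytic in g_i at best on the common domain of the old terms it is built from); so analyticity alone
   gives NE9 with uniform moduli and NO fading memory (`T4OutputRate.historySum_const` regime).
   General coordinate set: `BoxWindow I`, `CouplingAnalyticOn I E κ M r`, `ne9_of_couplingAnalyticOn` (I order-connected).
§1b t-COORDINATES (`abs_sub_le_of_window`, `ofT`, `ne9_tCoord_of_ne9`, `fadingMemory_tCoord`, `ne9_of_couplingAnalyticT`).
   The dictionary |g − g′| ≤ (γ³/2)|g⁻² − g′⁻²| on ]0, γ]: NE9 in g (window ]0, γ], moduli Λ ≥ 0) ⇒ NE9 for the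
   re-parametrised functional t⃗ ↦ E(1/√t⃗) over the t-box t_i ≥ γ⁻² with moduli (γ³/2)Λ — the WEAKER form, in the variable
   t = 1/g² that the spine's coupling matching (`T4CouplingMatching`) uses; and coordinate-disc analyticity IN t with a
   t-UNIFORM radius over the box `[t₀, ∞[` ⇒ NE9 in t.  Why t: in the printed scheme the representation (2.12)–(2.13) carries
   g_k through g_k·CB on the domain |B| < ε₁/g_k (L2)/(L4), so a complex LAST coupling is plausible on discs |z − g_k| < c·g_k
   (|zB| < (1+c)ε₁ stays small-field) and not on g-uniform discs; |z − g| < c·g corresponds to t-discs of radius ≍ 2c·t ≥ 2c/γ²,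
   UNIFORM in t — the Cauchy constant is then a bounded t-modulus (≍ M/(c·t) = M g²/c, even small), an unbounded g-modulus.
§2 THE RENEWAL LEMMA (`geomMod`, `transferSum_geomMod`, `fadingMemory_geomMod`).  The moduli `geomMod ℓ μ j i = ℓμ^{j−1−i}`
   (i < j; 0 otherwise) solve the renewal recursion `Λ (i+1) i = ℓ`, `Λ j i = a·Σ_{i<m<j} ω₀^{j−1−m} Λ m i` with μ = ω₀ + a up
   to the exact defect `ℓω₀^{j−1−i}`:  `a·Σ_{m≤j} ω₀^{j−m}·geomMod ℓ (ω₀+a) m i = ℓ((ω₀+a)^{j−i} − ω₀^{j−i})`, and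
   `FadingMemory (ℓ/μ) μ (geomMod ℓ μ)` for μ > 0.  Fading memory in the sense the consumer needs (`historySum_le_of_
   fadingMemory`: ω < 1) therefore holds iff `ω₀ + a < 1` — the route's SMALLNESS CONDITION, NOT PRINTED.
§3 NORM-LEVEL STEP TRANSFER ⇒ NE9 ∧ FadingMemory (`NormNE9`, `StepTransfer`, `normNE9_of_stepTransfer`, `ne9_of_normNE9`,
   `ne9_and_fadingMemory_of_stepTransfer`; one-step form `aggDisc_step`: aggregate ≤ (ω₀+a)·aggregate + ℓ|Δg_j|).
   Activities are modelled as elements `V j g` of ONE seminormed group (the weighted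
   sup-norm spaces of (0.25); abstract), the functional being an evaluation `E g U X = ev (V (scale X) g) U X` with
   `|ev b U X − ev b′ U X| ≤ e^{−κd(X)}‖b − b′‖`.  HYPOTHESIS SHAPE `StepTransfer V W ℓ a ω₀`: `‖V (j+1) g − V (j+1) g′‖ ≤
   ℓ|g_j − g′_j| + a·Σ_{m≤j} ω₀^{j−m}‖V m g − V m g′‖` (direct dependence on the last coupling with modulus ℓ; dependence on
   the old terms with transfer coefficient a, damped by the irrelevance factor ω₀ per scale — the typed form of (L1) + (0.29);
   NOT PRINTED).  THEOREM: StepTransfer + (V 0 coupling-free) ⇒ `NormNE9 V W (geomMod ℓ (ω₀ + a))` (strong induction; the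
   renewal identity of §2 closes the step with equality up to the defect), hence NE9 for E with these moduli and
   `FadingMemory (ℓ/(ω₀+a)) (ω₀+a)`.
§4 THE CAUCHY CONSTANTS OF THE STEP MAP (`contracts_of_sum`, `stepTransfer_of_analytic`, `ne9_of_analyticStep`).  If the
   step is `V (j+1) g = Φ j (g_j) (T j g)` with `T j g` = the transported old data, and (AN-LAST) s ↦ Φ j s w is
   complex-analytic on discs of radius r about ]0, γ] with sup bound M₁, (AN-OLD) w ↦ Φ j s w is complex-analytic (Fréchet,
   Banach-valued) on a ϱ-margin of the admissible old data with sup bound M₂, (CONTR) `‖T j g − T j g′‖ ≤ Σ_{m≤j}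
   ω₀^{j−m}‖V m g − V m g′‖` (e.g. `T j g = Σ_m L j m (V m g)` with `L j m` ω₀^{j−m}-Lipschitz: `contracts_of_sum`), then
   `StepTransfer V (Window γ) (4M₁/r) (4M₂/ϱ) ω₀` — `Dimock2015.real_param_lipschitz` and `Dimock2015.norm_sub_le_of_margin`
   BY NAME — and everything above follows with ℓ = 4M₁/r, a = 4M₂/ϱ, μ = ω₀ + 4M₂/ϱ.
§5 `shapes_nonvacuous`: the hypothesis shapes are jointly satisfiable (constant functionals), so no theorem above is
   vacuously true by contradiction.
§6 [v1.3] RELATIVE-RADIUS (DILATION) ANALYTICITY (`CouplingAnalyticRel I E κ M c`: discs of radius c·|s| about s ∈ I;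
   `couplingAnalyticOn_of_rel`; `ne9T_of_couplingAnalyticRel`: over the t-box `[t₀, ∞[` NE9 with UNIFORM moduli 4M/(c·t₀) =
   4Mγ²/c at t₀ = γ⁻²; `ofLog`, `exp_mem_closedBall_of_mem_closedBall`, `ne9Log_of_couplingAnalyticRel`: for the functional
   re-parametrised by u_i = log t_i = −2 log g_i, NE9 over the box `exp⁻¹ I` with γ-FREE moduli 4M/min(1, c/2) — relative
   discs are discs of constant radius in log t (`Complex.norm_exp_sub_one_le`); this is the invariant form of [H-dil] and the
   answer offered to the carver's g-versus-t question: the natural Lipschitz variable of the analytic route is log g).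
§7 [v1.3] THE STEP CAUCHY CONSTANTS OVER A GENERAL BOX (`stepTransfer_of_analyticOn`: `BoxWindow I`, I order-connected,
   base-point dependent last-coupling radius r s ≥ r₀ on I ⇒ `StepTransfer V (BoxWindow I) (4M₁/r₀) (4M₂/ϱ) ω₀`;
   `ne9T_of_dilationStep`: the route END TO END in t with dilation radii r s = c·s on `[t₀, ∞[` ⇒ NE9 ∧ FadingMemory with
   ℓ = 4M₁/(c·t₀), μ = ω₀ + 4M₂/ϱ).  §8 `shapes_nonvacuous₂`.
§9 [v1.4] THE VERTEX g = 0 AND WEIGHTED RELATIVE RADII (`update_mem_boxWindow`, `CoordLipschitzOn`, `coordLipschitzOn_of_ne9`,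
   `ne9_of_coordLipschitz`, `ne9_iff_coordLipschitzOn`: NE9 over a box ⟺ coordinatewise Lipschitz down to the vertex;
   `real_param_lipschitz_relW`: analytic on the relative discs |z − s| ≤ c·s, s ∈ [a, b] ⊂ ]0, ∞[, with ‖·‖ ≤ B·s ⇒
   ‖g a − g b‖ ≤ (8B/min(c,1))|a − b|; `CouplingAnalyticRelW I E κ M c w` (weighted shape), `couplingAnalyticRelW_one_of_rel`,
   `couplingAnalyticRelW_mono`, `couplingAnalyticRelW_lin_of_pow`, `ne9_of_couplingAnalyticRelLin`,
   `ne9Window_of_couplingAnalyticRelLin` (moduli 8M/min(c,1)), `ne9Window_of_couplingAnalyticRelPow` (8Mγ^{p−1}/min(c,1)),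
   `couplingAnalyticOn_of_rel_one_lt` / `ne9Window_of_couplingAnalyticRel_one_lt` (c > 1: uniform radii (c−1)γ);
   `stepTransfer_of_analyticOnW`, `ne9Window_of_dilationStepLin`: the route end to end in the g-WINDOW with a linearly weighted
   last-coupling bound ⇒ NE9 (Window γ) ∧ FadingMemory, ℓ = 8M₁/min(c,1), μ = ω₀ + 4M₂/ϱ).
§10 [v1.4] THE VERTEX OBSTRUCTION (`norm_cos_le_exp_pi`, `vertexModel`, `vertexModel_prefix/decay/rel/not_ne9/ne9Log`,
   `exists_couplingAnalyticRel_not_ne9Window`): kernel no-go at shape level — unweighted relative radii (any c < 1) + the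
   (1.18) shape + prefix dependence do NOT imply the g-form of NE9 for any modulus table, while the same model satisfies the
   log-form of §6.  §11 `shapes_nonvacuous₃`.
§12 [v1.5] EXPLICIT-HISTORY SOURCES (the 𝐑- and boundary kinds): `srcMod` (superposition moduli Σ_{i≤s<j} σ s i·μ^{j−1−s}),
   `srcMod_succ` (renewal recursion), `StepTransferS` (per-slot sources + the damped old-data channel), `aggDisc_stepS`,
   `aggDisc_le_srcMod`, `normNE9_of_stepTransferS`, `ne9_of_stepTransferS`; the WINDOW source of the R-operation `windowSrc ℓ N`
   / `StepTransferN` (`stepTransferN_zero_iff`: N = 0 is `StepTransfer`; `srcMod_windowSrc_zero`: back to `geomMod`),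
   `srcMod_windowSrc_le`, `fadingMemory_windowSrc` (C₉ = ℓ(N+1)/μ^{N+1}, uniform in the scale iff N is fixed),
   `ne9_and_fadingMemory_of_stepTransferN`; GEOMETRIC (strata) sources `geomConv_eq`, `fadingMemory_srcMod_of_geom` (C₉ =
   σ₀/(μ−ν)), `ne9_and_fadingMemory_of_geomSources`; suppliers `norm_sub_le_sum_slots` (telescoping through hybrids),
   `stepTransferS_of_slotLipschitz`, `stepTransferN_of_analyticOn` (Cauchy per window slot in t with dilation radii + exact
   independence below the window + old-data margin), `ne9T_of_dilationStepN` (the window route end to end).  §13 `shapes_nonvacuous₄`.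
§14 [v1.6] (WIN) ON THE KERNEL SIDE — the k-DEPENDENT window ABSORBED into the printed weight: `vwinSrc`, `StepTransferV`
   (`vwinSrc_const` / `stepTransferV_const_iff` = §12 for constant data), `sum_vwinSrc`, `stepTransferS_of_stepTransferV`;
   `vwinSrc_le_geom` (0 ≤ ℓ s ≤ σ₀ν^{N s} ⇒ geometric source), `fadingMemory_vwinSrc` (C₉ = σ₀/(μ−ν), NO dependence on the
   window length), `ne9_and_fadingMemory_of_stepTransferV`; profiles `logWindow_absorbed`, `polyWindow_absorbed`, bridges
   `windowWeight_absorbed_poly/log`; supplier `stepTransferV_of_analyticOn`, `ne9T_of_dilationStepV` (END TO END, uniform in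
   the scale).  §15 `shapes_nonvacuous₅`.

THE WALL, TYPED (what a proof of NE9 ∧ FadingMemory along this route needs and print does not give; cell GAPS G-ne9p1-1..4):
(W1) `CouplingAnalytic` / (AN-LAST) with (j, i)-INDEPENDENT radii — an assumption on the MODIFIED procedure with the p. 266
alternative cut-off (γ_k depends on the physical scale L^kε, the same for the paired steps of the two runs), or, in the printed
scheme (2.9), only in the variable t = 1/g² on a strip (the integrand of (2.10) is entire in the prefactor t_k = 1/g_k² over the
t-independent domain χ_k; a uniform bound on a strip |Im t_k| < τ₀ needs the cluster expansion of [Balaban1988RG2Cluster]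
re-run with a complex phase — NOT PRINTED; in the coupling itself this gives radii ~ τ₀g³/2, moduli ~ g^{−3}, not uniform);
(W1-t) the t-form that the printed scheme can plausibly support (v1.2, (L4)): complex LAST coupling z on |z − g_k| < c·g_k
through [Balaban1988RG2Cluster] §§1–2 at the fixed real cut-off (sizes unchanged since |zB| < (1+c)ε₁; the positivity
shortcut of p. 15 is lost, the "perturbative argument" case remains) PLUS the cut-off insensitivity of E^{(k+1)} in g_k
(small-field tail) — both NOT PRINTED; typed home `ne9_of_couplingAnalyticT`; this is the ONE SUBSTANTIVE wall of the route;
[H-dil] (v1.3, the LOCATED form of (W1-t) by (L5); clause 2 of (W1-t) withdrawn): ∃ absolute c₀ > 0 (with (LM)⁴c₀ ≤ 1) and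
M₁ such that for every k, X ∈ 𝐃_{k+1}, (U, J) ∈ U^c_{k+1}(X, α₀, α₁) and admissible real history, ζ ↦ E^{(k+1)}_ζ(X) — (2.13)
with the five 1/g_k²-terms of (2.10) p. 267 dilated by (1 + ζ) at the real base point (Δ ↦ (1 + ζ)Δ; σ(B′), δ(Q̃(B′)), χ_k and
𝐄_k undilated, (O1)) — is holomorphic on |ζ| < c₀, equals E^{(k+1)}(X) at
the last coupling g_k(1 + ζ)^{−1/2} for real ζ, and |E^{(k+1)}_ζ(X)| ≤ M₁e^{−κd_{k+1}(X)}: INSPECTION-LEVEL by (L5) (c₀ joins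
α₅ of (2.23)), NOT PRINTED as a statement; typed homes `CouplingAnalyticRel` / `ne9T_of_couplingAnalyticRel` /
`ne9Log_of_couplingAnalyticRel` (§6) and (AN-LAST-dil) of `ne9T_of_dilationStep` (§7); with it the whole wall of the route is
inspection-level-but-unprinted ([H-dil], (W2), (W3), (W4)) and none of it is a new idea beyond [Balaban1988RG2Cluster] §2;
(W2) (AN-OLD): analyticity of the step map in the OLD ACTIVITY on a norm ball with a margin — for complex backgrounds this is
what (2.27)(ii) of [Balaban1988Convergent] is proved by; for complex old activities it is INSPECTION-LEVEL by (L4) (linear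
channel (1.33) with modulus bound (1.36), used downstream only through |V| (2.15)) and NOT PRINTED as a statement; (W3) (CONTR) for DIFFERENCES: (0.29) bounds the old renormalised terms themselves at later scales,
not the g_i-differences of their fluctuation differences — same mechanism (fifth-order expansion + Ward identities), NOT
PRINTED; (W4) the smallness `ω₀ + 4M₂/ϱ < 1` — NOT PRINTED as such ([Balaban1987RG1] Thm 3: *"numerous restrictions"*); by (L4) it
is the [Balaban1988RG2Cluster] p. 18 restriction *"2E₀ε₁C₁α₄^{−1}α₆^{−1}M^q exp C₂κ₁ exp 5κ ≤ 1"* read WITHOUT E₀ against the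
needed a < 1 − L^{−α} ((0.30)) — the same inequality up to the unprinted normalisation of the inductive constant E₀ and the
Cauchy factor 4; if it fails, §3 still gives NE9 but with moduli growing like (ω₀ + a)^{j−i}.  The g-versus-t dichotomy (|Δg| ≤ (γ³/2)|Δ(1/g²)| on ]0, γ]: NE9 in g
with bounded moduli is the STRONGER statement; `T4CouplingMatching.disc` is in t) is typed in §1b (v1.2).
(W5) [v1.4] THE VERTEX g = 0 (g-form versus log-form).  (1.18) p. 263 bounds E^{(j)} UNIFORMLY (no power of g: *"There exists
a constant E₀ such that |E^{(j)}(X, g_{j−1}, U, J)| ≤ E₀ exp(−κd_j(X))"*), and UNWEIGHTED relative-disc analyticity ([H-dil] read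
in g: discs |z − g| ≤ c·g, c < 1) yields only the t-form / LOG-form of NE9 (§6) — the g-form over `Window γ` with
history-independent moduli (the shape `T4BetaReadOut.histLipschitz_of_ne9` of unit t4-ne4 consumes, W = `Window γ`) FAILS AT
SHAPE LEVEL: §10, `exists_couplingAnalyticRel_not_ne9Window` — the functional (M/e^π)e^{−κd(X)}cos(log g₀) is prefix-dependent,
obeys the (1.18) shape with constant M and `CouplingAnalyticRel ]0, γ]` for every c < 1, and violates `NE9 E (Window γ) κ Λ`
for EVERY Λ (kernel theorem; negative knowledge about hypothesis shapes, nothing about Bałaban's functionals).  The typed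
missing input is `CoordLipschitzOn ]0, γ] E κ Λ` (§9: coordinatewise Lipschitz dependence on each g_i UNIFORMLY DOWN TO THE
VERTEX; `ne9_iff_coordLipschitzOn`: it is EQUIVALENT to the g-form given prefix dependence, so it is irreducible), for which
print offers (i) p. 263 *"It is a C^∞-function of g_{j−1} ∈ [0, γ], (or analytic), with a positive, absolute γ."* —
qualitative, the LAST coupling only, no bound on the derivative — or (ii) a g-POWER-weighted activity bound, printed for the
R-terms only ([Balaban1988Convergent] (2.31) p. 260: *"|R^{(j)}(X, (U, J))| ≤ g_j^{κ₀} exp(−κd_j(X))"*, *"Here κ₀ can be chosen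
arbitrarily large, similarly as κ, if the other parameters are fixed properly, as in [I]."*) and in the FERMIONIC sibling
([DimockYuan2024GNFlow] Corollary 1, proof: *"consider complex g′_k with |g′_k − g_k| < g_k … analytic here with the bound
‖E_k^*‖ ≤ C_E h^{−½}|g′_k|³ ≤ 8C_E h^{−½}g_k³. Then by a Cauchy inequality the derivative at g_k satisfies ‖∂E_k^*/∂g_k‖ ≤
g_k^{−1}(8C_E h^{−½}g_k³)"*), which §9 turns into the g-form with BOUNDED moduli (`real_param_lipschitz_relW`,
`ne9Window_of_couplingAnalyticRelLin/Pow`, `ne9Window_of_dilationStepLin`: the linear vanishing of the bound at the vertex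
compensates the shrinking radii c·g); for c > 1 (vertex interior) the unweighted shape suffices (`ne9Window_of_couplingAnalyticRel_one_lt`).
NOT PRINTED for Bałaban's E-terms either way (cell GAPS G-ne9p1-8).
(W6) [v1.5] THE WALL PER KIND (𝐑-terms and boundary terms; module section §12, cell record `t4/T4-EST-NE9-P1.md` §12, cell GAPS
G-ne9p1-9..12).  The 𝐄-kind's explicit coupling is the last one ([Balaban1988Convergent] (3.27)/(3.30) pp. 271–272) — walls
[H-dil], (W2)–(W5) as above, window N = 0.  The 𝐑-kind carries the N + 1 couplings of the recent window EXPLICITLY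
([Balaban1989LargeFieldI] (1.2)/(1.6) p. 178, N restricted by (1.94) p. 198) and the coupling FUNCTION of the action on older
nested large-field regions (p. 177 (ii)); the boundary kind carries ALL older couplings explicitly and linearly in the exponent
through `A((1/g_k²(·)) − (1/g_k²), …)` ([Balaban1988Convergent] p. 271, p. 277: supported in Z_k) with (2.24) p. 259.  Typed
missing inputs: [H-dil-N] = [H-dil] jointly in the window's dilation parameters with the weighted bound ([Balaban1989LargeFieldII]
(1.100) p. 390) preserved — inspection-level, NOT PRINTED (home `stepTransferN_of_analyticOn`); (WIN) a FIXED window length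
(`fadingMemory_windowSrc`: C₉ = ℓ(N+1)/μ^{N+1}; a k-dependent N(g_k) is not covered) ⟦v1.6: the printed window IS k-dependent on
BOTH sides ([Balaban1989LargeFieldII] p. 363, [Balaban1989LargeFieldI] pp. 179, 198) and is COVERED by §14: the window term's
printed weight exp(−p₀(g_k)) of (1.100), resp. g_j^{κ₀} of (2.31), ABSORBS ν^{−N(k)} whenever N(k) ≤ A(log g_k^{−2})^v + b with
v < p₀ (resp. ≤ a log log g_k^{−2} + b), with fading memory σ₀/(μ−ν) UNIFORM in the scale (`ne9T_of_dilationStepV`); unprinted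
stays [H-dil-N] WITH the weight⟧; (STRATA) an insertion bound for the old
large-field strata DECAYING IN THEIR AGE (home: the hypothesis `σ s i ≤ σ₀ν^{s−i}` of `fadingMemory_srcMod_of_geom`) — NOT
PRINTED and not inspection-level (p. 277 prints a suppression in the depth into Z_k only); (W2-R/B) the old-data margins of
the s- and t-interpolated expectations of (3.27) (p. 276: *"treated in exactly the same way as 𝐄_k"*) — inspection-level, NOT PRINTED.

CITATION HEADER (lean-in-tree rule 2026-08-18).  Sources quoted: T. Bałaban, *Renormalization group approach to lattice gauge
field theories. I.*, Commun. Math. Phys. **109**, 249–301 (1987) [Balaban1987RG1] (cell paper B12; held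
`paper:balaban1987-cmp109-rg-i-small-field`); T. Bałaban, *Renormalization group approach to lattice gauge field theories.
II.*, Commun. Math. Phys. **116**, 1–22 (1988) [Balaban1988RG2Cluster] (B13); T. Bałaban, *Convergent renormalization
expansions for lattice gauge theories*, Commun. Math. Phys. **119**, 243–285 (1988) [Balaban1988Convergent] (B14); [v1.5]
T. Bałaban, *Large field renormalization. I. The basic step of the R operation*, Commun. Math. Phys. **122**, 175–202 (1989)
[Balaban1989LargeFieldI] (B15); T. Bałaban, *Large field renormalization. II. Localization, exponentiation, and bounds for the
R operation*, Commun. Math. Phys. **122**, 355–392 (1989) [Balaban1989LargeFieldII] (B16) (journal page = PDF page + 174,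
resp. + 354, of the renders `b2b-balaban-ref1/pages/1989-cmp122-large-field-I|II/`; [Balaban1988Convergent]: + 242).  The
Bałaban papers are manuscripts UNDER ADJUDICATION by the audit cell: nothing printed in them is asserted here, and the p. 266
analyticity sentence in particular is NOT used.  Kernel inputs imported BY NAME: `T4OutputRate` (unit pv05-g4, p179034:
`Carriers`, `Functional`, `Window`, `PrefixDependenceOn`, `NE9`, `FadingMemory`), `Dimock2015.AnalyticLipschitz` (template
lineage, p179421: `real_param_lipschitz`, `norm_sub_le_of_margin` — J. Dimock's printed "analyticity implies Lipschitz
continuity" mechanism [Dimock2015], [DimockYuan2024GNFlow], PUBLISHED and outside the audited series).  NEW module of unit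
`b2b-balaban-t4-ne9-p1` (T⁴ fan-out, NE9 prover P1, analytic-dependence route; journal claim T4-U3.E-NE9-PROVE-P1*
2026-08-19T07:04:23Z); imports the two tree modules + Mathlib and modifies nothing.  Sibling seats P2 (inductive-recursion
route, one-step propagation shape) and P3 type the same estimate by other mechanisms; `StepTransfer` here is the full-history
(renewal) form natural for Cauchy constants (`aggDisc_step` is its one-step form), and the carver may merge the bookkeeping.
v1 = p184543 (commit 050e1eee1fae); v1.1 = DOCFIX of two locator sentences (p. 263/264, (W4)) + the bridge lemmas `aggDisc`,
`aggDisc_succ`, `aggDisc_step`, `norm_sub_le_aggDisc`; v1.2 = [Balaban1988RG2Cluster] pp. 9/15/18 located ((L4), (W1-t), (W2),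
(W4) refined) + §1 generalised to box windows (`BoxWindow`, `CouplingAnalyticOn`, `ne9_of_couplingAnalyticOn`; the v1 theorem
`ne9_of_couplingAnalytic` is now its corollary, statement unchanged) + §1b t-coordinates; no earlier declaration's statement changed.
v1.3 (generation 2 of the lineage, journal claim T4-U3.E-NE9-PROVE-P1b* 2026-08-19T07:56:51Z) = (L5) located (B12 p. 266–267,
B13 pp. 12–20: the last coupling is a dilation parameter; (W1-t) clause 2 withdrawn; [H-dil] typed) + §6 relative-radius /
log-coordinate layer + §7 general-box step constants and the dilation end-to-end form + §8; APPEND-ONLY: no v1.2 declaration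
changed.  The BY-NAME bridge to the sibling module `T4HistoryLipschitzRecursion` (`StepTransfer` as the geometric instance of
its `StepLipschitz`/`RenewalSuper` layer, `geomMod ℓ μ = prodModuli ℓ (fun _ ↦ μ)`) is shipped by THAT lineage as a separate
leaf importing both modules (journal 2026-08-19T07:52:24Z); this module imports nothing of it, so no import cycle can arise.
v1.4 (generation 3, journal claim T4-U3.E-NE9-PROVE-P1c*) = DOCFIX of (L5)/[H-dil]/`CouplingAnalyticRel` after XREAD
C-pv05g11-2 (M1/M2: verbatim p. 15 sentences of [Balaban1988RG2Cluster]; O1: only the 1/g_k²-terms of (2.10) dilate; A1: the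
printed scaling sentence *"B = g_kB′"*; A2: the large-field factor is (2.26) p. 17; A3: (2.5) is on p. 12; A4: the index set of
(2.9)) + (W5) + §9 (vertex / weighted relative radii ⇒ the g-form) + §10 (kernel no-go: unweighted relative radii ⇏ the g-form)
+ §11; APPEND-ONLY: no v1.3 declaration's statement changed (docstrings of the module and of `CouplingAnalyticRel` corrected).
v1.5 (generation 5, journal claim T4-U3.E-NE9-PROVE-P1e*) = the PER-KIND reading ([Balaban1988Convergent] pp. 259, 271–272,
276–277; [Balaban1989LargeFieldI] pp. 177–178, 198; [Balaban1989LargeFieldII] p. 390 located: (W6)) + §12 (explicit-history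
sources: superposition moduli, the R-operation's coupling window, geometric strata sources, suppliers, the window route end to
end) + §13; APPEND-ONLY: no v1.4 declaration changed (module docstring extended by §12/(W6)/this line and two sources).
v1.6 (generation 6, journal claim T4-U3.E-NE9-PROVE-P1f*) = DOCFIX after XREAD C-pv14-90 (Q1: (1.2) verbatim, the p. 177
convention quoted OUTSIDE the quotation marks; I1: the p. 276 sentence in full; I2: `windowSrc` off-history remark) and C-pv10-78
R1 (`CouplingAnalyticRelW` weight remark) + the (WIN) CORRECTION (pp. 363/179/175 located; v1.5's "N fixed admissible"
withdrawn) + §14 (absorbed variable window) + §15; APPEND-ONLY: no v1.5 declaration changed (four docstrings amended as listed).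
-/

noncomputable section

open Complex Metric Set
open scoped BigOperators
open Literature.MathematicalPhysics.QuantumFieldTheory.Balaban1983to89.T4OutputRate
open Literature.MathematicalPhysics.QuantumFieldTheory.Dimock2015

namespace Literature.MathematicalPhysics.QuantumFieldTheory.Balaban1983to89.T4CouplingAnalyticity

variable {C : Carriers}

/-! ## §1  Coordinate-disc analyticity ⇒ NE9 with the Cauchy constants as moduli -/

/-- HYPOTHESIS SHAPE (NOT PRINTED; the analytic branch of NE9-CUT, cell GAPS G-t4-U3-4): COORDINATE-DISC ANALYTICITY of the
scale-j term in each preceding coupling with UNIFORM radii.  For every background `U`, domain `X` (j = `scale X`), admissible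
history `h ∈ Window γ` and coordinate `i < j`, the function `s ↦ E(h[i := s], U, X)` on `]0, γ]` has a complex-analytic
extension `F` to a set `D ⊆ ℂ` containing the closed discs of radius `r j i` about every point of `]0, γ]`, with
`‖F‖ ≤ M·e^{−κd_j(X)}` on `D`.  Print: only *"C^∞-function of g_{j−1} ∈ [0, γ], (or analytic)"* (p. 263, last coupling,
no radius) and the p. 266 sentence on the alternative cut-off (no radius, no bound); in the printed scheme (2.9) no
g-independent radius is available (module docstring (L2), (W1)). [cite: Balaban1987RG1, §1 p.263 and §2 p.266] -/
def CouplingAnalytic {Bg : Type} (E : Functional C Bg) (γ κ M : ℝ) (r : ℕ → ℕ → ℝ) : Prop :=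
  ∀ (U : Bg) (X : C.Dom), ∀ h ∈ Window γ, ∀ i < C.scale X,
    ∃ (F : ℂ → ℂ) (D : Set ℂ), DifferentiableOn ℂ F D ∧
      (∀ z ∈ D, ‖F z‖ ≤ M * Real.exp (-(κ * C.d X))) ∧
      (∀ s ∈ Set.Ioc (0 : ℝ) γ, closedBall (s : ℂ) (r (C.scale X) i) ⊆ D) ∧
      (∀ s ∈ Set.Ioc (0 : ℝ) γ, F s = (E (Function.update h i s) U X : ℂ))

/-- The hybrid coupling history: `g′` strictly below `m`, `g` from `m` on (the chain along which one coupling is changed at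
a time). [folklore] -/
def hybrid (g g' : ℕ → ℝ) (m : ℕ) : ℕ → ℝ := fun n => if n < m then g' n else g n

/-- At height 0 the hybrid history is `g`. [folklore] -/
theorem hybrid_zero (g g' : ℕ → ℝ) : hybrid g g' 0 = g := by
  funext n
  simp [hybrid]

/-- The hybrid history of height `m` still carries `g m` at coordinate `m`. [folklore] -/
theorem hybrid_apply_self (g g' : ℕ → ℝ) (m : ℕ) : hybrid g g' m m = g m := by
  simp [hybrid]

/-- Below its height the hybrid history agrees with `g′`. [folklore] -/
theorem hybrid_apply_lt (g g' : ℕ → ℝ) {m n : ℕ} (h : n < m) : hybrid g g' m n = g' n := by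
  simp [hybrid, h]

/-- Re-inserting `g m` at coordinate `m` does not change the hybrid history of height `m`. [folklore] -/
theorem update_hybrid_self (g g' : ℕ → ℝ) (m : ℕ) :
    Function.update (hybrid g g' m) m (g m) = hybrid g g' m := by
  funext n
  rw [Function.update_apply]
  split_ifs with h
  · subst h
    simp [hybrid]
  · rfl

/-- Raising the height by one = updating coordinate `m` to `g′ m`. [folklore] -/
theorem hybrid_succ (g g' : ℕ → ℝ) (m : ℕ) :
    hybrid g g' (m + 1) = Function.update (hybrid g g' m) m (g' m) := by
  funext n
  rw [Function.update_apply]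
  by_cases h : n = m
  · subst h
    simp [hybrid]
  · simp only [hybrid, if_neg h]
    split_ifs with h1 h2 h2 <;> first | rfl | (exfalso; omega)

/-- Hybrids of two admissible histories are admissible (the window is a box). [folklore] -/
theorem hybrid_mem_window {γ : ℝ} {g g' : ℕ → ℝ} (hg : g ∈ Window γ) (hg' : g' ∈ Window γ) (m : ℕ) :
    hybrid g g' m ∈ Window γ := by
  intro n
  by_cases h : n < m
  · rw [hybrid_apply_lt g g' h]
    exact hg' n
  · simp only [hybrid, if_neg h]
    exact hg n

/-- A BOX WINDOW of coupling histories: every coordinate ranges over the same set `I ⊆ ℝ` (`Window γ = BoxWindow ]0, γ]`;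
the t-coordinate window `t_i ≥ t₀` of §1b is `BoxWindow [t₀, ∞[`). [folklore] -/
def BoxWindow (I : Set ℝ) : Set (ℕ → ℝ) := {h | ∀ i, h i ∈ I}

/-- Membership unfolding. [folklore] -/
theorem mem_boxWindow {I : Set ℝ} {h : ℕ → ℝ} : h ∈ BoxWindow I ↔ ∀ i, h i ∈ I := Iff.rfl

/-- The g-window of `T4OutputRate` is the box over `]0, γ]`. [folklore] -/
theorem window_eq_boxWindow (γ : ℝ) : Window γ = BoxWindow (Set.Ioc 0 γ) := rfl

/-- Hybrids of two histories in a box stay in the box. [folklore] -/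
theorem hybrid_mem_boxWindow {I : Set ℝ} {g g' : ℕ → ℝ} (hg : g ∈ BoxWindow I) (hg' : g' ∈ BoxWindow I) (m : ℕ) :
    hybrid g g' m ∈ BoxWindow I := by
  intro n
  by_cases h : n < m
  · rw [hybrid_apply_lt g g' h]
    exact hg' n
  · simp only [hybrid, if_neg h]
    exact hg n

/-- HYPOTHESIS SHAPE, general coordinate set (NOT PRINTED): COORDINATE-DISC ANALYTICITY over the box `BoxWindow I` —
`CouplingAnalytic E γ κ M r` is the case `I = ]0, γ]`; the case `I = [t₀, ∞[` is the t-COORDINATE form (t = 1/g², §1b),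
which is the form the printed small-field scheme (2.9) can plausibly support for the LAST coupling: the representation
(2.12)–(2.13) depends on g_k through `g_k·CB` on the g_k-dependent domain `|B| < ε₁/g_k` ([Balaban1988RG2Cluster] (1.34)
p. 9: *"{B: |B| < ε₁g_k^{−1} on Y}"*), so complex g on a disc of radius PROPORTIONAL to g_k keeps `|zB| < (1+c)ε₁`, and
g-discs of radius `c·g` are t-discs of radius `≍ c·t ≥ c/γ²` — uniform in t (module docstring (L3)/(L4), cell record
`t4/T4-EST-NE9-P1.md` §7). [cite: Balaban1988RG2Cluster, Lemma 1 (1.34) p.9 (the printed g_k-dependent domain); Balaban1987RG1, §1 p.263] -/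
def CouplingAnalyticOn {Bg : Type} (I : Set ℝ) (E : Functional C Bg) (κ M : ℝ) (r : ℕ → ℕ → ℝ) : Prop :=
  ∀ (U : Bg) (X : C.Dom), ∀ h ∈ BoxWindow I, ∀ i < C.scale X,
    ∃ (F : ℂ → ℂ) (D : Set ℂ), DifferentiableOn ℂ F D ∧
      (∀ z ∈ D, ‖F z‖ ≤ M * Real.exp (-(κ * C.d X))) ∧
      (∀ s ∈ I, closedBall (s : ℂ) (r (C.scale X) i) ⊆ D) ∧
      (∀ s ∈ I, F s = (E (Function.update h i s) U X : ℂ))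

/-- `CouplingAnalytic` is `CouplingAnalyticOn ]0, γ]`. [folklore] -/
theorem couplingAnalytic_iff {Bg : Type} (E : Functional C Bg) (γ κ M : ℝ) (r : ℕ → ℕ → ℝ) :
    CouplingAnalytic E γ κ M r ↔ CouplingAnalyticOn (Set.Ioc 0 γ) E κ M r := Iff.rfl

/-- **Coordinate-disc analyticity over a box ⇒ NE9** (general coordinate set `I`, order-connected so that the segment
between two values of a coupling stays in `I`): moduli = the Cauchy constants `4M / r j i`.  Telescoping through the
hybrid histories, prefix dependence for the coordinates `≥ j`, `Dimock2015.real_param_lipschitz` per coordinate.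
[cite: DimockYuan2024GNFlow, proof of Thm 4 (arXiv:2303.07916v3 TeX ll. 4073–4076)] -/
theorem ne9_of_couplingAnalyticOn {Bg : Type} {I : Set ℝ} {E : Functional C Bg} {κ M : ℝ} {r : ℕ → ℕ → ℝ}
    (hI : I.OrdConnected) (hr : ∀ j i, i < j → 0 < r j i) (hP : PrefixDependenceOn E (BoxWindow I))
    (hA : CouplingAnalyticOn I E κ M r) :
    NE9 E (BoxWindow I) κ (fun j i => 4 * M / r j i) := by
  intro g hg g' hg' U X
  set f : ℕ → ℝ := fun m => E (hybrid g g' m) U X with hf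
  have h0 : f 0 = E g U X := by
    simp only [hf, hybrid_zero]
  have hfin : f (C.scale X) = E g' U X := by
    simp only [hf]
    exact hP _ (hybrid_mem_boxWindow hg hg' _) _ hg' U X (fun i hi => hybrid_apply_lt g g' hi)
  have htel : E g U X - E g' U X = ∑ m ∈ Finset.range (C.scale X), (f m - f (m + 1)) := by
    rw [Finset.sum_range_sub', h0, hfin]
  have hstep : ∀ m ∈ Finset.range (C.scale X),
      |f m - f (m + 1)| ≤ Real.exp (-(κ * C.d X)) * (4 * M / r (C.scale X) m * |g m - g' m|) := by
    intro m hm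
    rw [Finset.mem_range] at hm
    obtain ⟨F, D, hF, hFM, hD, hFE⟩ := hA U X (hybrid g g' m) (hybrid_mem_boxWindow hg hg' m) m hm
    have hgm : g m ∈ I := hg m
    have hg'm : g' m ∈ I := hg' m
    have hmin : min (g m) (g' m) ∈ I := by
      rcases min_choice (g m) (g' m) with h | h <;> rw [h] <;> assumption
    have hmax : max (g m) (g' m) ∈ I := by
      rcases max_choice (g m) (g' m) with h | h <;> rw [h] <;> assumption
    have hDab : ∀ s ∈ Icc (min (g m) (g' m)) (max (g m) (g' m)), closedBall (s : ℂ) (r (C.scale X) m) ⊆ D :=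
      fun s hs => hD s (hI.out hmin hmax hs)
    have key := real_param_lipschitz (hr _ _ hm) hF hFM hDab
      (s := g m) (t := g' m) ⟨min_le_left _ _, le_max_left _ _⟩ ⟨min_le_right _ _, le_max_right _ _⟩
    have hFs : F (g m) = (f m : ℂ) := by
      rw [hFE (g m) hgm, update_hybrid_self]
    have hFt : F (g' m) = (f (m + 1) : ℂ) := by
      rw [hFE (g' m) hg'm, ← hybrid_succ]
    rw [hFs, hFt, ← ofReal_sub, norm_real, Real.norm_eq_abs] at key
    calc |f m - f (m + 1)| ≤ 4 * (M * Real.exp (-(κ * C.d X))) / r (C.scale X) m * |g m - g' m| := key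
      _ = Real.exp (-(κ * C.d X)) * (4 * M / r (C.scale X) m * |g m - g' m|) := by ring
  calc |E g U X - E g' U X|
      = |∑ m ∈ Finset.range (C.scale X), (f m - f (m + 1))| := by rw [htel]
    _ ≤ ∑ m ∈ Finset.range (C.scale X), |f m - f (m + 1)| := Finset.abs_sum_le_sum_abs _ _
    _ ≤ ∑ m ∈ Finset.range (C.scale X), Real.exp (-(κ * C.d X)) * (4 * M / r (C.scale X) m * |g m - g' m|) :=
        Finset.sum_le_sum hstep
    _ = Real.exp (-(κ * C.d X)) * ∑ m ∈ Finset.range (C.scale X), 4 * M / r (C.scale X) m * |g m - g' m| := by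
        rw [Finset.mul_sum]

/-- **Coordinate-disc analyticity ⇒ NE9** with the Cauchy constants `4M / r j i` as history moduli: telescoping one
coupling at a time through the hybrid histories (all inside the box `Window γ`), the printed-in-words prefix dependence to
discard the coordinates `≥ j`, and `Dimock2015.real_param_lipschitz` on each coordinate segment.  The moduli are UNIFORM iff
the radii are; NO decay in `j − i` comes out of this (module docstring §1). [cite: DimockYuan2024GNFlow, proof of Thm 4 (arXiv:2303.07916v3 TeX ll. 4073–4076)] -/
theorem ne9_of_couplingAnalytic {Bg : Type} {E : Functional C Bg} {γ κ M : ℝ} {r : ℕ → ℕ → ℝ}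
    (hr : ∀ j i, i < j → 0 < r j i) (hP : PrefixDependenceOn E (Window γ))
    (hA : CouplingAnalytic E γ κ M r) :
    NE9 E (Window γ) κ (fun j i => 4 * M / r j i) :=
  ne9_of_couplingAnalyticOn Set.ordConnected_Ioc hr hP hA

/-! ## §1b  t-coordinates (t = 1/g²): the weaker t-form of NE9 and the box over `[t₀, ∞[` -/

/-- The g ↦ t DICTIONARY on the window: for `0 < g, g′ ≤ γ`, `|g − g′| ≤ (γ³/2)·|g⁻² − g′⁻²|` — a g-Lipschitz functional with
bounded moduli is t-Lipschitz (t = 1/g²) with moduli `× γ³/2`; the converse fails (t-moduli bounded ⇒ g-moduli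
`~ (g+g′)/(g²g′²)`, unbounded as g → 0).  Proof: `g⁻² − g′⁻² = (g′ − g)(g′ + g)/(g²g′²)` and `2g²g′² ≤ γ³(g + g′)`. [folklore] -/
theorem abs_sub_le_of_window {γ g g' : ℝ} (hg : 0 < g) (hgγ : g ≤ γ) (hg' : 0 < g') (hg'γ : g' ≤ γ) :
    |g - g'| ≤ γ ^ 3 / 2 * |(g ^ 2)⁻¹ - (g' ^ 2)⁻¹| := by
  have hg0 : g ≠ 0 := hg.ne'
  have hg'0 : g' ≠ 0 := hg'.ne'
  have key : (g ^ 2)⁻¹ - (g' ^ 2)⁻¹ = (g' - g) * ((g' + g) / (g ^ 2 * g' ^ 2)) := by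
    field_simp
    ring
  have hq : 0 < (g' + g) / (g ^ 2 * g' ^ 2) := by positivity
  rw [key, abs_mul, abs_of_pos hq, abs_sub_comm g' g]
  have ha : g ^ 2 * g' ≤ γ ^ 3 := by
    calc g ^ 2 * g' ≤ γ ^ 2 * γ := mul_le_mul (pow_le_pow_left₀ hg.le hgγ 2) hg'γ hg'.le (by positivity)
      _ = γ ^ 3 := by ring
  have hb : g * g' ^ 2 ≤ γ ^ 3 := by
    calc g * g' ^ 2 ≤ γ * γ ^ 2 := mul_le_mul hgγ (pow_le_pow_left₀ hg'.le hg'γ 2) (by positivity) (hg.le.trans hgγ)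
      _ = γ ^ 3 := by ring
  have h2 : 2 * (g ^ 2 * g' ^ 2) ≤ γ ^ 3 * (g' + g) := by
    nlinarith [mul_le_mul_of_nonneg_right ha hg'.le, mul_le_mul_of_nonneg_right hb hg.le]
  have h1 : 1 ≤ γ ^ 3 / 2 * ((g' + g) / (g ^ 2 * g' ^ 2)) := by
    rw [show γ ^ 3 / 2 * ((g' + g) / (g ^ 2 * g' ^ 2)) = γ ^ 3 * (g' + g) / (2 * (g ^ 2 * g' ^ 2)) by ring,
      one_le_div (by positivity)]
    exact h2
  calc |g - g'| = |g - g'| * 1 := (mul_one _).symm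
    _ ≤ |g - g'| * (γ ^ 3 / 2 * ((g' + g) / (g ^ 2 * g' ^ 2))) := mul_le_mul_of_nonneg_left h1 (abs_nonneg _)
    _ = γ ^ 3 / 2 * (|g - g'| * ((g' + g) / (g ^ 2 * g' ^ 2))) := by ring

/-- The coupling history as a function of the t-history: `g_i = 1/√t_i`. [folklore] -/
def ofT (t : ℕ → ℝ) : ℕ → ℝ := fun i => (Real.sqrt (t i))⁻¹

/-- On the t-window `t_i ≥ γ⁻²` the couplings `1/√t_i` lie in the g-window `]0, γ]`. [folklore] -/
theorem ofT_mem_window {γ : ℝ} (hγ : 0 < γ) {t : ℕ → ℝ} (ht : t ∈ BoxWindow (Set.Ici (γ ^ 2)⁻¹)) :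
    ofT t ∈ Window γ := by
  intro i
  have hti : (γ ^ 2)⁻¹ ≤ t i := ht i
  have htpos : 0 < t i := lt_of_lt_of_le (by positivity) hti
  refine ⟨inv_pos.2 (Real.sqrt_pos.2 htpos), ?_⟩
  have hsq : γ⁻¹ ≤ Real.sqrt (t i) := by
    apply Real.le_sqrt_of_sq_le
    rw [inv_pow]
    exact hti
  calc (Real.sqrt (t i))⁻¹ ≤ (γ⁻¹)⁻¹ := inv_anti₀ (inv_pos.2 hγ) hsq
    _ = γ := inv_inv γ

/-- `(1/√t)⁻² = t` for `t ≥ 0`. [folklore] -/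
theorem ofT_sq_inv {t : ℕ → ℝ} {i : ℕ} (ht : 0 ≤ t i) : ((ofT t i) ^ 2)⁻¹ = t i := by
  simp [ofT, inv_pow, Real.sq_sqrt ht]

/-- **NE9 in g ⇒ NE9 in t** (the WEAKER form the spine's coupling matching, done in t = 1/g², can consume): if `E` obeys
NE9 over the g-window `]0, γ]` with moduli `Λ ≥ 0`, then the re-parametrised functional `t⃗ ↦ E(1/√t⃗)` obeys NE9 over the
t-box `t_i ≥ γ⁻²` with moduli `(γ³/2)·Λ` — same shape `T4OutputRate.NE9` (the window is a parameter of the shape), same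
fading-memory profile. [folklore] -/
theorem ne9_tCoord_of_ne9 {Bg : Type} {E : Functional C Bg} {γ κ : ℝ} {Λ : ℕ → ℕ → ℝ} (hγ : 0 < γ)
    (hΛ : ∀ j i, 0 ≤ Λ j i) (h : NE9 E (Window γ) κ Λ) :
    NE9 (fun t U X => E (ofT t) U X) (BoxWindow (Set.Ici (γ ^ 2)⁻¹)) κ (fun j i => γ ^ 3 / 2 * Λ j i) := by
  intro t ht t' ht' U X
  have hg := ofT_mem_window hγ ht
  have hg' := ofT_mem_window hγ ht'
  refine (h (ofT t) hg (ofT t') hg' U X).trans ?_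
  refine mul_le_mul_of_nonneg_left (Finset.sum_le_sum fun i _ => ?_) (Real.exp_pos _).le
  have hti : 0 ≤ t i := le_trans (by positivity) (ht i)
  have ht'i : 0 ≤ t' i := le_trans (by positivity) (ht' i)
  have hd := abs_sub_le_of_window (hg i).1 (hg i).2 (hg' i).1 (hg' i).2
  rw [ofT_sq_inv hti, ofT_sq_inv ht'i] at hd
  calc Λ (C.scale X) i * |ofT t i - ofT t' i| ≤ Λ (C.scale X) i * (γ ^ 3 / 2 * |t i - t' i|) :=
        mul_le_mul_of_nonneg_left hd (hΛ _ _)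
    _ = γ ^ 3 / 2 * Λ (C.scale X) i * |t i - t' i| := by ring

/-- FadingMemory is stable under the constant factor `γ³/2` of the g ↦ t dictionary. [folklore] -/
theorem fadingMemory_tCoord {C₉ ω γ : ℝ} {Λ : ℕ → ℕ → ℝ} (hγ : 0 ≤ γ) (hΛ : FadingMemory C₉ ω Λ) :
    FadingMemory (γ ^ 3 / 2 * C₉) ω (fun j i => γ ^ 3 / 2 * Λ j i) := by
  intro k i hik
  obtain ⟨h0, h1⟩ := hΛ k i hik
  refine ⟨by positivity, ?_⟩
  calc γ ^ 3 / 2 * Λ k i ≤ γ ^ 3 / 2 * (C₉ * ω ^ (k - i)) := mul_le_mul_of_nonneg_left h1 (by positivity)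
    _ = γ ^ 3 / 2 * C₉ * ω ^ (k - i) := by ring

/-- **Coordinate-disc analyticity IN t over the box `t_i ≥ t₀` ⇒ NE9 in t** — the typed home of the t-form of the
last-coupling wall (W1-t): analyticity of the scale-(k+1) activity in t_k on discs of a t-UNIFORM radius `r` about
`[t₀, ∞[` (available, by inspection of [Balaban1988RG2Cluster] §§1–2 with complex `z = g_k` on `|z − g_k| < c·g_k` at the
fixed real cut-off, iff that inspection goes through — NOT PRINTED — plus the cut-off insensitivity in g_k, NOT PRINTED).
Instance of `ne9_of_couplingAnalyticOn` with `I = [t₀, ∞[`. [cite: Balaban1988RG2Cluster, Lemma 1 (1.33)–(1.36) p.9; (2.15) p.15] -/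
theorem ne9_of_couplingAnalyticT {Bg : Type} {E : Functional C Bg} {t₀ κ M : ℝ} {r : ℕ → ℕ → ℝ}
    (hr : ∀ j i, i < j → 0 < r j i) (hP : PrefixDependenceOn E (BoxWindow (Set.Ici t₀)))
    (hA : CouplingAnalyticOn (Set.Ici t₀) E κ M r) :
    NE9 E (BoxWindow (Set.Ici t₀)) κ (fun j i => 4 * M / r j i) :=
  ne9_of_couplingAnalyticOn Set.ordConnected_Ici hr hP hA

/-! ## §2  The renewal lemma: geometric moduli, the transfer identity, fading memory -/

/-- The GEOMETRIC HISTORY MODULI `geomMod ℓ μ j i = ℓ·μ^{j−1−i}` for `i < j` (and `0` for `i ≥ j`, where NE9 does not look):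
modulus `ℓ` for the last coupling `i = j − 1`, one factor `μ` per further scale. [folklore] -/
def geomMod (ℓ μ : ℝ) (j i : ℕ) : ℝ := if i < j then ℓ * μ ^ (j - 1 - i) else 0

/-- Value on the history coordinates `i < j`. [folklore] -/
theorem geomMod_of_lt (ℓ μ : ℝ) {j i : ℕ} (h : i < j) : geomMod ℓ μ j i = ℓ * μ ^ (j - 1 - i) := if_pos h

/-- Value off the history coordinates. [folklore] -/
theorem geomMod_of_le (ℓ μ : ℝ) {j i : ℕ} (h : j ≤ i) : geomMod ℓ μ j i = 0 := if_neg (not_lt.2 h)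

/-- The last-coupling modulus: `geomMod ℓ μ (i+1) i = ℓ`. [folklore] -/
theorem geomMod_last (ℓ μ : ℝ) (i : ℕ) : geomMod ℓ μ (i + 1) i = ℓ := by
  rw [geomMod_of_lt ℓ μ (Nat.lt_succ_self i)]
  simp

/-- Nonnegativity for `ℓ, μ ≥ 0`. [folklore] -/
theorem geomMod_nonneg {ℓ μ : ℝ} (hℓ : 0 ≤ ℓ) (hμ : 0 ≤ μ) (j i : ℕ) : 0 ≤ geomMod ℓ μ j i := by
  unfold geomMod
  split_ifs
  · positivity
  · exact le_rfl

/-- **Transfer identity** (the renewal recursion solved exactly): with `μ = ω₀ + a`,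
`a·Σ_{m ≤ j} ω₀^{j−m}·geomMod ℓ μ m i = ℓ·(μ^{j−i} − ω₀^{j−i})` for `i ≤ j` — the old-term channel (transfer coefficient `a`,
irrelevance damping `ω₀` per scale between the old term's scale `m` and the new one `j + 1`) reproduces the geometric modulus
`ℓμ^{j−i} = geomMod ℓ μ (j+1) i` up to the defect `ℓω₀^{j−i}`, which the direct last-coupling term fills at `i = j`.
Induction on `j − i`. [folklore] -/
theorem transferSum_geomMod (ℓ a ω₀ : ℝ) {i j : ℕ} (hij : i ≤ j) :
    a * ∑ m ∈ Finset.range (j + 1), ω₀ ^ (j - m) * geomMod ℓ (ω₀ + a) m i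
      = ℓ * ((ω₀ + a) ^ (j - i) - ω₀ ^ (j - i)) := by
  obtain ⟨n, rfl⟩ := Nat.exists_eq_add_of_le hij
  clear hij
  induction n with
  | zero =>
    have hzero : ∀ m ∈ Finset.range (i + 0 + 1), ω₀ ^ (i + 0 - m) * geomMod ℓ (ω₀ + a) m i = 0 := by
      intro m hm
      rw [Finset.mem_range] at hm
      rw [geomMod_of_le ℓ (ω₀ + a) (by omega), mul_zero]
    rw [Finset.sum_eq_zero hzero]
    simp
  | succ n ih =>
    have hsplit : ∑ m ∈ Finset.range (i + (n + 1) + 1), ω₀ ^ (i + (n + 1) - m) * geomMod ℓ (ω₀ + a) m i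
        = ω₀ * ∑ m ∈ Finset.range (i + n + 1), ω₀ ^ (i + n - m) * geomMod ℓ (ω₀ + a) m i
          + ℓ * (ω₀ + a) ^ n := by
      rw [show i + (n + 1) + 1 = (i + n + 1) + 1 by ring, Finset.sum_range_succ]
      congr 1
      · rw [Finset.mul_sum]
        refine Finset.sum_congr rfl fun m hm => ?_
        rw [Finset.mem_range] at hm
        rw [show i + (n + 1) - m = (i + n - m) + 1 by omega, pow_succ]
        ring
      · rw [show i + (n + 1) - (i + n + 1) = 0 by omega, pow_zero, one_mul,
          geomMod_of_lt ℓ (ω₀ + a) (by omega), show i + n + 1 - 1 - i = n by omega]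
    rw [hsplit, mul_add, ← mul_assoc, mul_comm a ω₀, mul_assoc, ih,
      show i + (n + 1) - i = n + 1 by omega, show i + n - i = n by omega, pow_succ, pow_succ]
    ring

/-- **Fading memory of the geometric moduli**: `FadingMemory (ℓ/μ) μ (geomMod ℓ μ)` for `ℓ ≥ 0`, `μ > 0` (for `i < j`,
`ℓμ^{j−1−i} = (ℓ/μ)μ^{j−i}`; the diagonal carries `0 ≤ ℓ/μ`).  Decay in the consumer's sense
(`T4OutputRate.historySum_le_of_fadingMemory`) needs `μ < 1` IN ADDITION — the route's smallness condition (W4).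
[folklore] -/
theorem fadingMemory_geomMod {ℓ μ : ℝ} (hℓ : 0 ≤ ℓ) (hμ : 0 < μ) : FadingMemory (ℓ / μ) μ (geomMod ℓ μ) := by
  intro k i hik
  refine ⟨geomMod_nonneg hℓ hμ.le k i, ?_⟩
  by_cases h : i < k
  · rw [geomMod_of_lt ℓ μ h, show k - i = (k - 1 - i) + 1 by omega, pow_succ]
    have hne : μ ≠ 0 := hμ.ne'
    have heq : ℓ / μ * (μ ^ (k - 1 - i) * μ) = ℓ * μ ^ (k - 1 - i) := by
      rw [div_mul_eq_mul_div, div_eq_iff hne]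
      ring
    exact heq.symm.le
  · rw [geomMod_of_le ℓ μ (not_lt.1 h)]
    positivity

/-! ## §3  Norm-level step transfer ⇒ NE9 with geometric moduli -/

section NormLevel

variable {F : Type*} [SeminormedAddCommGroup F]

/-- HYPOTHESIS / CONCLUSION SHAPE at the norm level: the scale-j ACTIVITY `V j g` (an element of an abstract seminormed group
standing for the weighted space of (0.25)) depends on the admissible history with history moduli `Λ j i`, jointly:
`‖V j g − V j g′‖ ≤ Σ_{i<j} Λ j i |g_i − g′_i|`.  NE9 for the evaluated functional follows (`ne9_of_normNE9`). NOT PRINTED.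
[cite: Balaban1987RG1, §0 p.256 and (0.25) p.257] -/
def NormNE9 (V : ℕ → (ℕ → ℝ) → F) (W : Set (ℕ → ℝ)) (Λ : ℕ → ℕ → ℝ) : Prop :=
  ∀ j, ∀ g ∈ W, ∀ g' ∈ W, ‖V j g - V j g'‖ ≤ ∑ i ∈ Finset.range j, Λ j i * |g i - g' i|

/-- HYPOTHESIS SHAPE `StepTransfer` (NOT PRINTED; the typed form of the located structure (L1) + the irrelevance contraction
(0.29)): the activity born at step `j + 1` depends on the LAST coupling `g_j` with modulus `ℓ` and on the OLD activities
`V m`, `m ≤ j`, with TRANSFER COEFFICIENT `a` damped by `ω₀^{j−m}`: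
`‖V (j+1) g − V (j+1) g′‖ ≤ ℓ|g_j − g′_j| + a·Σ_{m≤j} ω₀^{j−m}‖V m g − V m g′‖`.  On the analytic route `ℓ` and `a` are
Cauchy constants (§4 `stepTransfer_of_analytic`). [cite: Balaban1987RG1, (2.12)-(2.13) p.268 and (0.29) p.258] -/
def StepTransfer (V : ℕ → (ℕ → ℝ) → F) (W : Set (ℕ → ℝ)) (ℓ a ω₀ : ℝ) : Prop :=
  ∀ j, ∀ g ∈ W, ∀ g' ∈ W,
    ‖V (j + 1) g - V (j + 1) g'‖ ≤
      ℓ * |g j - g' j| + a * ∑ m ∈ Finset.range (j + 1), ω₀ ^ (j - m) * ‖V m g - V m g'‖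

/-- Off-support extension of a history sum with geometric moduli: for `m ≤ N` the sum over `i < m` equals the sum over
`i < N` (the added moduli vanish). [folklore] -/
theorem sum_geomMod_extend (ℓ μ : ℝ) (c : ℕ → ℝ) {m N : ℕ} (h : m ≤ N) :
    ∑ i ∈ Finset.range m, geomMod ℓ μ m i * c i = ∑ i ∈ Finset.range N, geomMod ℓ μ m i * c i := by
  refine Finset.sum_subset (Finset.range_subset_range.2 h) fun i _ hi => ?_
  rw [Finset.mem_range, not_lt] at hi
  rw [geomMod_of_le ℓ μ hi, zero_mul]

/-- **Step transfer ⇒ norm-level NE9 with geometric moduli** `geomMod ℓ (ω₀ + a)`: strong induction on the scale; in the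
step, the old-term channel is bounded through the induction hypothesis and summed with the transfer identity
`transferSum_geomMod`, and the direct last-coupling term fills the defect `ℓω₀^{0} = ℓ` at `i = j`.  Requires the scale-0
activity to be coupling-free (it depends on no coupling: `Finset.range 0 = ∅`). [folklore] -/
theorem normNE9_of_stepTransfer {V : ℕ → (ℕ → ℝ) → F} {W : Set (ℕ → ℝ)} {ℓ a ω₀ : ℝ}
    (hℓ : 0 ≤ ℓ) (ha : 0 ≤ a) (hω : 0 ≤ ω₀)
    (h0 : ∀ g ∈ W, ∀ g' ∈ W, V 0 g = V 0 g') (hstep : StepTransfer V W ℓ a ω₀) :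
    NormNE9 V W (geomMod ℓ (ω₀ + a)) := by
  set μ := ω₀ + a with hμ
  intro j
  induction' j using Nat.strong_induction_on with j ih
  intro g hg g' hg'
  cases j with
  | zero =>
    rw [h0 g hg g' hg', sub_self, norm_zero, Finset.sum_range_zero]
  | succ j =>
    -- abbreviations
    set δ : ℕ → ℝ := fun i => |g i - g' i| with hδ
    have hδ0 : ∀ i, 0 ≤ δ i := fun i => abs_nonneg _
    -- induction hypothesis, extended to the rectangle i < j + 1
    have hIH : ∀ m ∈ Finset.range (j + 1),
        ‖V m g - V m g'‖ ≤ ∑ i ∈ Finset.range (j + 1), geomMod ℓ μ m i * δ i := by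
      intro m hm
      rw [Finset.mem_range] at hm
      rw [← sum_geomMod_extend ℓ μ δ hm.le]
      exact ih m hm g hg g' hg'
    -- the old-term channel
    have hold : a * ∑ m ∈ Finset.range (j + 1), ω₀ ^ (j - m) * ‖V m g - V m g'‖
        ≤ ∑ i ∈ Finset.range (j + 1), ℓ * (μ ^ (j - i) - ω₀ ^ (j - i)) * δ i := by
      calc a * ∑ m ∈ Finset.range (j + 1), ω₀ ^ (j - m) * ‖V m g - V m g'‖
          ≤ a * ∑ m ∈ Finset.range (j + 1), ω₀ ^ (j - m) * ∑ i ∈ Finset.range (j + 1), geomMod ℓ μ m i * δ i := by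
            refine mul_le_mul_of_nonneg_left (Finset.sum_le_sum fun m hm => ?_) ha
            exact mul_le_mul_of_nonneg_left (hIH m hm) (pow_nonneg hω _)
        _ = ∑ i ∈ Finset.range (j + 1),
              (a * ∑ m ∈ Finset.range (j + 1), ω₀ ^ (j - m) * geomMod ℓ μ m i) * δ i := by
            simp_rw [Finset.mul_sum, Finset.sum_mul]
            rw [Finset.sum_comm]
            refine Finset.sum_congr rfl fun i _ => Finset.sum_congr rfl fun m _ => ?_
            ring
        _ = ∑ i ∈ Finset.range (j + 1), ℓ * (μ ^ (j - i) - ω₀ ^ (j - i)) * δ i := by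
            refine Finset.sum_congr rfl fun i hi => ?_
            rw [Finset.mem_range] at hi
            rw [hμ, transferSum_geomMod ℓ a ω₀ (Nat.le_of_lt_succ hi)]
    -- the direct last-coupling term fills the defect at i = j
    have hlast : ℓ * δ j ≤ ∑ i ∈ Finset.range (j + 1), ℓ * ω₀ ^ (j - i) * δ i := by
      have hmem : j ∈ Finset.range (j + 1) := Finset.self_mem_range_succ j
      have h := Finset.single_le_sum (f := fun i => ℓ * ω₀ ^ (j - i) * δ i)
        (fun i _ => mul_nonneg (mul_nonneg hℓ (pow_nonneg hω _)) (hδ0 i)) hmem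
      simpa using h
    -- assemble
    have hgoal : ∑ i ∈ Finset.range (j + 1), geomMod ℓ μ (j + 1) i * δ i
        = ∑ i ∈ Finset.range (j + 1), ℓ * ω₀ ^ (j - i) * δ i
          + ∑ i ∈ Finset.range (j + 1), ℓ * (μ ^ (j - i) - ω₀ ^ (j - i)) * δ i := by
      rw [← Finset.sum_add_distrib]
      refine Finset.sum_congr rfl fun i hi => ?_
      rw [Finset.mem_range] at hi
      rw [geomMod_of_lt ℓ μ hi, show j + 1 - 1 - i = j - i by omega]
      ring
    calc ‖V (j + 1) g - V (j + 1) g'‖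
        ≤ ℓ * |g j - g' j| + a * ∑ m ∈ Finset.range (j + 1), ω₀ ^ (j - m) * ‖V m g - V m g'‖ :=
          hstep j g hg g' hg'
      _ ≤ ∑ i ∈ Finset.range (j + 1), ℓ * ω₀ ^ (j - i) * δ i
          + ∑ i ∈ Finset.range (j + 1), ℓ * (μ ^ (j - i) - ω₀ ^ (j - i)) * δ i := add_le_add hlast hold
      _ = ∑ i ∈ Finset.range (j + 1), geomMod ℓ μ (j + 1) i * δ i := hgoal.symm
      _ = ∑ i ∈ Finset.range (j + 1), geomMod ℓ μ (j + 1) i * |g i - g' i| := rfl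

/-- **Norm level ⇒ functional level**: if the functional is an evaluation of the activity, `E g U X = ev (V (scale X) g) U X`,
through a map that is `e^{−κd(X)}`-Lipschitz in the activity (evaluation in a weighted sup-norm space, (0.25)), then
`NormNE9 V W Λ` gives `T4OutputRate.NE9 E W κ Λ`. [cite: Balaban1987RG1, (0.24)-(0.25) p.257] -/
theorem ne9_of_normNE9 {Bg : Type} {E : Functional C Bg} {V : ℕ → (ℕ → ℝ) → F} {W : Set (ℕ → ℝ)} {κ : ℝ}
    {Λ : ℕ → ℕ → ℝ} (ev : F → Bg → C.Dom → ℝ)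
    (hev : ∀ (b b' : F) (U : Bg) (X : C.Dom), |ev b U X - ev b' U X| ≤ Real.exp (-(κ * C.d X)) * ‖b - b'‖)
    (hE : ∀ g ∈ W, ∀ (U : Bg) (X : C.Dom), E g U X = ev (V (C.scale X) g) U X) (hV : NormNE9 V W Λ) :
    NE9 E W κ Λ := by
  intro g hg g' hg' U X
  rw [hE g hg U X, hE g' hg' U X]
  calc |ev (V (C.scale X) g) U X - ev (V (C.scale X) g') U X|
      ≤ Real.exp (-(κ * C.d X)) * ‖V (C.scale X) g - V (C.scale X) g'‖ := hev _ _ U X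
    _ ≤ Real.exp (-(κ * C.d X)) * ∑ i ∈ Finset.range (C.scale X), Λ (C.scale X) i * |g i - g' i| :=
        mul_le_mul_of_nonneg_left (hV _ g hg g' hg') (Real.exp_pos _).le

/-- **The reduction of NE9 ∧ FadingMemory to the step transfer inequality** (this module's main bookkeeping statement):
`StepTransfer V W ℓ a ω₀` (+ coupling-free scale-0 activity, + evaluation) gives `NE9 E W κ (geomMod ℓ μ)` AND
`FadingMemory (ℓ/μ) μ (geomMod ℓ μ)` with `μ = ω₀ + a` — fading memory FROM THE CONTRACTION `ω₀` and the transfer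
coefficient `a`, meaningful (`μ < 1`) exactly under the smallness (W4).  NOT PRINTED; NOT summit progress. [folklore] -/
theorem ne9_and_fadingMemory_of_stepTransfer {Bg : Type} {E : Functional C Bg} {V : ℕ → (ℕ → ℝ) → F}
    {W : Set (ℕ → ℝ)} {κ ℓ a ω₀ : ℝ} (ev : F → Bg → C.Dom → ℝ)
    (hev : ∀ (b b' : F) (U : Bg) (X : C.Dom), |ev b U X - ev b' U X| ≤ Real.exp (-(κ * C.d X)) * ‖b - b'‖)
    (hE : ∀ g ∈ W, ∀ (U : Bg) (X : C.Dom), E g U X = ev (V (C.scale X) g) U X)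
    (hℓ : 0 ≤ ℓ) (ha : 0 ≤ a) (hω : 0 ≤ ω₀) (hμ : 0 < ω₀ + a)
    (h0 : ∀ g ∈ W, ∀ g' ∈ W, V 0 g = V 0 g') (hstep : StepTransfer V W ℓ a ω₀) :
    NE9 E W κ (geomMod ℓ (ω₀ + a)) ∧ FadingMemory (ℓ / (ω₀ + a)) (ω₀ + a) (geomMod ℓ (ω₀ + a)) :=
  ⟨ne9_of_normNE9 ev hev hE (normNE9_of_stepTransfer hℓ ha hω h0 hstep), fadingMemory_geomMod hℓ hμ⟩

/-- (CONTR) from a sum of contractions: if the transported old data are `T j g = Σ_{m≤j} L j m (V m g)` with `L j m`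
`ω₀^{j−m}`-Lipschitz (the typed irrelevance damping of an old term's fluctuation difference, (0.29)-type; NOT PRINTED for
differences, (W3)), then `‖T j g − T j g′‖ ≤ Σ_{m≤j} ω₀^{j−m}‖V m g − V m g′‖`. [cite: Balaban1987RG1, (0.29)-(0.30) p.258] -/
theorem contracts_of_sum {G : Type*} [SeminormedAddCommGroup G] {V : ℕ → (ℕ → ℝ) → G} {T : ℕ → (ℕ → ℝ) → F}
    {W : Set (ℕ → ℝ)} {ω₀ : ℝ} (L : ℕ → ℕ → G → F)
    (hT : ∀ j, ∀ g ∈ W, T j g = ∑ m ∈ Finset.range (j + 1), L j m (V m g))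
    (hL : ∀ j m (b b' : G), ‖L j m b - L j m b'‖ ≤ ω₀ ^ (j - m) * ‖b - b'‖) :
    ∀ j, ∀ g ∈ W, ∀ g' ∈ W, ‖T j g - T j g'‖ ≤ ∑ m ∈ Finset.range (j + 1), ω₀ ^ (j - m) * ‖V m g - V m g'‖ := by
  intro j g hg g' hg'
  rw [hT j g hg, hT j g' hg', ← Finset.sum_sub_distrib]
  exact (norm_sum_le _ _).trans (Finset.sum_le_sum fun m _ => hL j m _ _)

/-- The AGGREGATED DISCREPANCY `aggDisc V ω₀ j g g′ = Σ_{m≤j} ω₀^{j−m}‖V m g − V m g′‖`: the old-term channel of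
`StepTransfer` (all old activities, each damped by the irrelevance factor per scale). [folklore] -/
def aggDisc (V : ℕ → (ℕ → ℝ) → F) (ω₀ : ℝ) (j : ℕ) (g g' : ℕ → ℝ) : ℝ :=
  ∑ m ∈ Finset.range (j + 1), ω₀ ^ (j - m) * ‖V m g - V m g'‖

/-- One more scale = damp the aggregate once and add the newborn discrepancy. [folklore] -/
theorem aggDisc_succ (V : ℕ → (ℕ → ℝ) → F) (ω₀ : ℝ) (j : ℕ) (g g' : ℕ → ℝ) :
    aggDisc V ω₀ (j + 1) g g' = ω₀ * aggDisc V ω₀ j g g' + ‖V (j + 1) g - V (j + 1) g'‖ := by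
  unfold aggDisc
  rw [Finset.sum_range_succ, Nat.sub_self, pow_zero, one_mul, Finset.mul_sum]
  congr 1
  refine Finset.sum_congr rfl fun m hm => ?_
  rw [Finset.mem_range] at hm
  rw [show j + 1 - m = (j - m) + 1 by omega, pow_succ]
  ring

/-- **ONE-STEP (propagation) FORM of the renewal inequality** — the bridge to the inductive-recursion typing of NE9
(sibling seat P2, one-step shape): `StepTransfer V W ℓ a ω₀` implies
`aggDisc (j+1) ≤ (ω₀ + a)·aggDisc j + ℓ|g_j − g′_j|`, i.e. the aggregated discrepancy propagates with the ONE rate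
`μ = ω₀ + a` plus the last-coupling source; both typings therefore produce the same geometric moduli. [folklore] -/
theorem aggDisc_step {V : ℕ → (ℕ → ℝ) → F} {W : Set (ℕ → ℝ)} {ℓ a ω₀ : ℝ} (hstep : StepTransfer V W ℓ a ω₀)
    (j : ℕ) {g g' : ℕ → ℝ} (hg : g ∈ W) (hg' : g' ∈ W) :
    aggDisc V ω₀ (j + 1) g g' ≤ (ω₀ + a) * aggDisc V ω₀ j g g' + ℓ * |g j - g' j| := by
  rw [aggDisc_succ, add_mul]
  have h := hstep j g hg g' hg'
  change ‖V (j + 1) g - V (j + 1) g'‖ ≤ ℓ * |g j - g' j| + a * aggDisc V ω₀ j g g' at h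
  linarith

/-- The norm-level NE9 bound is dominated by the aggregate: `‖V j g − V j g′‖ ≤ aggDisc V ω₀ j g g′` for `ω₀ ≥ 0`
(the `m = j` term). [folklore] -/
theorem norm_sub_le_aggDisc (V : ℕ → (ℕ → ℝ) → F) {ω₀ : ℝ} (hω : 0 ≤ ω₀) (j : ℕ) (g g' : ℕ → ℝ) :
    ‖V j g - V j g'‖ ≤ aggDisc V ω₀ j g g' := by
  unfold aggDisc
  have h := Finset.single_le_sum (f := fun m => ω₀ ^ (j - m) * ‖V m g - V m g'‖)
    (fun m _ => mul_nonneg (pow_nonneg hω _) (norm_nonneg _)) (Finset.self_mem_range_succ j)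
  simpa using h

end NormLevel

/-! ## §4  The Cauchy constants of the step map (the analytic route proper) -/

section Analytic

variable {F : Type*} [NormedAddCommGroup F] [NormedSpace ℂ F] [CompleteSpace F]

/-- **The Cauchy constants of the step map ⇒ StepTransfer** (the analytic route proper).  The step is
`V (j+1) g = Φ j (g_j) (T j g)` (new activity = step map applied to the last coupling and the transported old data).
(AN-LAST): for every admissible `g`, `s ↦ Φ j s (T j g)` is complex differentiable on a set containing the closed `r`-discs
about `]0, γ]`, with `‖·‖ ≤ M₁` there; (AN-OLD): for every `s ∈ ]0, γ]`, `w ↦ Φ j s w` is complex (Fréchet) differentiable on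
a set containing the closed `ϱ`-balls about the admissible old data, with `‖·‖ ≤ M₂` there; (CONTR) as in
`contracts_of_sum`.  Then `StepTransfer V (Window γ) (4M₁/r) (4M₂/ϱ) ω₀` — one triangle inequality,
`Dimock2015.real_param_lipschitz` for the last coupling and `Dimock2015.norm_sub_le_of_margin` for the old data.  The three
hypotheses are NOT PRINTED for Bałaban's step ((W1)–(W3)); the mechanism is Dimock's printed one.
[cite: Dimock2015, Sect. 7 proof of Lemma 25 (arXiv:1512.04373 TeX ll. 5647–5679)] -/
theorem stepTransfer_of_analytic {V : ℕ → (ℕ → ℝ) → F} {γ : ℝ} (T : ℕ → (ℕ → ℝ) → F) (Φ : ℕ → ℂ → F → F)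
    {M₁ r M₂ ϱ ω₀ : ℝ} (hr : 0 < r) (hϱ : 0 < ϱ)
    (hV : ∀ j, ∀ g ∈ Window γ, V (j + 1) g = Φ j (g j : ℂ) (T j g))
    (hlast : ∀ j, ∀ g ∈ Window γ, ∃ D : Set ℂ, DifferentiableOn ℂ (fun s => Φ j s (T j g)) D ∧
      (∀ z ∈ D, ‖Φ j z (T j g)‖ ≤ M₁) ∧ ∀ s ∈ Set.Ioc (0 : ℝ) γ, closedBall (s : ℂ) r ⊆ D)
    (hold : ∀ j, ∀ s ∈ Set.Ioc (0 : ℝ) γ, ∃ D : Set F, DifferentiableOn ℂ (Φ j (s : ℂ)) D ∧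
      (∀ w ∈ D, ‖Φ j (s : ℂ) w‖ ≤ M₂) ∧ ∀ g ∈ Window γ, closedBall (T j g) ϱ ⊆ D)
    (hT : ∀ j, ∀ g ∈ Window γ, ∀ g' ∈ Window γ,
      ‖T j g - T j g'‖ ≤ ∑ m ∈ Finset.range (j + 1), ω₀ ^ (j - m) * ‖V m g - V m g'‖) :
    StepTransfer V (Window γ) (4 * M₁ / r) (4 * M₂ / ϱ) ω₀ := by
  intro j g hg g' hg'
  have hgj : g j ∈ Set.Ioc (0 : ℝ) γ := ⟨(hg j).1, (hg j).2⟩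
  have hg'j : g' j ∈ Set.Ioc (0 : ℝ) γ := ⟨(hg' j).1, (hg' j).2⟩
  -- last coupling: Cauchy on the coordinate disc, at the old datum T j g
  have h1 : ‖Φ j (g j : ℂ) (T j g) - Φ j (g' j : ℂ) (T j g)‖ ≤ 4 * M₁ / r * |g j - g' j| := by
    obtain ⟨D, hD, hM, hdisc⟩ := hlast j g hg
    have hDab : ∀ s ∈ Icc (min (g j) (g' j)) (max (g j) (g' j)), closedBall (s : ℂ) r ⊆ D := by
      intro s hs
      refine hdisc s ⟨?_, ?_⟩
      · exact lt_of_lt_of_le (lt_min hgj.1 hg'j.1) hs.1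
      · exact hs.2.trans (max_le hgj.2 hg'j.2)
    exact real_param_lipschitz (g := fun s => Φ j s (T j g)) hr hD hM hDab
      ⟨min_le_left _ _, le_max_left _ _⟩ ⟨min_le_right _ _, le_max_right _ _⟩
  -- old data: Cauchy on the ϱ-margin of the admissible old data, at the last coupling g' j
  have h2 : ‖Φ j (g' j : ℂ) (T j g) - Φ j (g' j : ℂ) (T j g')‖ ≤ 4 * M₂ / ϱ * ‖T j g - T j g'‖ := by
    obtain ⟨D, hD, hM, hball⟩ := hold j (g' j) hg'j
    have hS : ∀ y ∈ (fun h : ℕ → ℝ => T j h) '' Window γ, closedBall y ϱ ⊆ D := by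
      rintro _ ⟨h, hh, rfl⟩
      exact hball h hh
    exact norm_sub_le_of_margin hϱ hD hM hS (mem_image_of_mem _ hg) (mem_image_of_mem _ hg')
  have hM₂ : 0 ≤ M₂ := by
    obtain ⟨D, _, hM, hball⟩ := hold j (g' j) hg'j
    exact (norm_nonneg _).trans (hM _ (hball g hg (mem_closedBall_self hϱ.le)))
  rw [hV j g hg, hV j g' hg']
  calc ‖Φ j (g j : ℂ) (T j g) - Φ j (g' j : ℂ) (T j g')‖
      ≤ ‖Φ j (g j : ℂ) (T j g) - Φ j (g' j : ℂ) (T j g)‖ + ‖Φ j (g' j : ℂ) (T j g) - Φ j (g' j : ℂ) (T j g')‖ :=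
        norm_sub_le_norm_sub_add_norm_sub _ _ _
    _ ≤ 4 * M₁ / r * |g j - g' j| + 4 * M₂ / ϱ * ‖T j g - T j g'‖ := add_le_add h1 h2
    _ ≤ 4 * M₁ / r * |g j - g' j|
          + 4 * M₂ / ϱ * ∑ m ∈ Finset.range (j + 1), ω₀ ^ (j - m) * ‖V m g - V m g'‖ :=
        add_le_add le_rfl (mul_le_mul_of_nonneg_left (hT j g hg g' hg') (by positivity))

/-- **The analytic route, end to end**: (AN-LAST) + (AN-OLD) + (CONTR) + coupling-free scale-0 activity + evaluation + the
smallness-free positivity `0 < ω₀ + 4M₂/ϱ` give `NE9 E (Window γ) κ (geomMod ℓ μ)` and `FadingMemory (ℓ/μ) μ (geomMod ℓ μ)`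
with `ℓ = 4M₁/r`, `μ = ω₀ + 4M₂/ϱ` — every constant explicit; the consumer's decay needs `μ < 1` (W4).  NOT PRINTED for
Bałaban's functionals; NOT summit progress. [cite: DimockYuan2024GNFlow, proof of Thm 4 (arXiv:2303.07916v3 TeX ll. 4073–4076)] -/
theorem ne9_of_analyticStep {Bg : Type} {E : Functional C Bg} {V : ℕ → (ℕ → ℝ) → F} {γ κ : ℝ}
    (T : ℕ → (ℕ → ℝ) → F) (Φ : ℕ → ℂ → F → F) (ev : F → Bg → C.Dom → ℝ)
    {M₁ r M₂ ϱ ω₀ : ℝ} (hr : 0 < r) (hϱ : 0 < ϱ) (hM₁ : 0 ≤ M₁) (hM₂ : 0 ≤ M₂) (hω : 0 ≤ ω₀)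
    (hμ : 0 < ω₀ + 4 * M₂ / ϱ)
    (hev : ∀ (b b' : F) (U : Bg) (X : C.Dom), |ev b U X - ev b' U X| ≤ Real.exp (-(κ * C.d X)) * ‖b - b'‖)
    (hE : ∀ g ∈ Window γ, ∀ (U : Bg) (X : C.Dom), E g U X = ev (V (C.scale X) g) U X)
    (h0 : ∀ g ∈ Window γ, ∀ g' ∈ Window γ, V 0 g = V 0 g')
    (hV : ∀ j, ∀ g ∈ Window γ, V (j + 1) g = Φ j (g j : ℂ) (T j g))
    (hlast : ∀ j, ∀ g ∈ Window γ, ∃ D : Set ℂ, DifferentiableOn ℂ (fun s => Φ j s (T j g)) D ∧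
      (∀ z ∈ D, ‖Φ j z (T j g)‖ ≤ M₁) ∧ ∀ s ∈ Set.Ioc (0 : ℝ) γ, closedBall (s : ℂ) r ⊆ D)
    (hold : ∀ j, ∀ s ∈ Set.Ioc (0 : ℝ) γ, ∃ D : Set F, DifferentiableOn ℂ (Φ j (s : ℂ)) D ∧
      (∀ w ∈ D, ‖Φ j (s : ℂ) w‖ ≤ M₂) ∧ ∀ g ∈ Window γ, closedBall (T j g) ϱ ⊆ D)
    (hT : ∀ j, ∀ g ∈ Window γ, ∀ g' ∈ Window γ,
      ‖T j g - T j g'‖ ≤ ∑ m ∈ Finset.range (j + 1), ω₀ ^ (j - m) * ‖V m g - V m g'‖) :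
    NE9 E (Window γ) κ (geomMod (4 * M₁ / r) (ω₀ + 4 * M₂ / ϱ)) ∧
      FadingMemory (4 * M₁ / r / (ω₀ + 4 * M₂ / ϱ)) (ω₀ + 4 * M₂ / ϱ)
        (geomMod (4 * M₁ / r) (ω₀ + 4 * M₂ / ϱ)) := by
  have hstep := stepTransfer_of_analytic T Φ hr hϱ hV hlast hold hT
  have ha : 0 ≤ 4 * M₂ / ϱ := by positivity
  exact ne9_and_fadingMemory_of_stepTransfer ev hev hE (by positivity) ha hω hμ h0 hstep

end Analytic

/-! ## §5  Non-vacuity -/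

/-- The hypothesis shapes of §§1–4 are jointly satisfiable (a coupling-free functional / activity: zero moduli, any radii),
so none of the implications above holds by contradiction. [folklore] -/
theorem shapes_nonvacuous (C : Carriers) (Bg : Type) (γ κ : ℝ) :
    ∃ E : Functional C Bg, CouplingAnalytic E γ κ 0 (fun _ _ => 1) ∧ PrefixDependenceOn E (Window γ) ∧
      NE9 E (Window γ) κ (geomMod 0 1) ∧ FadingMemory 0 1 (geomMod 0 1) := by
  refine ⟨fun _ _ _ => 0, ?_, ?_, ?_, ?_⟩
  · intro U X h _ i _
    refine ⟨fun _ => 0, Set.univ, differentiableOn_const 0, fun z _ => by simp, fun s _ => subset_univ _, fun s _ => by simp⟩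
  · intro g _ g' _ U X _
    rfl
  · intro g _ g' _ U X
    simp only [sub_self, abs_zero]
    exact mul_nonneg (Real.exp_pos _).le
      (Finset.sum_nonneg fun i _ => mul_nonneg (geomMod_nonneg le_rfl zero_le_one _ _) (abs_nonneg _))
  · have h := fadingMemory_geomMod (ℓ := 0) (μ := 1) le_rfl one_pos
    simpa using h

/-! ## §6  Relative-radius (DILATION) analyticity: the surviving form of the last-coupling wall, t- and log-coordinates -/

/-- HYPOTHESIS SHAPE (NOT PRINTED; the LOCATED form of the last-coupling wall, module docstring (W1-t)/(L5)): COORDINATE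
analyticity with RELATIVE radius `c·|s|` over the box `BoxWindow I` — for every coordinate `i < scale X` the function
`s ↦ E(h[i := s], U, X)` on `I` extends analytically to the closed discs of radius `c|s|` about the points `s ∈ I`,
bounded by `M·e^{−κd(X)}`.  In t = 1/g² a relative t-disc `|t′ − t| < c·t` is EXACTLY a dilation disc `|ζ| < c`,
`1 + ζ = t′/t`: in the unscaled representation (2.10) p. 267 of [Balaban1987RG1] the last coupling enters the k-th step
ONLY as the prefactor `t_k = 1/g_k²` of the classical fluctuation action over the g-free cut-off (2.9), so after the printed
REAL scaling (p. 267: *"Next we make the scaling transformation B = g_kB′."* — the variable of (2.10) is g_k times the new one)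
a complex last coupling is a complex scalar dilation `(1 + ζ)` of the five `1/g_k²`-terms of (2.10) [Gaussian form + the
interaction terms from G, V and the J-term] at the real base point, the Haar density σ(B′), the δ-function, the cut-offs
`|B(b)| < ε₁/g_k` ((2.3) p. 12 of [Balaban1988RG2Cluster]), the previous-action term 𝐄_k and the curly bracket staying
undilated (v1.4 DOCFIX (O1)/(A1); statement unchanged); the estimates (2.15)–(2.26) pp. 15–17 of [Balaban1988RG2Cluster] for complex backgrounds are absolute-value
bounds in which such a dilation enters exactly where the printed small parameters do ((2.17) p. 16: *"The determinants in
the next factor are equal for the new operators, hence this factor can be estimated by exp((O(1)e^{−1/3δ₀M} + O(α₀ +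
α₁))|Z₀|)"*; (2.23) p. 17: *"where α₅ = O(1)e^{−1/3δ₀M} + O(α₀ + α₁) + O(1)α₄ + γ₂"*; p. 20: *"We assume that (LM)⁴α₀,
(LM)⁴α₁, (LM)⁴α₄, (LM)⁴γ₂ are bounded by a constant independent of M, for example by 1"*) — a READING recorded in the
cell file `t4/T4-EST-NE9-P1.md` §9, NOT a printed statement and NOT asserted here.
[cite: Balaban1988RG2Cluster, (2.15)-(2.17) pp.15-16 and (2.23)-(2.26) p.17; Balaban1987RG1, (2.10) p.267] -/
def CouplingAnalyticRel {Bg : Type} (I : Set ℝ) (E : Functional C Bg) (κ M c : ℝ) : Prop :=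
  ∀ (U : Bg) (X : C.Dom), ∀ h ∈ BoxWindow I, ∀ i < C.scale X,
    ∃ (F : ℂ → ℂ) (D : Set ℂ), DifferentiableOn ℂ F D ∧
      (∀ z ∈ D, ‖F z‖ ≤ M * Real.exp (-(κ * C.d X))) ∧
      (∀ s ∈ I, closedBall (s : ℂ) (c * |s|) ⊆ D) ∧
      (∀ s ∈ I, F s = (E (Function.update h i s) U X : ℂ))

/-- Relative radius (`c ≥ 0`) over a box bounded below by `t₀` ⇒ UNIFORM radius `c·t₀` (monotonicity of discs). [folklore] -/
theorem couplingAnalyticOn_of_rel {Bg : Type} {I : Set ℝ} {E : Functional C Bg} {κ M c t₀ : ℝ} (hc : 0 ≤ c)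
    (hI : ∀ s ∈ I, t₀ ≤ s) (hA : CouplingAnalyticRel I E κ M c) :
    CouplingAnalyticOn I E κ M (fun _ _ => c * t₀) := by
  intro U X h hh i hi
  obtain ⟨F, D, hF, hM, hD, hE⟩ := hA U X h hh i hi
  refine ⟨F, D, hF, hM, fun s hs => (closedBall_subset_closedBall ?_).trans (hD s hs), hE⟩
  calc c * t₀ ≤ c * s := mul_le_mul_of_nonneg_left (hI s hs) hc
    _ ≤ c * |s| := mul_le_mul_of_nonneg_left (le_abs_self s) hc

/-- **Dilation analyticity in t over `[t₀, ∞[` ⇒ NE9 in t with UNIFORM moduli `4M/(c·t₀)`** (`= 4Mγ²/c` at `t₀ = γ⁻²`) —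
the typed home of the located wall (W1-t) in the coordinates of the spine's coupling matching. [folklore] -/
theorem ne9T_of_couplingAnalyticRel {Bg : Type} {E : Functional C Bg} {t₀ κ M c : ℝ} (ht₀ : 0 < t₀) (hc : 0 < c)
    (hP : PrefixDependenceOn E (BoxWindow (Set.Ici t₀))) (hA : CouplingAnalyticRel (Set.Ici t₀) E κ M c) :
    NE9 E (BoxWindow (Set.Ici t₀)) κ (fun _ _ => 4 * M / (c * t₀)) :=
  ne9_of_couplingAnalyticT (r := fun _ _ => c * t₀) (fun _ _ _ => mul_pos hc ht₀) hP
    (couplingAnalyticOn_of_rel hc.le (fun _ hs => hs) hA)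

/-- The coupling (t-)history as a function of the LOG-history: `t_i = exp(u_i)`. [folklore] -/
def ofLog (u : ℕ → ℝ) : ℕ → ℝ := fun i => Real.exp (u i)

/-- Log-histories over `exp⁻¹ I` map into the box over `I`. [folklore] -/
theorem ofLog_mem_boxWindow {I : Set ℝ} {u : ℕ → ℝ} (hu : u ∈ BoxWindow (Real.exp ⁻¹' I)) : ofLog u ∈ BoxWindow I :=
  fun i => hu i

/-- Updating a log-coordinate = updating the coordinate by its exponential. [folklore] -/
theorem ofLog_update (u : ℕ → ℝ) (i : ℕ) (v : ℝ) :
    ofLog (Function.update u i v) = Function.update (ofLog u) i (Real.exp v) := by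
  funext j
  simp only [ofLog]
  exact Function.apply_update (fun _ => Real.exp) u i v j

/-- The complex exponential maps the closed disc of radius `ρ ≤ min(1, c/2)` about a real point `u` into the closed disc of
radius `c·e^u` about `e^u`: `|e^z − e^u| = e^u|e^{z−u} − 1| ≤ 2e^u|z − u|` (`Complex.norm_exp_sub_one_le`). [folklore] -/
theorem exp_mem_closedBall_of_mem_closedBall {u c ρ : ℝ} (hρ1 : ρ ≤ 1) (hρc : 2 * ρ ≤ c) {z : ℂ}
    (hz : z ∈ closedBall (u : ℂ) ρ) :
    Complex.exp z ∈ closedBall ((Real.exp u : ℝ) : ℂ) (c * |Real.exp u|) := by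
  rw [mem_closedBall, dist_eq_norm] at hz ⊢
  have h1 : ‖z - u‖ ≤ 1 := hz.trans hρ1
  rw [Complex.ofReal_exp, abs_of_pos (Real.exp_pos u)]
  have hfac : Complex.exp z - Complex.exp u = Complex.exp u * (Complex.exp (z - u) - 1) := by
    rw [mul_sub, mul_one, ← Complex.exp_add, add_sub_cancel]
  rw [hfac, norm_mul, Complex.norm_exp_ofReal]
  calc Real.exp u * ‖Complex.exp (z - u) - 1‖ ≤ Real.exp u * (2 * ‖z - (u : ℂ)‖) :=
        mul_le_mul_of_nonneg_left (Complex.norm_exp_sub_one_le h1) (Real.exp_pos u).le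
    _ ≤ Real.exp u * c := by
        refine mul_le_mul_of_nonneg_left ?_ (Real.exp_pos u).le
        linarith
    _ = c * Real.exp u := mul_comm _ _

/-- **Relative-radius analyticity ⇒ NE9 in LOG-coordinates with γ-FREE uniform moduli** `4M/min(1, c/2)`: relative discs
`|t′ − t| < c·t` are discs of a t-INDEPENDENT radius in `u = log t` (a horizontal strip), so the re-parametrised functional
`u⃗ ↦ E(exp u⃗)` is uniformly Lipschitz in each log-coupling `u_i = log t_i = −2 log g_i` over the whole box `exp⁻¹ I` —
no lower bound `t₀` and no window parameter enter the moduli.  Offered to the carver's open g-versus-t question as the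
invariant form of the dilation hypothesis. [folklore] -/
theorem ne9Log_of_couplingAnalyticRel {Bg : Type} {I : Set ℝ} {E : Functional C Bg} {κ M c : ℝ} (hI : I.OrdConnected)
    (hc : 0 < c) (hP : PrefixDependenceOn E (BoxWindow I)) (hA : CouplingAnalyticRel I E κ M c) :
    NE9 (fun u U X => E (ofLog u) U X) (BoxWindow (Real.exp ⁻¹' I)) κ (fun _ _ => 4 * M / min 1 (c / 2)) := by
  have hρ : 0 < min 1 (c / 2) := lt_min one_pos (by linarith)
  refine ne9_of_couplingAnalyticOn (I := Real.exp ⁻¹' I) (r := fun _ _ => min 1 (c / 2))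
    (hI.preimage_mono Real.exp_monotone) (fun _ _ _ => hρ) ?_ ?_
  · intro u hu u' hu' U X hagree
    exact hP _ (ofLog_mem_boxWindow hu) _ (ofLog_mem_boxWindow hu') U X
      (fun i hi => by simp only [ofLog, hagree i hi])
  · intro U X u hu i hi
    obtain ⟨F, D, hF, hM, hD, hE⟩ := hA U X (ofLog u) (ofLog_mem_boxWindow hu) i hi
    refine ⟨fun z => F (Complex.exp z), Complex.exp ⁻¹' D, ?_, fun z hz => hM _ hz, ?_, ?_⟩
    · exact hF.comp Complex.differentiable_exp.differentiableOn fun z hz => hz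
    · intro v hv z hz
      exact hD (Real.exp v) hv
        (exp_mem_closedBall_of_mem_closedBall (min_le_left _ _) (by linarith [min_le_right (1 : ℝ) (c / 2)]) hz)
    · intro v hv
      show F (Complex.exp (v : ℂ)) = _
      rw [← Complex.ofReal_exp, hE (Real.exp v) hv, ← ofLog_update]

/-! ## §7  The Cauchy constants of the step map over a general coupling box (t-coordinates, relative radii) -/

section AnalyticOn

variable {F : Type*} [NormedAddCommGroup F] [NormedSpace ℂ F] [CompleteSpace F]

/-- **The Cauchy constants of the step map ⇒ StepTransfer over a general box** `BoxWindow I` (`I` order-connected), with a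
base-point dependent last-coupling radius `r s` bounded below by `r₀ > 0` on `I`: the g-window version is
`stepTransfer_of_analytic` (`I = ]0, γ]`, constant radius); the t-window `I = [t₀, ∞[` with RELATIVE radius `r s = c·s`
(`r₀ = c·t₀`) is the form the located wall (W1-t) supports.  Same two Cauchy estimates (`Dimock2015.real_param_lipschitz`,
`Dimock2015.norm_sub_le_of_margin`) and one triangle inequality. [cite: Dimock2015, Sect. 7 proof of Lemma 25 (arXiv:1512.04373 TeX ll. 5647–5679)] -/
theorem stepTransfer_of_analyticOn {V : ℕ → (ℕ → ℝ) → F} {I : Set ℝ} (hI : I.OrdConnected) (T : ℕ → (ℕ → ℝ) → F)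
    (Φ : ℕ → ℂ → F → F) (r : ℝ → ℝ) {r₀ M₁ M₂ ϱ ω₀ : ℝ} (hr₀ : 0 < r₀) (hr : ∀ s ∈ I, r₀ ≤ r s) (hϱ : 0 < ϱ)
    (hV : ∀ j, ∀ g ∈ BoxWindow I, V (j + 1) g = Φ j (g j : ℂ) (T j g))
    (hlast : ∀ j, ∀ g ∈ BoxWindow I, ∃ D : Set ℂ, DifferentiableOn ℂ (fun s => Φ j s (T j g)) D ∧
      (∀ z ∈ D, ‖Φ j z (T j g)‖ ≤ M₁) ∧ ∀ s ∈ I, closedBall (s : ℂ) (r s) ⊆ D)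
    (hold : ∀ j, ∀ s ∈ I, ∃ D : Set F, DifferentiableOn ℂ (Φ j (s : ℂ)) D ∧
      (∀ w ∈ D, ‖Φ j (s : ℂ) w‖ ≤ M₂) ∧ ∀ g ∈ BoxWindow I, closedBall (T j g) ϱ ⊆ D)
    (hT : ∀ j, ∀ g ∈ BoxWindow I, ∀ g' ∈ BoxWindow I,
      ‖T j g - T j g'‖ ≤ ∑ m ∈ Finset.range (j + 1), ω₀ ^ (j - m) * ‖V m g - V m g'‖) :
    StepTransfer V (BoxWindow I) (4 * M₁ / r₀) (4 * M₂ / ϱ) ω₀ := by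
  intro j g hg g' hg'
  have hgj : g j ∈ I := hg j
  have hg'j : g' j ∈ I := hg' j
  -- last coupling: Cauchy on the coordinate discs (radius ≥ r₀ along the segment), at the old datum T j g
  have h1 : ‖Φ j (g j : ℂ) (T j g) - Φ j (g' j : ℂ) (T j g)‖ ≤ 4 * M₁ / r₀ * |g j - g' j| := by
    obtain ⟨D, hD, hM, hdisc⟩ := hlast j g hg
    have hmin : min (g j) (g' j) ∈ I := by
      rcases min_choice (g j) (g' j) with h | h <;> rw [h] <;> assumption
    have hmax : max (g j) (g' j) ∈ I := by
      rcases max_choice (g j) (g' j) with h | h <;> rw [h] <;> assumption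
    have hDab : ∀ s ∈ Icc (min (g j) (g' j)) (max (g j) (g' j)), closedBall (s : ℂ) r₀ ⊆ D := by
      intro s hs
      have hsI : s ∈ I := hI.out hmin hmax hs
      exact (closedBall_subset_closedBall (hr s hsI)).trans (hdisc s hsI)
    exact real_param_lipschitz (g := fun s => Φ j s (T j g)) hr₀ hD hM hDab
      ⟨min_le_left _ _, le_max_left _ _⟩ ⟨min_le_right _ _, le_max_right _ _⟩
  -- old data: Cauchy on the ϱ-margin of the admissible old data, at the last coupling g' j
  have h2 : ‖Φ j (g' j : ℂ) (T j g) - Φ j (g' j : ℂ) (T j g')‖ ≤ 4 * M₂ / ϱ * ‖T j g - T j g'‖ := by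
    obtain ⟨D, hD, hM, hball⟩ := hold j (g' j) hg'j
    have hS : ∀ y ∈ (fun h : ℕ → ℝ => T j h) '' BoxWindow I, closedBall y ϱ ⊆ D := by
      rintro _ ⟨h, hh, rfl⟩
      exact hball h hh
    exact norm_sub_le_of_margin hϱ hD hM hS (mem_image_of_mem _ hg) (mem_image_of_mem _ hg')
  have hM₂ : 0 ≤ M₂ := by
    obtain ⟨D, _, hM, hball⟩ := hold j (g' j) hg'j
    exact (norm_nonneg _).trans (hM _ (hball g hg (mem_closedBall_self hϱ.le)))
  rw [hV j g hg, hV j g' hg']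
  calc ‖Φ j (g j : ℂ) (T j g) - Φ j (g' j : ℂ) (T j g')‖
      ≤ ‖Φ j (g j : ℂ) (T j g) - Φ j (g' j : ℂ) (T j g)‖ + ‖Φ j (g' j : ℂ) (T j g) - Φ j (g' j : ℂ) (T j g')‖ :=
        norm_sub_le_norm_sub_add_norm_sub _ _ _
    _ ≤ 4 * M₁ / r₀ * |g j - g' j| + 4 * M₂ / ϱ * ‖T j g - T j g'‖ := add_le_add h1 h2
    _ ≤ 4 * M₁ / r₀ * |g j - g' j|
          + 4 * M₂ / ϱ * ∑ m ∈ Finset.range (j + 1), ω₀ ^ (j - m) * ‖V m g - V m g'‖ :=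
        add_le_add le_rfl (mul_le_mul_of_nonneg_left (hT j g hg g' hg') (by positivity))

/-- **The analytic route end to end in t-COORDINATES with DILATION radii** (the form the located wall supports): over the
t-box `t_i ≥ t₀ > 0`, (AN-LAST-dil) — `s ↦ Φ j s w` analytic on the relative discs `|z − s| ≤ c·s`, `s ≥ t₀`, with sup bound
M₁ — plus (AN-OLD), (CONTR), coupling-free scale 0 and evaluation give `NE9 E (BoxWindow [t₀, ∞[) κ (geomMod ℓ μ)` and
`FadingMemory (ℓ/μ) μ (geomMod ℓ μ)` with `ℓ = 4M₁/(c·t₀)`, `μ = ω₀ + 4M₂/ϱ`.  Every analytic hypothesis is NOT PRINTED for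
Bałaban's step (module docstring (L5), (W2)–(W4)); NOT summit progress. [folklore] -/
theorem ne9T_of_dilationStep {Bg : Type} {E : Functional C Bg} {V : ℕ → (ℕ → ℝ) → F} {t₀ κ c : ℝ}
    (T : ℕ → (ℕ → ℝ) → F) (Φ : ℕ → ℂ → F → F) (ev : F → Bg → C.Dom → ℝ)
    {M₁ M₂ ϱ ω₀ : ℝ} (ht₀ : 0 < t₀) (hc : 0 < c) (hϱ : 0 < ϱ) (hM₁ : 0 ≤ M₁) (hM₂ : 0 ≤ M₂) (hω : 0 ≤ ω₀)
    (hμ : 0 < ω₀ + 4 * M₂ / ϱ)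
    (hev : ∀ (b b' : F) (U : Bg) (X : C.Dom), |ev b U X - ev b' U X| ≤ Real.exp (-(κ * C.d X)) * ‖b - b'‖)
    (hE : ∀ g ∈ BoxWindow (Set.Ici t₀), ∀ (U : Bg) (X : C.Dom), E g U X = ev (V (C.scale X) g) U X)
    (h0 : ∀ g ∈ BoxWindow (Set.Ici t₀), ∀ g' ∈ BoxWindow (Set.Ici t₀), V 0 g = V 0 g')
    (hV : ∀ j, ∀ g ∈ BoxWindow (Set.Ici t₀), V (j + 1) g = Φ j (g j : ℂ) (T j g))
    (hlast : ∀ j, ∀ g ∈ BoxWindow (Set.Ici t₀), ∃ D : Set ℂ, DifferentiableOn ℂ (fun s => Φ j s (T j g)) D ∧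
      (∀ z ∈ D, ‖Φ j z (T j g)‖ ≤ M₁) ∧ ∀ s ∈ Set.Ici t₀, closedBall (s : ℂ) (c * s) ⊆ D)
    (hold : ∀ j, ∀ s ∈ Set.Ici t₀, ∃ D : Set F, DifferentiableOn ℂ (Φ j (s : ℂ)) D ∧
      (∀ w ∈ D, ‖Φ j (s : ℂ) w‖ ≤ M₂) ∧ ∀ g ∈ BoxWindow (Set.Ici t₀), closedBall (T j g) ϱ ⊆ D)
    (hT : ∀ j, ∀ g ∈ BoxWindow (Set.Ici t₀), ∀ g' ∈ BoxWindow (Set.Ici t₀),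
      ‖T j g - T j g'‖ ≤ ∑ m ∈ Finset.range (j + 1), ω₀ ^ (j - m) * ‖V m g - V m g'‖) :
    NE9 E (BoxWindow (Set.Ici t₀)) κ (geomMod (4 * M₁ / (c * t₀)) (ω₀ + 4 * M₂ / ϱ)) ∧
      FadingMemory (4 * M₁ / (c * t₀) / (ω₀ + 4 * M₂ / ϱ)) (ω₀ + 4 * M₂ / ϱ)
        (geomMod (4 * M₁ / (c * t₀)) (ω₀ + 4 * M₂ / ϱ)) := by
  have hstep : StepTransfer V (BoxWindow (Set.Ici t₀)) (4 * M₁ / (c * t₀)) (4 * M₂ / ϱ) ω₀ :=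
    stepTransfer_of_analyticOn Set.ordConnected_Ici T Φ (fun s => c * s) (mul_pos hc ht₀)
      (fun s hs => mul_le_mul_of_nonneg_left hs hc.le) hϱ hV hlast hold hT
  have ha : 0 ≤ 4 * M₂ / ϱ := by positivity
  have hℓ : 0 ≤ 4 * M₁ / (c * t₀) := by positivity
  exact ne9_and_fadingMemory_of_stepTransfer ev hev hE hℓ ha hω hμ h0 hstep

end AnalyticOn

/-! ## §8  Non-vacuity of the v1.3 shapes -/

/-- The relative-radius shape is satisfiable jointly with prefix dependence over the same box, and the general-box step
transfer is satisfiable (zero functional / zero activities in `ℂ`), so no v1.3 theorem is vacuously true by contradiction.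
[folklore] -/
theorem shapes_nonvacuous₂ (C : Carriers) (Bg : Type) (I : Set ℝ) (κ c : ℝ) :
    (∃ E : Functional C Bg, CouplingAnalyticRel I E κ 0 c ∧ PrefixDependenceOn E (BoxWindow I)) ∧
      ∃ V : ℕ → (ℕ → ℝ) → ℂ, StepTransfer V (BoxWindow I) 0 0 0 := by
  refine ⟨⟨fun _ _ _ => 0, ?_, ?_⟩, fun _ _ => 0, ?_⟩
  · intro U X h _ i _
    exact ⟨fun _ => 0, Set.univ, differentiableOn_const 0, fun z _ => by simp, fun s _ => Set.subset_univ _,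
      fun s _ => by simp⟩
  · intro g _ g' _ U X _
    rfl
  · intro j g _ g' _
    simp

/-! ## §9  g-coordinates and the vertex g = 0: WEIGHTED relative radii ⇒ the g-form of NE9 with BOUNDED moduli -/

section Weighted

variable {F : Type*} [NormedAddCommGroup F] [NormedSpace ℂ F] [CompleteSpace F]

/-- **Weighted Cauchy estimate on relative discs** (the core of §9): if `g` is analytic on a set containing the closed
discs of radius `c·s` about the points `s ∈ [a, b]`, `0 < a ≤ b`, and is bounded by `B·s` on the disc about `s`
(a bound VANISHING LINEARLY at the vertex `0`), then `‖g a − g b‖ ≤ (8B / min(c,1))·|a − b|` — a Lipschitz constant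
that does NOT blow up as `a → 0`.  Two cases: `b ≤ 2a` — `Dimock2015.real_param_lipschitz` on the union of the
relative discs (radius `c·a`, sup `≤ B·b ≤ 2B·a`); `b > 2a` — the triangle inequality `‖g a‖ + ‖g b‖ ≤ B(a + b) ≤ 4B(b − a)`.
[folklore] -/
theorem real_param_lipschitz_relW {g : ℂ → F} {D : Set ℂ} {a b c B : ℝ} (ha : 0 < a) (hab : a ≤ b)
    (hc : 0 < c) (hg : DifferentiableOn ℂ g D)
    (hD : ∀ s ∈ Icc a b, closedBall (s : ℂ) (c * s) ⊆ D)
    (hB : ∀ s ∈ Icc a b, ∀ z ∈ closedBall (s : ℂ) (c * s), ‖g z‖ ≤ B * s) :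
    ‖g a - g b‖ ≤ 8 * B / min c 1 * |a - b| := by
  have haI : a ∈ Icc a b := ⟨le_rfl, hab⟩
  have hbI : b ∈ Icc a b := ⟨hab, le_rfl⟩
  have hb : 0 < b := ha.trans_le hab
  have hga : ‖g a‖ ≤ B * a := hB a haI a (mem_closedBall_self (mul_nonneg hc.le ha.le))
  have hgb : ‖g b‖ ≤ B * b := hB b hbI b (mem_closedBall_self (mul_nonneg hc.le hb.le))
  have hB0 : 0 ≤ B := by
    have h0 : 0 * a ≤ B * a := by
      rw [zero_mul]
      exact (norm_nonneg _).trans hga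
    exact le_of_mul_le_mul_right h0 ha
  have hmin : 0 < min c 1 := lt_min hc one_pos
  have hmin1 : min c 1 ≤ 1 := min_le_right _ _
  have hminc : min c 1 ≤ c := min_le_left _ _
  have habs : |a - b| = b - a := by
    rw [abs_sub_comm]
    exact abs_of_nonneg (sub_nonneg.2 hab)
  by_cases h2 : b ≤ 2 * a
  · -- Cauchy on the union of the relative discs along [a, b]: radius c·a, sup ≤ B·b
    set D' : Set ℂ := ⋃ s ∈ Icc a b, closedBall (s : ℂ) (c * s) with hD'
    have hD'D : D' ⊆ D := Set.iUnion₂_subset fun s hs => hD s hs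
    have hg' : DifferentiableOn ℂ g D' := hg.mono hD'D
    have hM' : ∀ z ∈ D', ‖g z‖ ≤ B * b := by
      intro z hz
      obtain ⟨s, hs, hzs⟩ := Set.mem_iUnion₂.1 hz
      exact (hB s hs z hzs).trans (mul_le_mul_of_nonneg_left hs.2 hB0)
    have hdisc : ∀ s ∈ Icc a b, closedBall (s : ℂ) (c * a) ⊆ D' := by
      intro s hs
      refine (closedBall_subset_closedBall (mul_le_mul_of_nonneg_left hs.1 hc.le)).trans ?_
      exact Set.subset_iUnion₂ (s := fun s' (_ : s' ∈ Icc a b) => closedBall (s' : ℂ) (c * s')) s hs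
    have key := real_param_lipschitz (mul_pos hc ha) hg' hM' hdisc haI hbI
    calc ‖g a - g b‖ ≤ 4 * (B * b) / (c * a) * |a - b| := key
      _ ≤ 8 * B / min c 1 * |a - b| := by
          refine mul_le_mul_of_nonneg_right ?_ (abs_nonneg _)
          rw [div_le_div_iff₀ (mul_pos hc ha) hmin]
          have hBb : 0 ≤ 4 * B * b := by
            have := mul_nonneg hB0 hb.le
            linarith
          nlinarith [mul_le_mul_of_nonneg_left hminc hBb, mul_le_mul_of_nonneg_left h2 (mul_nonneg hB0 hc.le)]
  · -- far apart: the triangle inequality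
    push Not at h2
    calc ‖g a - g b‖ ≤ ‖g a‖ + ‖g b‖ := norm_sub_le _ _
      _ ≤ B * a + B * b := add_le_add hga hgb
      _ ≤ 4 * B * (b - a) := by
          nlinarith [mul_nonneg hB0 (sub_nonneg.2 h2.le), mul_nonneg hB0 ha.le]
      _ ≤ 8 * B / min c 1 * |a - b| := by
          rw [habs]
          refine mul_le_mul_of_nonneg_right ?_ (sub_nonneg.2 hab)
          rw [le_div_iff₀ hmin]
          nlinarith [mul_le_mul_of_nonneg_left hmin1 (by linarith : (0 : ℝ) ≤ 4 * B)]

end Weighted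

/-- Updating one coordinate inside `I` keeps a history in the box. [folklore] -/
theorem update_mem_boxWindow {I : Set ℝ} {h : ℕ → ℝ} (hh : h ∈ BoxWindow I) (i : ℕ) {s : ℝ} (hs : s ∈ I) :
    Function.update h i s ∈ BoxWindow I := by
  intro n
  rcases eq_or_ne n i with rfl | hne
  · rw [Function.update_self]; exact hs
  · rw [Function.update_of_ne hne]; exact hh n

/-- THE TYPED MISSING INEQUALITY (W5) as a hypothesis shape (NOT PRINTED for Bałaban's `E^{(j)}`): COORDINATEWISE Lipschitz
dependence on each running coupling `g_i`, `i < j`, UNIFORMLY DOWN TO THE VERTEX `g_i → 0⁺` — changing one coupling inside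
`I` moves `E(·, U, X)` by at most `e^{−κd(X)}·Λ j i·|s − s′|`.  By `ne9_iff_coordLipschitzOn` this is EXACTLY the joint shape
`NE9` over the box (given prefix dependence), so it is the irreducible content of NE9's coupling-history half; print gives it
only qualitatively and for the LAST coupling (p. 263 of [Balaban1987RG1]: *"It is a C^∞-function of g_{j−1} ∈ [0, γ], (or
analytic), with a positive, absolute γ."*).  Nothing asserted. [cite: Balaban1987RG1, §1 p.263 (qualitative, last coupling only)] -/
def CoordLipschitzOn {Bg : Type} (I : Set ℝ) (E : Functional C Bg) (κ : ℝ) (Λ : ℕ → ℕ → ℝ) : Prop :=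
  ∀ (U : Bg) (X : C.Dom), ∀ h ∈ BoxWindow I, ∀ i < C.scale X, ∀ s ∈ I, ∀ s' ∈ I,
    |E (Function.update h i s) U X - E (Function.update h i s') U X| ≤
      Real.exp (-(κ * C.d X)) * (Λ (C.scale X) i * |s - s'|)

/-- `NE9` over a box ⇒ the coordinatewise shape (specialise to one-coordinate variations; no prefix dependence needed).
[folklore] -/
theorem coordLipschitzOn_of_ne9 {Bg : Type} {I : Set ℝ} {E : Functional C Bg} {κ : ℝ} {Λ : ℕ → ℕ → ℝ}
    (hNE : NE9 E (BoxWindow I) κ Λ) : CoordLipschitzOn I E κ Λ := by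
  intro U X h hh i hi s hs s' hs'
  have key := hNE _ (update_mem_boxWindow hh i hs) _ (update_mem_boxWindow hh i hs') U X
  have hsum : ∑ m ∈ Finset.range (C.scale X), Λ (C.scale X) m * |Function.update h i s m - Function.update h i s' m|
      = Λ (C.scale X) i * |s - s'| := by
    rw [Finset.sum_eq_single i]
    · rw [Function.update_self, Function.update_self]
    · intro m _ hm
      rw [Function.update_of_ne hm, Function.update_of_ne hm, sub_self, abs_zero, mul_zero]
    · intro hi'
      exact absurd (Finset.mem_range.2 hi) hi'
  rwa [hsum] at key

/-- **Coordinatewise Lipschitz inside a box ⇒ NE9** (the telescoping core of §1 made reusable): telescoping through the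
hybrid histories, prefix dependence discarding the coordinates `≥ j`. [folklore] -/
theorem ne9_of_coordLipschitz {Bg : Type} {I : Set ℝ} {E : Functional C Bg} {κ : ℝ} {Λ : ℕ → ℕ → ℝ}
    (hP : PrefixDependenceOn E (BoxWindow I)) (hL : CoordLipschitzOn I E κ Λ) :
    NE9 E (BoxWindow I) κ Λ := by
  intro g hg g' hg' U X
  set f : ℕ → ℝ := fun m => E (hybrid g g' m) U X with hf
  have h0 : f 0 = E g U X := by
    simp only [hf, hybrid_zero]
  have hfin : f (C.scale X) = E g' U X := by
    simp only [hf]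
    exact hP _ (hybrid_mem_boxWindow hg hg' _) _ hg' U X (fun i hi => hybrid_apply_lt g g' hi)
  have htel : E g U X - E g' U X = ∑ m ∈ Finset.range (C.scale X), (f m - f (m + 1)) := by
    rw [Finset.sum_range_sub', h0, hfin]
  have hstep : ∀ m ∈ Finset.range (C.scale X),
      |f m - f (m + 1)| ≤ Real.exp (-(κ * C.d X)) * (Λ (C.scale X) m * |g m - g' m|) := by
    intro m hm
    rw [Finset.mem_range] at hm
    have key := hL U X (hybrid g g' m) (hybrid_mem_boxWindow hg hg' m) m hm (g m) (hg m) (g' m) (hg' m)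
    rwa [update_hybrid_self, ← hybrid_succ] at key
  calc |E g U X - E g' U X|
      = |∑ m ∈ Finset.range (C.scale X), (f m - f (m + 1))| := by rw [htel]
    _ ≤ ∑ m ∈ Finset.range (C.scale X), |f m - f (m + 1)| := Finset.abs_sum_le_sum_abs _ _
    _ ≤ ∑ m ∈ Finset.range (C.scale X), Real.exp (-(κ * C.d X)) * (Λ (C.scale X) m * |g m - g' m|) :=
        Finset.sum_le_sum hstep
    _ = Real.exp (-(κ * C.d X)) * ∑ m ∈ Finset.range (C.scale X), Λ (C.scale X) m * |g m - g' m| := by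
        rw [Finset.mul_sum]

/-- **NE9 over a box ⟺ coordinatewise Lipschitz down to the vertex** (given the printed-in-words prefix dependence): the
coupling-history half of NE9 carries no content beyond (W5). [folklore] -/
theorem ne9_iff_coordLipschitzOn {Bg : Type} {I : Set ℝ} {E : Functional C Bg} {κ : ℝ} {Λ : ℕ → ℕ → ℝ}
    (hP : PrefixDependenceOn E (BoxWindow I)) : NE9 E (BoxWindow I) κ Λ ↔ CoordLipschitzOn I E κ Λ :=
  ⟨coordLipschitzOn_of_ne9, ne9_of_coordLipschitz hP⟩

/-- HYPOTHESIS SHAPE (NOT PRINTED): relative-radius coordinate analyticity with a WEIGHTED bound — as `CouplingAnalyticRel`,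
but the bound on the disc `|z − s| ≤ c|s|` about the base point `s` is `M·w(s)·e^{−κd(X)}` with a weight `w`.  The weights
that occur: `w ≡ 1` (the unweighted shape, = (1.18) p. 263 of [Balaban1987RG1] for the E-terms: *"There exists a constant
E₀ such that |E^{(j)}(X, g_{j−1}, U, J)| ≤ E₀ exp(−κd_j(X))"*); `w(s) = s^p`, `p ≥ 1` (the g-POWER weight of
[Balaban1988Convergent] (2.31) p. 260 for the R-terms: *"|R^{(j)}(X,(U,J))| ≤ g_j^{κ₀} exp(−κd_j(X))"*, *"Here κ₀ can be chosen
arbitrarily large, similarly as κ, if the other parameters are fixed properly, as in [I]"*; and of the FERMIONIC printed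
instance [DimockYuan2024GNFlow] Cor. 1, activities `O(g_k³)` on the disc `|g′_k − g_k| < g_k`).  (v1.6 remark, cell GAPS
C-pv10-78 R1: the shape weighs EACH coordinate `i < scale X` by `w` at its own base point, whereas the printed weights quoted
as provenance are powers of ONE coupling, g_j^{κ₀} resp. C_E g_k³; they agree only along histories with mutually comparable
couplings — e.g. under (2.6) p. 255 of [Balaban1988Convergent] — not on the full box, so passing from a one-coupling weight to
this shape is ONE MORE UNPRINTED STEP; (W5) says NOT PRINTED either way.)  Nothing asserted.
[cite: Balaban1987RG1, (1.18) p.263; Balaban1988Convergent, (2.31) p.260; DimockYuan2024GNFlow, Corollary 1 and its proof] -/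
def CouplingAnalyticRelW {Bg : Type} (I : Set ℝ) (E : Functional C Bg) (κ M c : ℝ) (w : ℝ → ℝ) : Prop :=
  ∀ (U : Bg) (X : C.Dom), ∀ h ∈ BoxWindow I, ∀ i < C.scale X,
    ∃ (Fz : ℂ → ℂ) (D : Set ℂ), DifferentiableOn ℂ Fz D ∧
      (∀ s ∈ I, closedBall (s : ℂ) (c * |s|) ⊆ D) ∧
      (∀ s ∈ I, ∀ z ∈ closedBall (s : ℂ) (c * |s|), ‖Fz z‖ ≤ M * w s * Real.exp (-(κ * C.d X))) ∧
      (∀ s ∈ I, Fz s = (E (Function.update h i s) U X : ℂ))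

/-- The unweighted shape of §6 is the weight `w ≡ 1`. [folklore] -/
theorem couplingAnalyticRelW_one_of_rel {Bg : Type} {I : Set ℝ} {E : Functional C Bg} {κ M c : ℝ}
    (hA : CouplingAnalyticRel I E κ M c) : CouplingAnalyticRelW I E κ M c (fun _ => 1) := by
  intro U X h hh i hi
  obtain ⟨Fz, D, hF, hM, hD, hE⟩ := hA U X h hh i hi
  refine ⟨Fz, D, hF, hD, fun s hs z hz => ?_, hE⟩
  rw [mul_one]
  exact hM z (hD s hs hz)

/-- Monotonicity in the weight (for `M ≥ 0`). [folklore] -/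
theorem couplingAnalyticRelW_mono {Bg : Type} {I : Set ℝ} {E : Functional C Bg} {κ M c : ℝ} {w w' : ℝ → ℝ}
    (hM : 0 ≤ M) (hw : ∀ s ∈ I, w s ≤ w' s) (hA : CouplingAnalyticRelW I E κ M c w) :
    CouplingAnalyticRelW I E κ M c w' := by
  intro U X h hh i hi
  obtain ⟨Fz, D, hF, hD, hB, hE⟩ := hA U X h hh i hi
  refine ⟨Fz, D, hF, hD, fun s hs z hz => (hB s hs z hz).trans ?_, hE⟩
  exact mul_le_mul_of_nonneg_right (mul_le_mul_of_nonneg_left (hw s hs) hM) (Real.exp_pos _).le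

/-- On the window `]0, γ]` a POWER weight `s^p`, `p ≥ 1`, is dominated by the LINEAR weight: `s^p ≤ γ^{p−1}·s`, so
`M ↦ M·γ^{p−1}`. [folklore] -/
theorem couplingAnalyticRelW_lin_of_pow {Bg : Type} {E : Functional C Bg} {γ κ M c : ℝ} {p : ℕ} (hp : 1 ≤ p)
    (hM : 0 ≤ M) (hA : CouplingAnalyticRelW (Set.Ioc 0 γ) E κ M c (fun s => s ^ p)) :
    CouplingAnalyticRelW (Set.Ioc 0 γ) E κ (M * γ ^ (p - 1)) c (fun s => s) := by
  intro U X h hh i hi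
  obtain ⟨Fz, D, hF, hD, hB, hE⟩ := hA U X h hh i hi
  refine ⟨Fz, D, hF, hD, fun s hs z hz => (hB s hs z hz).trans ?_, hE⟩
  have hs0 : 0 ≤ s := hs.1.le
  have hpow : s ^ p ≤ γ ^ (p - 1) * s := by
    calc s ^ p = s ^ (p - 1) * s := by rw [← pow_succ, Nat.sub_add_cancel hp]
      _ ≤ γ ^ (p - 1) * s := mul_le_mul_of_nonneg_right (pow_le_pow_left₀ hs0 hs.2 _) hs0
  have := mul_le_mul_of_nonneg_left hpow hM
  calc M * s ^ p * Real.exp (-(κ * C.d X)) ≤ M * (γ ^ (p - 1) * s) * Real.exp (-(κ * C.d X)) :=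
        mul_le_mul_of_nonneg_right this (Real.exp_pos _).le
    _ = M * γ ^ (p - 1) * s * Real.exp (-(κ * C.d X)) := by ring

/-- **LINEARLY weighted relative radii ⇒ the g-FORM of NE9 with BOUNDED, history-independent moduli** `8M/min(c,1)` over any
order-connected coordinate set `I ⊆ ]0, ∞[`: the linear vanishing of the bound at the vertex exactly compensates the
shrinking `c·s` of the radii (`real_param_lipschitz_relW`).  This is the mechanism by which the fermionic printed instance
gets a bounded (even small) g-derivative ([DimockYuan2024GNFlow] Cor. 1: `O(g_k³)` activities, disc radius `g_k`, derivative
`O(g_k²)`); for Bałaban's E-terms the bound (1.18) is UNWEIGHTED and §10 shows the conclusion then FAILS. [folklore] -/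
theorem ne9_of_couplingAnalyticRelLin {Bg : Type} {I : Set ℝ} {E : Functional C Bg} {κ M c : ℝ}
    (hI : I.OrdConnected) (hI0 : ∀ s ∈ I, 0 < s) (hc : 0 < c) (hP : PrefixDependenceOn E (BoxWindow I))
    (hA : CouplingAnalyticRelW I E κ M c (fun s => s)) :
    NE9 E (BoxWindow I) κ (fun _ _ => 8 * M / min c 1) := by
  refine ne9_of_coordLipschitz hP ?_
  intro U X h hh i hi s hs s' hs'
  obtain ⟨Fz, D, hF, hD, hB, hE⟩ := hA U X h hh i hi
  wlog hss : s ≤ s' generalizing s s'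
  · have h1 := this s' hs' s hs (not_le.1 hss).le
    rw [abs_sub_comm] at h1
    rw [abs_sub_comm s' s] at h1
    exact h1
  have hs0 : 0 < s := hI0 s hs
  have hIcc : Icc s s' ⊆ I := hI.out hs hs'
  have key := real_param_lipschitz_relW (g := Fz) (B := M * Real.exp (-(κ * C.d X))) hs0 hss hc hF
    (fun r hr => by
      have h := hD r (hIcc hr)
      rwa [abs_of_pos (hs0.trans_le hr.1)] at h)
    (fun r hr z hz => by
      have hr0 : 0 < r := hs0.trans_le hr.1
      have hz' : z ∈ closedBall (r : ℂ) (c * |r|) := by rwa [abs_of_pos hr0]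
      calc ‖Fz z‖ ≤ M * r * Real.exp (-(κ * C.d X)) := hB r (hIcc hr) z hz'
        _ = M * Real.exp (-(κ * C.d X)) * r := by ring)
  rw [hE s hs, hE s' hs', ← ofReal_sub, norm_real, Real.norm_eq_abs] at key
  calc |E (Function.update h i s) U X - E (Function.update h i s') U X|
      ≤ 8 * (M * Real.exp (-(κ * C.d X))) / min c 1 * |s - s'| := key
    _ = Real.exp (-(κ * C.d X)) * (8 * M / min c 1 * |s - s'|) := by ring

/-- **The g-WINDOW form** (`Window γ = BoxWindow ]0, γ]`): linearly weighted relative radii ⇒ `NE9 E (Window γ) κ (8M/min(c,1))`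
— the shape node U2's read-out consumes BY NAME (`T4BetaReadOut.histLipschitz_of_ne9`, W = `Window γ`). [folklore] -/
theorem ne9Window_of_couplingAnalyticRelLin {Bg : Type} {E : Functional C Bg} {γ κ M c : ℝ} (hc : 0 < c)
    (hP : PrefixDependenceOn E (Window γ)) (hA : CouplingAnalyticRelW (Set.Ioc 0 γ) E κ M c (fun s => s)) :
    NE9 E (Window γ) κ (fun _ _ => 8 * M / min c 1) :=
  ne9_of_couplingAnalyticRelLin Set.ordConnected_Ioc (fun _ hs => hs.1) hc hP hA

/-- **Power weight** `g^p`, `p ≥ 1` (the (2.31)-type / Dimock–Yuan-type bound): `NE9 E (Window γ) κ (8Mγ^{p−1}/min(c,1))`.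
[folklore] -/
theorem ne9Window_of_couplingAnalyticRelPow {Bg : Type} {E : Functional C Bg} {γ κ M c : ℝ} {p : ℕ} (hp : 1 ≤ p)
    (hM : 0 ≤ M) (hc : 0 < c) (hP : PrefixDependenceOn E (Window γ))
    (hA : CouplingAnalyticRelW (Set.Ioc 0 γ) E κ M c (fun s => s ^ p)) :
    NE9 E (Window γ) κ (fun _ _ => 8 * (M * γ ^ (p - 1)) / min c 1) :=
  ne9Window_of_couplingAnalyticRelLin hc hP (couplingAnalyticRelW_lin_of_pow hp hM hA)

/-- If the relative radius EXCEEDS the distance to the vertex (`c > 1`), the vertex `g = 0` is INTERIOR to the disc about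
`s = γ` and the unweighted shape already gives UNIFORM radii `(c − 1)γ` — hence the g-form by §1 with moduli `4M/((c−1)γ)`;
the printed relative radii have `c < 1` ((1.34) p. 9 of [Balaban1988RG2Cluster]: the domain `|B| < ε₁g_k^{−1}`; the fermionic
disc `|g′_k − g_k| < g_k`), where §10 applies. [folklore] -/
theorem couplingAnalyticOn_of_rel_one_lt {Bg : Type} {E : Functional C Bg} {γ κ M c : ℝ} (hγ : 0 < γ)
    (hA : CouplingAnalyticRel (Set.Ioc 0 γ) E κ M c) :
    CouplingAnalyticOn (Set.Ioc 0 γ) E κ M (fun _ _ => (c - 1) * γ) := by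
  intro U X h hh i hi
  obtain ⟨Fz, D, hF, hM, hD, hE⟩ := hA U X h hh i hi
  refine ⟨Fz, D, hF, hM, fun s hs => Subset.trans ?_ (hD γ ⟨hγ, le_rfl⟩), hE⟩
  intro z hz
  rw [mem_closedBall, dist_eq_norm] at hz ⊢
  rw [abs_of_pos hγ]
  have hsz : ‖(s : ℂ) - (γ : ℂ)‖ = γ - s := by
    rw [← ofReal_sub, norm_real, Real.norm_eq_abs, abs_of_nonpos (sub_nonpos.2 hs.2)]
    ring
  calc ‖z - (γ : ℂ)‖ ≤ ‖z - (s : ℂ)‖ + ‖(s : ℂ) - (γ : ℂ)‖ := norm_sub_le_norm_sub_add_norm_sub _ _ _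
    _ ≤ (c - 1) * γ + (γ - s) := add_le_add hz hsz.le
    _ ≤ c * γ := by nlinarith [hs.1]

/-- `c > 1` (vertex interior) ⇒ the g-form with UNIFORM moduli `4M/((c − 1)γ)` from the UNWEIGHTED shape — the regime the
printed relative radii (`c < 1`) do not reach (§10). [folklore] -/
theorem ne9Window_of_couplingAnalyticRel_one_lt {Bg : Type} {E : Functional C Bg} {γ κ M c : ℝ} (hγ : 0 < γ)
    (hc : 1 < c) (hP : PrefixDependenceOn E (Window γ)) (hA : CouplingAnalyticRel (Set.Ioc 0 γ) E κ M c) :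
    NE9 E (Window γ) κ (fun _ _ => 4 * M / ((c - 1) * γ)) :=
  ne9_of_couplingAnalyticOn Set.ordConnected_Ioc (fun _ _ _ => mul_pos (sub_pos.2 hc) hγ) hP
    (couplingAnalyticOn_of_rel_one_lt hγ hA)

section WeightedStep

variable {F : Type*} [NormedAddCommGroup F] [NormedSpace ℂ F] [CompleteSpace F]

/-- **The Cauchy constants of the step map with a LINEARLY weighted last-coupling bound ⇒ StepTransfer in g-coordinates**
over a box `BoxWindow I`, `I ⊆ ]0, ∞[` order-connected: `s ↦ Φ j s w` analytic on the relative discs `|z − s| ≤ c·s` with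
`‖Φ j z w‖ ≤ M₁·s` there ⇒ injection modulus `ℓ = 8M₁/min(c,1)` (`real_param_lipschitz_relW`); the old-data channel as in
`stepTransfer_of_analyticOn`. [folklore] -/
theorem stepTransfer_of_analyticOnW {V : ℕ → (ℕ → ℝ) → F} {I : Set ℝ} (hI : I.OrdConnected) (hI0 : ∀ s ∈ I, 0 < s)
    (T : ℕ → (ℕ → ℝ) → F) (Φ : ℕ → ℂ → F → F) {c M₁ M₂ ϱ ω₀ : ℝ} (hc : 0 < c) (hϱ : 0 < ϱ)
    (hV : ∀ j, ∀ g ∈ BoxWindow I, V (j + 1) g = Φ j (g j : ℂ) (T j g))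
    (hlast : ∀ j, ∀ g ∈ BoxWindow I, ∃ D : Set ℂ, DifferentiableOn ℂ (fun s => Φ j s (T j g)) D ∧
      (∀ s ∈ I, closedBall (s : ℂ) (c * s) ⊆ D) ∧
      (∀ s ∈ I, ∀ z ∈ closedBall (s : ℂ) (c * s), ‖Φ j z (T j g)‖ ≤ M₁ * s))
    (hold : ∀ j, ∀ s ∈ I, ∃ D : Set F, DifferentiableOn ℂ (Φ j (s : ℂ)) D ∧
      (∀ w ∈ D, ‖Φ j (s : ℂ) w‖ ≤ M₂) ∧ ∀ g ∈ BoxWindow I, closedBall (T j g) ϱ ⊆ D)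
    (hT : ∀ j, ∀ g ∈ BoxWindow I, ∀ g' ∈ BoxWindow I,
      ‖T j g - T j g'‖ ≤ ∑ m ∈ Finset.range (j + 1), ω₀ ^ (j - m) * ‖V m g - V m g'‖) :
    StepTransfer V (BoxWindow I) (8 * M₁ / min c 1) (4 * M₂ / ϱ) ω₀ := by
  intro j g hg g' hg'
  have hgj : g j ∈ I := hg j
  have hg'j : g' j ∈ I := hg' j
  -- last coupling: weighted Cauchy on the relative discs, at the old datum T j g
  have h1 : ‖Φ j (g j : ℂ) (T j g) - Φ j (g' j : ℂ) (T j g)‖ ≤ 8 * M₁ / min c 1 * |g j - g' j| := by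
    obtain ⟨D, hD, hdisc, hM⟩ := hlast j g hg
    have aux : ∀ a b : ℝ, a ∈ I → b ∈ I → a ≤ b →
        ‖Φ j (a : ℂ) (T j g) - Φ j (b : ℂ) (T j g)‖ ≤ 8 * M₁ / min c 1 * |a - b| := by
      intro a b ha hb hab
      have hIcc : Icc a b ⊆ I := hI.out ha hb
      exact real_param_lipschitz_relW (g := fun s => Φ j s (T j g)) (hI0 a ha) hab hc hD
        (fun s hs => hdisc s (hIcc hs)) (fun s hs z hz => hM s (hIcc hs) z hz)
    rcases le_total (g j) (g' j) with hle | hle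
    · exact aux _ _ hgj hg'j hle
    · rw [norm_sub_rev, abs_sub_comm]
      exact aux _ _ hg'j hgj hle
  -- old data: Cauchy on the ϱ-margin of the admissible old data, at the last coupling g' j
  have h2 : ‖Φ j (g' j : ℂ) (T j g) - Φ j (g' j : ℂ) (T j g')‖ ≤ 4 * M₂ / ϱ * ‖T j g - T j g'‖ := by
    obtain ⟨D, hD, hM, hball⟩ := hold j (g' j) hg'j
    have hS : ∀ y ∈ (fun h : ℕ → ℝ => T j h) '' BoxWindow I, closedBall y ϱ ⊆ D := by
      rintro _ ⟨h, hh, rfl⟩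
      exact hball h hh
    exact norm_sub_le_of_margin hϱ hD hM hS (mem_image_of_mem _ hg) (mem_image_of_mem _ hg')
  have hM₂ : 0 ≤ M₂ := by
    obtain ⟨D, _, hM, hball⟩ := hold j (g' j) hg'j
    exact (norm_nonneg _).trans (hM _ (hball g hg (mem_closedBall_self hϱ.le)))
  rw [hV j g hg, hV j g' hg']
  calc ‖Φ j (g j : ℂ) (T j g) - Φ j (g' j : ℂ) (T j g')‖
      ≤ ‖Φ j (g j : ℂ) (T j g) - Φ j (g' j : ℂ) (T j g)‖ + ‖Φ j (g' j : ℂ) (T j g) - Φ j (g' j : ℂ) (T j g')‖ :=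
        norm_sub_le_norm_sub_add_norm_sub _ _ _
    _ ≤ 8 * M₁ / min c 1 * |g j - g' j| + 4 * M₂ / ϱ * ‖T j g - T j g'‖ := add_le_add h1 h2
    _ ≤ 8 * M₁ / min c 1 * |g j - g' j|
          + 4 * M₂ / ϱ * ∑ m ∈ Finset.range (j + 1), ω₀ ^ (j - m) * ‖V m g - V m g'‖ :=
        add_le_add le_rfl (mul_le_mul_of_nonneg_left (hT j g hg g' hg') (by positivity))

/-- **The analytic route end to end in the g-WINDOW with linearly weighted last-coupling bound**: (AN-LAST-lin) —
`s ↦ Φ j s w` analytic on `|z − s| ≤ c·s`, `0 < s ≤ γ`, with `‖Φ j z w‖ ≤ M₁·s` — plus (AN-OLD), (CONTR), coupling-free scale 0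
and evaluation give `NE9 E (Window γ) κ (geomMod ℓ μ)` and `FadingMemory (ℓ/μ) μ (geomMod ℓ μ)`, `ℓ = 8M₁/min(c,1)`,
`μ = ω₀ + 4M₂/ϱ` — the two hypothesis shapes of `T4BetaReadOut.histLipschitz_of_ne9` / `fadingMemory_readOut` over `Window γ`.
Every analytic hypothesis is NOT PRINTED for Bałaban's step, and the linear weight is NOT (1.18) (module docstring (W5));
NOT summit progress. [folklore] -/
theorem ne9Window_of_dilationStepLin {Bg : Type} {E : Functional C Bg} {V : ℕ → (ℕ → ℝ) → F} {γ κ c : ℝ}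
    (T : ℕ → (ℕ → ℝ) → F) (Φ : ℕ → ℂ → F → F) (ev : F → Bg → C.Dom → ℝ)
    {M₁ M₂ ϱ ω₀ : ℝ} (hc : 0 < c) (hϱ : 0 < ϱ) (hM₁ : 0 ≤ M₁) (hω : 0 ≤ ω₀)
    (hμ : 0 < ω₀ + 4 * M₂ / ϱ) (hM₂ : 0 ≤ M₂)
    (hev : ∀ (b b' : F) (U : Bg) (X : C.Dom), |ev b U X - ev b' U X| ≤ Real.exp (-(κ * C.d X)) * ‖b - b'‖)
    (hE : ∀ g ∈ Window γ, ∀ (U : Bg) (X : C.Dom), E g U X = ev (V (C.scale X) g) U X)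
    (h0 : ∀ g ∈ Window γ, ∀ g' ∈ Window γ, V 0 g = V 0 g')
    (hV : ∀ j, ∀ g ∈ Window γ, V (j + 1) g = Φ j (g j : ℂ) (T j g))
    (hlast : ∀ j, ∀ g ∈ Window γ, ∃ D : Set ℂ, DifferentiableOn ℂ (fun s => Φ j s (T j g)) D ∧
      (∀ s ∈ Set.Ioc (0 : ℝ) γ, closedBall (s : ℂ) (c * s) ⊆ D) ∧
      (∀ s ∈ Set.Ioc (0 : ℝ) γ, ∀ z ∈ closedBall (s : ℂ) (c * s), ‖Φ j z (T j g)‖ ≤ M₁ * s))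
    (hold : ∀ j, ∀ s ∈ Set.Ioc (0 : ℝ) γ, ∃ D : Set F, DifferentiableOn ℂ (Φ j (s : ℂ)) D ∧
      (∀ w ∈ D, ‖Φ j (s : ℂ) w‖ ≤ M₂) ∧ ∀ g ∈ Window γ, closedBall (T j g) ϱ ⊆ D)
    (hT : ∀ j, ∀ g ∈ Window γ, ∀ g' ∈ Window γ,
      ‖T j g - T j g'‖ ≤ ∑ m ∈ Finset.range (j + 1), ω₀ ^ (j - m) * ‖V m g - V m g'‖) :
    NE9 E (Window γ) κ (geomMod (8 * M₁ / min c 1) (ω₀ + 4 * M₂ / ϱ)) ∧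
      FadingMemory (8 * M₁ / min c 1 / (ω₀ + 4 * M₂ / ϱ)) (ω₀ + 4 * M₂ / ϱ)
        (geomMod (8 * M₁ / min c 1) (ω₀ + 4 * M₂ / ϱ)) := by
  have hstep : StepTransfer V (Window γ) (8 * M₁ / min c 1) (4 * M₂ / ϱ) ω₀ :=
    stepTransfer_of_analyticOnW (I := Set.Ioc 0 γ) Set.ordConnected_Ioc (fun _ hs => hs.1) T Φ hc hϱ hV hlast hold hT
  have ha : 0 ≤ 4 * M₂ / ϱ := by positivity
  have hmin : 0 < min c 1 := lt_min hc one_pos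
  have hℓ : 0 ≤ 8 * M₁ / min c 1 := by positivity
  exact ne9_and_fadingMemory_of_stepTransfer ev hev hE hℓ ha hω hμ h0 hstep

end WeightedStep

/-! ## §10  The vertex obstruction: UNWEIGHTED relative radii do NOT give the g-form of NE9 (kernel no-go at shape level) -/

/-- `‖cos w‖ ≤ e^π` on the strip `|Im w| ≤ π` (so `‖cos(log z)‖ ≤ e^π` on `ℂ ∖ {0}`). [folklore] -/
theorem norm_cos_le_exp_pi {w : ℂ} (hw : |w.im| ≤ Real.pi) : ‖Complex.cos w‖ ≤ Real.exp Real.pi := by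
  have hcos : Complex.cos w = (Complex.exp (w * I) + Complex.exp (-w * I)) / 2 := by
    rw [← Complex.two_cos]; ring
  have h2 : ‖(2 : ℂ)‖ = 2 := by simp
  obtain ⟨hl, hu⟩ := abs_le.1 hw
  calc ‖Complex.cos w‖ = ‖Complex.exp (w * I) + Complex.exp (-w * I)‖ / 2 := by rw [hcos, norm_div, h2]
    _ ≤ (‖Complex.exp (w * I)‖ + ‖Complex.exp (-w * I)‖) / 2 := by
        gcongr
        exact norm_add_le _ _
    _ = (Real.exp (-w.im) + Real.exp w.im) / 2 := by
        rw [Complex.norm_exp, Complex.norm_exp]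
        congr 2
        · simp [Complex.mul_re]
        · simp [Complex.mul_re]
    _ ≤ (Real.exp Real.pi + Real.exp Real.pi) / 2 := by
        gcongr
        linarith
    _ = Real.exp Real.pi := by ring

/-- THE MODEL of the no-go: on domains of positive scale, `(M/e^π)·e^{−κd(X)}·cos(log g₀)` — a bounded, prefix-dependent
functional of the history whose g₀-coordinate oscillates boundedly but with UNBOUNDED frequency at the vertex `g₀ → 0`
(`= Re g₀^{i}` up to the constant); `0` on scale-0 domains. [folklore] -/
def vertexModel (C : Carriers) (Bg : Type) (κ M : ℝ) : Functional C Bg :=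
  fun g _ X => if 0 < C.scale X then M / Real.exp Real.pi * Real.exp (-(κ * C.d X)) * Real.cos (Real.log (g 0)) else 0

/-- The model is prefix-dependent on any window. [folklore] -/
theorem vertexModel_prefix (C : Carriers) (Bg : Type) (κ M : ℝ) (W : Set (ℕ → ℝ)) :
    PrefixDependenceOn (vertexModel C Bg κ M) W := by
  intro g _ g' _ U X hagree
  by_cases hX : 0 < C.scale X
  · simp only [vertexModel, if_pos hX, hagree 0 hX]
  · simp only [vertexModel, if_neg hX]

/-- The model obeys the PRINTED decay shape (1.18) with constant `M ≥ 0` (`|cos| ≤ 1 ≤ e^π`). [folklore] -/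
theorem vertexModel_decay (C : Carriers) (Bg : Type) {κ M : ℝ} (hM : 0 ≤ M) (W : Set (ℕ → ℝ)) :
    DecayBound (vertexModel C Bg κ M) W M κ := by
  intro g _ U X
  have hπ : 1 ≤ Real.exp Real.pi := Real.one_le_exp Real.pi_pos.le
  have hA : 0 ≤ M / Real.exp Real.pi * Real.exp (-(κ * C.d X)) := by positivity
  by_cases hX : 0 < C.scale X
  · simp only [vertexModel, if_pos hX]
    rw [abs_mul, abs_of_nonneg hA]
    calc M / Real.exp Real.pi * Real.exp (-(κ * C.d X)) * |Real.cos (Real.log (g 0))|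
        ≤ M / Real.exp Real.pi * Real.exp (-(κ * C.d X)) * 1 :=
          mul_le_mul_of_nonneg_left (Real.abs_cos_le_one _) hA
      _ ≤ M * Real.exp (-(κ * C.d X)) := by
          rw [mul_one, div_mul_eq_mul_div, div_le_iff₀ (Real.exp_pos _)]
          have := mul_nonneg hM (Real.exp_pos (-(κ * C.d X))).le
          nlinarith
  · simp only [vertexModel, if_neg hX, abs_zero]
    positivity

/-- The model satisfies the UNWEIGHTED relative-radius shape of §6 in g-coordinates for every `c < 1` (the discs
`|z − g| ≤ c·g` stay in the right half-plane, where `cos ∘ log` is holomorphic and bounded by `e^π`). [folklore] -/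
theorem vertexModel_rel (C : Carriers) (Bg : Type) {γ κ M c : ℝ} (hM : 0 ≤ M) (hc : c < 1) :
    CouplingAnalyticRel (Set.Ioc 0 γ) (vertexModel C Bg κ M) κ M c := by
  intro U X h hh i hi
  have hX : 0 < C.scale X := lt_of_le_of_lt (Nat.zero_le _) hi
  have hπ : 1 ≤ Real.exp Real.pi := Real.one_le_exp Real.pi_pos.le
  set A : ℝ := M / Real.exp Real.pi * Real.exp (-(κ * C.d X)) with hAdef
  have hA : 0 ≤ A := by positivity
  have hAM : A * Real.exp Real.pi = M * Real.exp (-(κ * C.d X)) := by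
    rw [hAdef]; field_simp
  by_cases hi0 : i = 0
  · subst hi0
    refine ⟨fun z => (A : ℂ) * Complex.cos (Complex.log z), {z | 0 < z.re}, ?_, ?_, ?_, ?_⟩
    · intro z hz
      exact (((Complex.differentiableAt_log (Or.inl hz)).ccos).const_mul _).differentiableWithinAt
    · intro z _
      rw [norm_mul, Complex.norm_real, Real.norm_eq_abs, abs_of_nonneg hA, ← hAM]
      exact mul_le_mul_of_nonneg_left (norm_cos_le_exp_pi (by rw [Complex.log_im]; exact Complex.abs_arg_le_pi _)) hA
    · intro s hs z hz
      rw [mem_closedBall, dist_eq_norm, abs_of_pos hs.1] at hz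
      show 0 < z.re
      have hre : ((s : ℂ) - z).re ≤ c * s := (Complex.re_le_norm _).trans (by rwa [norm_sub_rev])
      have hre' : ((s : ℂ) - z).re = s - z.re := by simp
      nlinarith [hs.1]
    · intro s hs
      show (A : ℂ) * Complex.cos (Complex.log s) = _
      simp only [vertexModel, if_pos hX, Function.update_self]
      rw [← hAdef]
      push_cast
      rw [Complex.ofReal_log hs.1.le]
  · refine ⟨fun _ => (vertexModel C Bg κ M h U X : ℂ), Set.univ, differentiableOn_const _, ?_,
      fun s _ => subset_univ _, ?_⟩
    · intro z _
      show ‖((vertexModel C Bg κ M h U X : ℝ) : ℂ)‖ ≤ _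
      rw [Complex.norm_real, Real.norm_eq_abs]
      simp only [vertexModel, if_pos hX]
      rw [abs_mul, abs_of_nonneg hA, ← hAM]
      calc A * |Real.cos (Real.log (h 0))| ≤ A * 1 := mul_le_mul_of_nonneg_left (Real.abs_cos_le_one _) hA
        _ ≤ A * Real.exp Real.pi := mul_le_mul_of_nonneg_left (by linarith) hA
    · intro s _
      simp only [vertexModel, if_pos hX, Function.update_of_ne (Ne.symm hi0)]

/-- **The model violates the g-form of NE9 for EVERY modulus table**: at `g₀ = e^{−2πn}` and `g₀′ = e^{−2πn−π}` the model
differs by `2(M/e^π)e^{−κd}` while `|g₀ − g₀′| < e^{−2πn} → 0`. [folklore] -/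
theorem vertexModel_not_ne9 (C : Carriers) (Bg : Type) (X₀ : C.Dom) (hX₀ : 0 < C.scale X₀) (U₀ : Bg) {γ κ M : ℝ}
    (hγ : 0 < γ) (hM : 0 < M) (Λ : ℕ → ℕ → ℝ) : ¬ NE9 (vertexModel C Bg κ M) (Window γ) κ Λ := by
  intro hNE
  set Λ₀ : ℝ := Λ (C.scale X₀) 0 with hΛ₀
  set A : ℝ := M / Real.exp Real.pi * Real.exp (-(κ * C.d X₀)) with hAdef
  have hA : 0 < A := by positivity
  have hK : 0 < M / Real.exp Real.pi := by positivity
  -- choose n with e^{−2πn} < ε := min γ ((M/e^π)/(max Λ₀ 0 + 1))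
  set ε : ℝ := min γ (M / Real.exp Real.pi / (max Λ₀ 0 + 1)) with hεdef
  have hL1 : 0 < max Λ₀ 0 + 1 := by positivity
  have hε : 0 < ε := lt_min hγ (div_pos hK hL1)
  obtain ⟨n, hn⟩ := exists_nat_gt (1 / ε)
  set x : ℝ := (n : ℝ) * (2 * Real.pi) with hxdef
  have hnx : (n : ℝ) ≤ x := le_mul_of_one_le_right (Nat.cast_nonneg n) (by linarith [Real.pi_gt_three])
  have hxexp : 1 / ε < Real.exp x := by
    have := Real.add_one_le_exp x
    linarith
  set b : ℝ := Real.exp (-x) with hbdef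
  set a : ℝ := Real.exp (-x - Real.pi) with hadef
  have hb0 : 0 < b := Real.exp_pos _
  have ha0 : 0 < a := Real.exp_pos _
  have hbε : b < ε := by
    have h1 : (Real.exp x)⁻¹ < (1 / ε)⁻¹ := inv_strictAnti₀ (one_div_pos.2 hε) hxexp
    rw [one_div, inv_inv, ← Real.exp_neg] at h1
    exact h1
  have hbγ : b ≤ γ := (hbε.trans_le (min_le_left _ _)).le
  have hab : a < b := Real.exp_lt_exp.2 (by linarith [Real.pi_pos])
  have haγ : a ≤ γ := (hab.le.trans hbγ)
  -- the two histories
  set g : ℕ → ℝ := fun _ => b with hgdef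
  set g' : ℕ → ℝ := Function.update g 0 a with hg'def
  have hg : g ∈ Window γ := fun _ => ⟨hb0, hbγ⟩
  have hg' : g' ∈ Window γ := by
    intro i
    by_cases hi : i = 0
    · subst hi; simp only [hg'def, Function.update_self]; exact ⟨ha0, haγ⟩
    · simp only [hg'def, Function.update_of_ne hi]; exact ⟨hb0, hbγ⟩
  have key := hNE g hg g' hg' U₀ X₀
  -- left-hand side = 2A
  have hEg : vertexModel C Bg κ M g U₀ X₀ = A := by
    simp only [vertexModel, if_pos hX₀, hgdef, hbdef, Real.log_exp]
    rw [show -x = -((n : ℝ) * (2 * Real.pi)) from rfl, Real.cos_neg, Real.cos_nat_mul_two_pi, mul_one]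
  have hEg' : vertexModel C Bg κ M g' U₀ X₀ = -A := by
    simp only [vertexModel, if_pos hX₀, hg'def, Function.update_self, hadef, Real.log_exp]
    rw [show -x - Real.pi = -((n : ℝ) * (2 * Real.pi) + Real.pi) by rw [hxdef]; ring, Real.cos_neg,
      Real.cos_nat_mul_two_pi_add_pi]
    ring
  have hlhs : |vertexModel C Bg κ M g U₀ X₀ - vertexModel C Bg κ M g' U₀ X₀| = 2 * A := by
    rw [hEg, hEg', sub_neg_eq_add, abs_of_pos (by linarith)]
    ring
  -- right-hand side = e^{−κd}·Λ₀·(b − a)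
  have hsum : ∑ i ∈ Finset.range (C.scale X₀), Λ (C.scale X₀) i * |g i - g' i| = Λ₀ * |b - a| := by
    rw [Finset.sum_eq_single 0]
    · simp only [hg'def, Function.update_self, hgdef, hΛ₀]
    · intro i _ hi
      simp only [hg'def, Function.update_of_ne hi, sub_self, abs_zero, mul_zero]
    · intro h0
      exact absurd (Finset.mem_range.2 hX₀) h0
  rw [hlhs, hsum] at key
  have hba : |b - a| ≤ b := by
    rw [abs_of_pos (sub_pos.2 hab)]
    linarith
  have hrhs : Λ₀ * |b - a| ≤ max Λ₀ 0 * b :=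
    (mul_le_mul_of_nonneg_right (le_max_left _ _) (abs_nonneg _)).trans
      (mul_le_mul_of_nonneg_left hba (le_max_right _ _))
  have hbK : max Λ₀ 0 * b < M / Real.exp Real.pi := by
    have h1 : b < M / Real.exp Real.pi / (max Λ₀ 0 + 1) := hbε.trans_le (min_le_right _ _)
    rw [lt_div_iff₀ hL1] at h1
    nlinarith [le_max_right Λ₀ 0]
  have : 2 * A ≤ Real.exp (-(κ * C.d X₀)) * (M / Real.exp Real.pi) := by
    calc 2 * A ≤ Real.exp (-(κ * C.d X₀)) * (Λ₀ * |b - a|) := key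
      _ ≤ Real.exp (-(κ * C.d X₀)) * (max Λ₀ 0 * b) := mul_le_mul_of_nonneg_left hrhs (Real.exp_pos _).le
      _ ≤ Real.exp (-(κ * C.d X₀)) * (M / Real.exp Real.pi) := mul_le_mul_of_nonneg_left hbK.le (Real.exp_pos _).le
  have hA' : Real.exp (-(κ * C.d X₀)) * (M / Real.exp Real.pi) = A := by rw [hAdef]; ring
  linarith

/-- **KERNEL NO-GO (shape level).**  For every carrier with a domain of positive scale, every window `]0, γ]`, every `M > 0`
and every relative radius `c < 1` there is a functional which is prefix-dependent, obeys the PRINTED decay shape (1.18) with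
constant `M`, and satisfies the UNWEIGHTED relative-radius analyticity `CouplingAnalyticRel ]0, γ]` of §6 in g-coordinates
(the located dilation form [H-dil] read in g; the disc shape `|g′ − g| < g` of the fermionic printed instance) — and for
which the g-form `NE9 E (Window γ) κ Λ` FAILS FOR EVERY history-independent modulus table `Λ`.  Hence the analytic route
delivers, for Bałaban's E-terms (bound (1.18), no g-power), the t-form / LOG-form of NE9 (§6: `ne9Log_of_couplingAnalyticRel`,
moduli `4M/min(1,c/2)`) and NOT the g-form consumed by `T4BetaReadOut.histLipschitz_of_ne9`; the g-form needs EITHER a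
g-weighted bound (§9; printed only for the R-terms, (2.31) p. 260 of [Balaban1988Convergent], and in the fermionic sibling) OR
regularity AT THE VERTEX g = 0 (print, qualitative and for the LAST coupling only: p. 263 of [Balaban1987RG1] *"It is a
C^∞-function of g_{j−1} ∈ [0, γ], (or analytic), with a positive, absolute γ."*) — the typed missing input (W5) of the module
docstring.  Negative knowledge about HYPOTHESIS SHAPES; nothing about Bałaban's functionals is asserted. [folklore] -/
theorem exists_couplingAnalyticRel_not_ne9Window (C : Carriers) (Bg : Type) (X₀ : C.Dom) (hX₀ : 0 < C.scale X₀)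
    (U₀ : Bg) {γ κ M c : ℝ} (hγ : 0 < γ) (hM : 0 < M) (hc : c < 1) :
    ∃ E : Functional C Bg, PrefixDependenceOn E (Window γ) ∧ DecayBound E (Window γ) M κ ∧
      CouplingAnalyticRel (Set.Ioc 0 γ) E κ M c ∧ ∀ Λ : ℕ → ℕ → ℝ, ¬ NE9 E (Window γ) κ Λ :=
  ⟨vertexModel C Bg κ M, vertexModel_prefix C Bg κ M _, vertexModel_decay C Bg hM.le _,
    vertexModel_rel C Bg hM.le hc, vertexModel_not_ne9 C Bg X₀ hX₀ U₀ hγ hM⟩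

/-- … while the SAME model does satisfy the LOG-form of NE9 (§6) — the two forms genuinely differ at the vertex. [folklore] -/
theorem vertexModel_ne9Log (C : Carriers) (Bg : Type) {γ κ M c : ℝ} (hM : 0 ≤ M) (hc0 : 0 < c) (hc : c < 1) :
    NE9 (fun u U X => vertexModel C Bg κ M (ofLog u) U X) (BoxWindow (Real.exp ⁻¹' Set.Ioc 0 γ)) κ
      (fun _ _ => 4 * M / min 1 (c / 2)) :=
  ne9Log_of_couplingAnalyticRel Set.ordConnected_Ioc hc0 (vertexModel_prefix C Bg κ M _) (vertexModel_rel C Bg hM hc)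

/-! ## §11  Non-vacuity of the v1.4 shapes -/

/-- The weighted shape is satisfiable jointly with prefix dependence over the same box (zero functional), for every weight.
[folklore] -/
theorem shapes_nonvacuous₃ (C : Carriers) (Bg : Type) (I : Set ℝ) (κ c : ℝ) (w : ℝ → ℝ) :
    ∃ E : Functional C Bg, CouplingAnalyticRelW I E κ 0 c w ∧ PrefixDependenceOn E (BoxWindow I) := by
  refine ⟨fun _ _ _ => 0, ?_, ?_⟩
  · intro U X h _ i _
    exact ⟨fun _ => 0, Set.univ, differentiableOn_const 0, fun s _ => Set.subset_univ _, fun s _ z _ => by simp,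
      fun s _ => by simp⟩
  · intro g _ g' _ U X _
    rfl

/-! ## §12  [v1.5] Explicit-history SOURCES beyond the last coupling: superposition moduli, the finite coupling WINDOW of the
R-operation, geometric (strata) sources, and their suppliers

WHY (located by this seat on the ×2 renders, generation 5; [R] = read as an image).  For the 𝐄-kind the last coupling is the
only EXPLICIT one: [Balaban1988Convergent] p. 271 [R p029], on the k+1-st step, *"The third expression is the logarithm of
the fluctuation field integral involving the regular terms of the effective action only, and it contributes to 𝐄^{(k+1)} and
𝐁^{(k+1)}"* (the expression at s = 0, t = 0 of (3.27), in which the coupling function is replaced by the constant 1/g_k²), and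
p. 272 [R p030] (3.30): *"Multiplying g_k by the parameter t we have … where the expectation value is with respect to the
probabilistic measure defined by the function χ^{(k)}exp[…tg_k…] in the logarithm, but with the constant g_k replaced by
tg_k"* — so `StepTransfer` (§3: last coupling + old-data channel) is the 𝐄-kind's shape.  For the 𝐑-kind and the BOUNDARY
kind the explicit coupling slots of a term born at step k + 1 are MORE than the last one:
(R) [Balaban1989LargeFieldI] p. 178 [R p004] (1.2): *"𝕋_k(Z) exp A_k = χ_k(Ω_k^{∼4}) Π_{j=k−1}^{h} 𝕋^{(j)}(Z_{j+1})
    χ_h(Ω∖Ω^∼_{h+1}) 𝕋_h(Z_h) exp A_k,"*, *"where h = k − N, and we have written explicitly the first and the last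
    characteristic functions in the product of the last N one-step operations."* ⟦every region there is intersected with Z
    by the convention of p. 177 [R p003]: *"For simplicity we denote intersections of the regions Z_j with Z by Z_j also,
    hence Z_k is identified with Z."* — v1.6 DOCFIX (cell GAPS C-pv14-90 Q1): v1.5 printed this gloss as "∩Z^{∼4}" INSIDE
    the quotation marks; (1.2) prints χ_k(Ω_k^{∼4})⟧ with the level-j densities (1.6) *"(1/z)exp[−(1/g_j²)[1 − Re tr V_j(y,
    x)]]"* — the N + 1 couplings g_{k−N}, …, g_k of the RECENT WINDOW enter an 𝐑-term explicitly; the window length is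
    restricted two-sidedly on p. 198 [R p024] after (1.94): *"The last inequality holds under two restrictions on N. At first,
    we assume that N ≤ O(1)(log g_k^{−2})^ν … with a positive integer ν satisfying ½ν ≤ p₀ − p₁ − 1. The second is that N has
    to be sufficiently large, so that the constant in the second term above can be bounded by ½α."* (⟦v1.6 CORRECTION: v1.5
    read the lower restriction as g-independent and concluded "a FIXED N is admissible for γ small"; print restricts N
    from BELOW k-dependently too — [Balaban1989LargeFieldII] p. 363 [R p009] *"N ≥ (ν/log L) log log g_k^{−2}"* and
    [Balaban1989LargeFieldI] p. 179 [R p005] *"We assume that N > N₀, in fact it will become clear later that N is much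
    greater than N₀"* (both quoted in full in §14) — so N = N(k) → ∞ in the ultraviolet, a FIXED N is NOT admissible
    uniformly in the scale, the cell's D8 synchronises N = N(ḡ) inside the printed k-dependent window, and §14 ABSORBS the
    k-dependence into the printed weight of the window term⟧); and p. 177 [R p003] (ii): *"in the preceding N
    renormalization steps no new large field regions were created inside this component, and the previous regions contained
    in it satisfy the condition (i) on the corresponding scales"* — OLDER large-field regions may be nested in the component,
    and on them the action `exp A_k` of (1.2) carries the position-dependent coupling (channel (S) below).
(B) [Balaban1988Convergent] p. 271 [R p029]: *"Introduce now auxiliary parameters s, t, the parameter t multiplying the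
    expressions 𝐁_k, A((1/g_k²(·)) − (1/g_k²), …), V^{(k)}, s multiplying 𝐑″_k"*, *"The first is the integral over t of the
    expectation value of the boundary terms, and it contributes to 𝐁^{(k+1)} only. The second is the integral over s of the
    expectation value of the R-terms, and it contributes to 𝐑^{(k+1)} and 𝐁^{(k+1)}."*; p. 277 [R p035]: *"We obtain a sum of
    terms localized in Z_k, because supp(g_k^{−2}(·) − g_k^{−2}) ⊂ Z_k. These terms contribute to the boundary terms only, and
    they are treated as above. Notice that the large values of the function g_k^{−2}(·) − g_k^{−2} are suppressed by the
    exponential decay of 𝐇_k."* — through the position-dependent coupling of p. 259 [R p017] (2.24) *"1/g²_{j−1}(x) = 1/g_j²(x)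
    + β_j(g_{j−1})φ_j(x)"* ALL older couplings enter a boundary term explicitly, LINEARLY in the exponent (coupling-function
    values × the Wilson density on the old large-field strata inside the localization domain): channel (S).
(S) THE STRATA CHANNEL is therefore common to the 𝐑- and boundary kinds; its natural moduli are FIRST-ORDER insertion bounds
    per stratum (a Cauchy estimate in one old slot alone returns the whole term's bound divided by the radius — a CONSTANT
    modulus, no decay in the age of the stratum, cf. `ne9Window_of_couplingAnalyticRelPow`); a bound on them DECAYING in the
    age k − j of the stratum is NOT PRINTED (p. 277 prints a suppression in the DEPTH into Z_k, not in the age) — cell GAPS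
    G-ne9p1-11; below it is the typed hypothesis `σ j i ≤ σ₀ν^{j−i}` of `fadingMemory_srcMod_of_geom`.
After the R-operation the action still carries the coupling function: [Balaban1989LargeFieldII] p. 390 [R p036] (1.101)
*"A_k(1/(g_k(·))², U_k) = A′_k(1/(g_k(·))², U_k) + Σ_X 𝐑′^{(k)}(X, U_k) + Σ_X 𝐁′^{(k)}(X, U_k)"*, with (1.100) *"|𝐑′^{(k)}(X,(𝐔,
𝐉))| ≤ exp(−p₀(g_k))exp(−κd_k(X))"* and the analyticity printed in (𝐔, 𝐉) only (p. 390: *"it can be extended as an analytic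
function of the variables (𝐔, 𝐉), defined on the space Ũ^c_k(X, α̃₀, α̃₁)"*).  NO coupling-difference bound of any 𝐑- or
boundary term is printed (null re-run of the (L3) searches over [Balaban1989LargeFieldI/II]: "Lipschitz", "g′", "difference
of the coupling" — no hit).

SHAPES AND THEOREMS (kernel; bookkeeping over the abstract activities of §3; NOT PRINTED as statements about Bałaban's terms;
NOT summit progress).  `StepTransferS V W σ a ω₀`: the activity born at step j + 1 depends on EVERY earlier coupling slot
i ≤ j with a per-slot SOURCE MODULUS `σ j i` plus the old-data channel of §3:
`‖V (j+1) g − V (j+1) g′‖ ≤ Σ_{i≤j} σ j i|g_i − g′_i| + a·Σ_{m≤j} ω₀^{j−m}‖V m g − V m g′‖`.  THEOREM `normNE9_of_stepTransferS`: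
⇒ `NormNE9 V W (srcMod σ (ω₀ + a))` with the SUPERPOSITION MODULI `srcMod σ μ j i = Σ_{i≤s<j} σ s i·μ^{j−1−s}` (each injection
propagates like a last coupling; proof through the one-step aggregate `aggDisc_stepS`, `aggDisc_le_srcMod`, and the renewal
recursion `srcMod_succ`; `srcMod_windowSrc_zero`: the pure last-coupling source gives back `geomMod`).  Special sources:
the WINDOW `windowSrc ℓ N` (σ j i = ℓ for j − N ≤ i ≤ j; `StepTransferN` is the same hypothesis written with the window sum,
`stepTransferN_zero_iff`: N = 0 is `StepTransfer`) ⇒ `fadingMemory_windowSrc`: `FadingMemory (ℓ(N+1)/μ^{N+1}) μ` for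
0 < μ ≤ 1 — UNIFORM IN THE SCALE IFF N IS FIXED: with a k-dependent N(g_k) the constant (N+1)μ^{−N−1} is NOT uniform and would
have to be absorbed by the term's own small factor exp(−p₀(g_k)) of (1.100), which is NOT done here (cell GAPS G-ne9p1-10)
⟦v1.6: DONE in §14 — `vwinSrc_le_geom`, `fadingMemory_vwinSrc`, `polyWindow_absorbed` / `logWindow_absorbed`,
`ne9T_of_dilationStepV`; cell GAPS G-ne9p1-10′⟧;
GEOMETRIC sources `σ j i ≤ σ₀ν^{j−i}`, 0 ≤ ν < μ ⇒ `fadingMemory_srcMod_of_geom`: `FadingMemory (σ₀/(μ−ν)) μ` (the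
convolution identity `geomConv_eq`).  SUPPLIERS: `norm_sub_le_sum_slots` (telescoping through the hybrid histories: per-slot
Lipschitz constants ⇒ the source sum), `stepTransferS_of_slotLipschitz`; `stepTransferN_of_analyticOn`: per-WINDOW-slot
DILATION analyticity in t (relative discs c·s over [t₀, ∞[, sup bound M₁; Cauchy via `Dimock2015.real_param_lipschitz`) +
EXACT independence of the slots outside the window + the old-data margin (`Dimock2015.norm_sub_le_of_margin`) + (CONTR) ⇒
`StepTransferN V (BoxWindow [t₀,∞[) (4M₁/(c·t₀)) (4M₂/ϱ) ω₀ N`; `ne9T_of_dilationStepN`: the window route END TO END ⇒ NE9 ∧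
FadingMemory with ℓ = 4M₁/(c·t₀), μ = ω₀ + 4M₂/ϱ ≤ 1, C₉ = ℓ(N+1)/μ^{N+1}.  `shapes_nonvacuous₄`.
THE WALL PER KIND, TYPED (cell record `t4/T4-EST-NE9-P1.md` §12): [H-dil-N] = [H-dil] jointly in the N + 1 dilation
parameters of the explicit window occurrences (1.2)/(1.6) with the weighted bound (1.100) preserved — INSPECTION-LEVEL as
[H-dil], NOT PRINTED; (W2-R/B) the old-data margins for the s- and t-interpolated expectations of (3.27) — p. 276 [R p034]:
*"The expression determined by 𝐑_k is treated in exactly the same way as 𝐄_k, except the second renormalization connected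
with the coupling constant renormalization counterterm, which is not needed here. In fact the analylsis* [sic] *presented in
[16] for three-dimensional models is enough here. The expression determined by the boundary terms 𝐁_k is much simpler to deal
with."* (v1.6: quoted in full, cell GAPS C-pv14-90 I1) — INSPECTION-LEVEL, NOT PRINTED; (W3), (W4) unchanged; (WIN) ⟦v1.5 wrote
"N fixed"; v1.6 §14: the k-DEPENDENT printed window is ABSORBED into the printed weight of the window term on the kernel side
(`ne9T_of_dilationStepV` + `windowWeight_absorbed_poly/log`), so (WIN) is no wall beyond [H-dil-N] WITH the weight preserved,
only the real-variable side condition "N(k) ≤ A(log g_k^{−2})^v + b with v < p₀, or N(k) ≤ a log log g_k^{−2} + b" on the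
synchronised choice of N inside the printed window⟧; (STRATA) the
age-decaying insertion bound of channel (S) — NOT PRINTED and NOT inspection-level (a real-variable estimate on the Wilson
density of the scale-k configurations over old large-field strata, or a re-routing of these kinds through the hybrid split
where such terms sit in the bad class); its typed home is the hypothesis of `fadingMemory_srcMod_of_geom`. -/

section Sources

variable {F : Type*} [SeminormedAddCommGroup F]

/-- The SUPERPOSITION MODULI of a source table `σ` (injection of coupling slot `i` at step `s + 1` with modulus `σ s i`, then
propagation with one factor `μ` per further scale): `srcMod σ μ j i = Σ_{i ≤ s < j} σ s i · μ^{j−1−s}`. [folklore] -/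
def srcMod (σ : ℕ → ℕ → ℝ) (μ : ℝ) (j i : ℕ) : ℝ := ∑ s ∈ Finset.Ico i j, σ s i * μ ^ (j - 1 - s)

/-- Off the history coordinates (`j ≤ i`) the superposition moduli vanish. [folklore] -/
theorem srcMod_of_le (σ : ℕ → ℕ → ℝ) (μ : ℝ) {j i : ℕ} (h : j ≤ i) : srcMod σ μ j i = 0 := by
  unfold srcMod
  rw [Finset.Ico_eq_empty_of_le h, Finset.sum_empty]

/-- Nonnegativity for nonnegative sources and `μ ≥ 0`. [folklore] -/
theorem srcMod_nonneg {σ : ℕ → ℕ → ℝ} {μ : ℝ} (hσ : ∀ s i, i ≤ s → 0 ≤ σ s i) (hμ : 0 ≤ μ) (j i : ℕ) :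
    0 ≤ srcMod σ μ j i :=
  Finset.sum_nonneg fun s hs => mul_nonneg (hσ s i (Finset.mem_Ico.1 hs).1) (pow_nonneg hμ _)

/-- **The renewal recursion of the superposition moduli**: one more scale = damp once and add the new injection,
`srcMod σ μ (j+1) i = μ·srcMod σ μ j i + σ j i` (`i ≤ j`). [folklore] -/
theorem srcMod_succ (σ : ℕ → ℕ → ℝ) (μ : ℝ) {j i : ℕ} (h : i ≤ j) :
    srcMod σ μ (j + 1) i = μ * srcMod σ μ j i + σ j i := by
  unfold srcMod
  rw [Finset.sum_Ico_succ_top h, Finset.mul_sum]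
  have hlast : σ j i * μ ^ (j + 1 - 1 - j) = σ j i := by
    rw [show j + 1 - 1 - j = 0 by omega, pow_zero, mul_one]
  rw [hlast]
  congr 1
  refine Finset.sum_congr rfl fun s hs => ?_
  rw [Finset.mem_Ico] at hs
  rw [show j + 1 - 1 - s = (j - 1 - s) + 1 by omega, pow_succ]
  ring

/-- HYPOTHESIS SHAPE `StepTransferS` (NOT PRINTED): the activity born at step `j + 1` depends on every earlier coupling slot
`i ≤ j` with SOURCE MODULUS `σ j i` and on the old activities through the damped channel of §3:
`‖V (j+1) g − V (j+1) g′‖ ≤ Σ_{i≤j} σ j i|g_i − g′_i| + a·Σ_{m≤j} ω₀^{j−m}‖V m g − V m g′‖`.  The pure last-coupling source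
(`σ j i = ℓ·[i = j]`) is `StepTransfer`; the window source is `StepTransferN`; the strata channel (S) of the module docstring
§12 is a general `σ`. [cite: Balaban1988Convergent, (3.27) p.271 and p.277; Balaban1989LargeFieldI, (1.2) and (1.6) p.178] -/
def StepTransferS (V : ℕ → (ℕ → ℝ) → F) (W : Set (ℕ → ℝ)) (σ : ℕ → ℕ → ℝ) (a ω₀ : ℝ) : Prop :=
  ∀ j, ∀ g ∈ W, ∀ g' ∈ W,
    ‖V (j + 1) g - V (j + 1) g'‖ ≤
      ∑ i ∈ Finset.range (j + 1), σ j i * |g i - g' i|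
        + a * ∑ m ∈ Finset.range (j + 1), ω₀ ^ (j - m) * ‖V m g - V m g'‖

/-- One-step (propagation) form with sources: `aggDisc (j+1) ≤ (ω₀ + a)·aggDisc j + Σ_{i≤j} σ j i|g_i − g′_i|`. [folklore] -/
theorem aggDisc_stepS {V : ℕ → (ℕ → ℝ) → F} {W : Set (ℕ → ℝ)} {σ : ℕ → ℕ → ℝ} {a ω₀ : ℝ}
    (hstep : StepTransferS V W σ a ω₀) (j : ℕ) {g g' : ℕ → ℝ} (hg : g ∈ W) (hg' : g' ∈ W) :
    aggDisc V ω₀ (j + 1) g g'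
      ≤ (ω₀ + a) * aggDisc V ω₀ j g g' + ∑ i ∈ Finset.range (j + 1), σ j i * |g i - g' i| := by
  rw [aggDisc_succ, add_mul]
  have h := hstep j g hg g' hg'
  change ‖V (j + 1) g - V (j + 1) g'‖ ≤ _ + a * aggDisc V ω₀ j g g' at h
  linarith

/-- **The aggregate is dominated by the superposition moduli**: `aggDisc j ≤ Σ_{i<j} srcMod σ (ω₀+a) j i·|g_i − g′_i|`
(induction on the scale with `aggDisc_stepS` and the renewal recursion `srcMod_succ`; scale 0 coupling-free). [folklore] -/
theorem aggDisc_le_srcMod {V : ℕ → (ℕ → ℝ) → F} {W : Set (ℕ → ℝ)} {σ : ℕ → ℕ → ℝ} {a ω₀ : ℝ}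
    (ha : 0 ≤ a) (hω : 0 ≤ ω₀) (h0 : ∀ g ∈ W, ∀ g' ∈ W, V 0 g = V 0 g') (hstep : StepTransferS V W σ a ω₀)
    (j : ℕ) {g g' : ℕ → ℝ} (hg : g ∈ W) (hg' : g' ∈ W) :
    aggDisc V ω₀ j g g' ≤ ∑ i ∈ Finset.range j, srcMod σ (ω₀ + a) j i * |g i - g' i| := by
  induction j with
  | zero =>
    simp [aggDisc, h0 g hg g' hg']
  | succ j ih =>
    have hμ : 0 ≤ ω₀ + a := add_nonneg hω ha
    have ih' : aggDisc V ω₀ j g g' ≤ ∑ i ∈ Finset.range (j + 1), srcMod σ (ω₀ + a) j i * |g i - g' i| := by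
      rw [Finset.sum_range_succ, srcMod_of_le σ (ω₀ + a) le_rfl, zero_mul, add_zero]
      exact ih
    calc aggDisc V ω₀ (j + 1) g g'
        ≤ (ω₀ + a) * aggDisc V ω₀ j g g' + ∑ i ∈ Finset.range (j + 1), σ j i * |g i - g' i| :=
          aggDisc_stepS hstep j hg hg'
      _ ≤ (ω₀ + a) * ∑ i ∈ Finset.range (j + 1), srcMod σ (ω₀ + a) j i * |g i - g' i|
            + ∑ i ∈ Finset.range (j + 1), σ j i * |g i - g' i| :=
          add_le_add (mul_le_mul_of_nonneg_left ih' hμ) le_rfl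
      _ = ∑ i ∈ Finset.range (j + 1), srcMod σ (ω₀ + a) (j + 1) i * |g i - g' i| := by
          rw [Finset.mul_sum, ← Finset.sum_add_distrib]
          refine Finset.sum_congr rfl fun i hi => ?_
          rw [Finset.mem_range] at hi
          rw [srcMod_succ σ (ω₀ + a) (Nat.le_of_lt_succ hi)]
          ring

/-- **Sources ⇒ norm-level NE9 with the superposition moduli** `srcMod σ (ω₀ + a)`. [folklore] -/
theorem normNE9_of_stepTransferS {V : ℕ → (ℕ → ℝ) → F} {W : Set (ℕ → ℝ)} {σ : ℕ → ℕ → ℝ} {a ω₀ : ℝ}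
    (ha : 0 ≤ a) (hω : 0 ≤ ω₀) (h0 : ∀ g ∈ W, ∀ g' ∈ W, V 0 g = V 0 g') (hstep : StepTransferS V W σ a ω₀) :
    NormNE9 V W (srcMod σ (ω₀ + a)) := fun j g hg g' hg' =>
  (norm_sub_le_aggDisc V hω j g g').trans (aggDisc_le_srcMod ha hω h0 hstep j hg hg')

/-- **Sources ⇒ NE9** for the evaluated functional, moduli `srcMod σ (ω₀ + a)`. [folklore] -/
theorem ne9_of_stepTransferS {Bg : Type} {E : Functional C Bg} {V : ℕ → (ℕ → ℝ) → F} {W : Set (ℕ → ℝ)} {κ : ℝ}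
    {σ : ℕ → ℕ → ℝ} {a ω₀ : ℝ} (ev : F → Bg → C.Dom → ℝ)
    (hev : ∀ (b b' : F) (U : Bg) (X : C.Dom), |ev b U X - ev b' U X| ≤ Real.exp (-(κ * C.d X)) * ‖b - b'‖)
    (hE : ∀ g ∈ W, ∀ (U : Bg) (X : C.Dom), E g U X = ev (V (C.scale X) g) U X)
    (ha : 0 ≤ a) (hω : 0 ≤ ω₀) (h0 : ∀ g ∈ W, ∀ g' ∈ W, V 0 g = V 0 g') (hstep : StepTransferS V W σ a ω₀) :
    NE9 E W κ (srcMod σ (ω₀ + a)) :=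
  ne9_of_normNE9 ev hev hE (normNE9_of_stepTransferS ha hω h0 hstep)

/-- The WINDOW SOURCE of length `N`: `windowSrc ℓ N s i = ℓ` if `s ≤ i + N` (slot `i` is in the window `[s − N, s]` of step
`s + 1`), else `0` — the typed form of the explicit recent couplings of the R-operation, (1.2)/(1.6) with `h = k − N`.
(v1.6, C-pv14-90 I2: for `i > s` the value is also `ℓ` — immaterial, every consumer (`srcMod`, `StepTransferS`,
`sum_windowSrc`) evaluates slots `i ≤ s` only.) [cite: Balaban1989LargeFieldI, (1.2) and (1.6) p.178] -/
def windowSrc (ℓ : ℝ) (N : ℕ) (s i : ℕ) : ℝ := if s ≤ i + N then ℓ else 0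

/-- Nonnegativity of the window source for `ℓ ≥ 0`. [folklore] -/
theorem windowSrc_nonneg {ℓ : ℝ} (hℓ : 0 ≤ ℓ) (N s i : ℕ) : 0 ≤ windowSrc ℓ N s i := by
  unfold windowSrc
  split_ifs
  · exact hℓ
  · exact le_rfl

/-- HYPOTHESIS SHAPE `StepTransferN` (NOT PRINTED): the activity born at step `j + 1` depends explicitly on the couplings of
the WINDOW `j − N ≤ m ≤ j` with modulus `ℓ` each, and on the old activities through the damped channel:
`‖V (j+1) g − V (j+1) g′‖ ≤ ℓ·Σ_{j−N ≤ m ≤ j} |g_m − g′_m| + a·Σ_{m≤j} ω₀^{j−m}‖V m g − V m g′‖`.  N = 0 is `StepTransfer`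
(`stepTransferN_zero_iff`). [cite: Balaban1989LargeFieldI, (1.2) and (1.6) p.178 and (1.94) p.198] -/
def StepTransferN (V : ℕ → (ℕ → ℝ) → F) (W : Set (ℕ → ℝ)) (ℓ a ω₀ : ℝ) (N : ℕ) : Prop :=
  ∀ j, ∀ g ∈ W, ∀ g' ∈ W,
    ‖V (j + 1) g - V (j + 1) g'‖ ≤
      ℓ * ∑ m ∈ Finset.Icc (j - N) j, |g m - g' m|
        + a * ∑ m ∈ Finset.range (j + 1), ω₀ ^ (j - m) * ‖V m g - V m g'‖

/-- The window sum is the source sum of `windowSrc`. [folklore] -/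
theorem sum_windowSrc (ℓ : ℝ) (N j : ℕ) (g g' : ℕ → ℝ) :
    ∑ i ∈ Finset.range (j + 1), windowSrc ℓ N j i * |g i - g' i| = ℓ * ∑ m ∈ Finset.Icc (j - N) j, |g m - g' m| := by
  have hset : (Finset.range (j + 1)).filter (fun i => j ≤ i + N) = Finset.Icc (j - N) j := by
    ext i
    simp only [Finset.mem_filter, Finset.mem_range, Finset.mem_Icc]
    omega
  rw [← hset, Finset.sum_filter, Finset.mul_sum]
  refine Finset.sum_congr rfl fun i _ => ?_
  unfold windowSrc
  split_ifs <;> simp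

/-- `StepTransferN` is `StepTransferS` with the window source. [folklore] -/
theorem stepTransferS_of_stepTransferN {V : ℕ → (ℕ → ℝ) → F} {W : Set (ℕ → ℝ)} {ℓ a ω₀ : ℝ} {N : ℕ}
    (h : StepTransferN V W ℓ a ω₀ N) : StepTransferS V W (windowSrc ℓ N) a ω₀ := by
  intro j g hg g' hg'
  rw [sum_windowSrc]
  exact h j g hg g' hg'

/-- Consistency with §3: the window of length 0 is the last coupling alone. [folklore] -/
theorem stepTransferN_zero_iff {V : ℕ → (ℕ → ℝ) → F} {W : Set (ℕ → ℝ)} {ℓ a ω₀ : ℝ} :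
    StepTransferN V W ℓ a ω₀ 0 ↔ StepTransfer V W ℓ a ω₀ := by
  simp only [StepTransferN, StepTransfer, Nat.sub_zero, Finset.Icc_self, Finset.sum_singleton]

/-- Consistency with §2: the superposition moduli of the length-0 window source are the geometric moduli. [folklore] -/
theorem srcMod_windowSrc_zero (ℓ μ : ℝ) : srcMod (windowSrc ℓ 0) μ = geomMod ℓ μ := by
  funext j i
  unfold srcMod geomMod windowSrc
  simp only [Nat.add_zero]
  by_cases hij : i < j
  · rw [if_pos hij, Finset.sum_eq_sum_Ico_succ_bot hij, if_pos le_rfl]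
    have hrest : ∑ s ∈ Finset.Ico (i + 1) j, (if s ≤ i then ℓ else 0) * μ ^ (j - 1 - s) = 0 := by
      refine Finset.sum_eq_zero fun s hs => ?_
      rw [Finset.mem_Ico] at hs
      rw [if_neg (by omega), zero_mul]
    rw [hrest, add_zero]
  · rw [if_neg hij, Finset.Ico_eq_empty_of_le (not_lt.1 hij), Finset.sum_empty]

/-- **Window sources have fading memory with constant `ℓ(N+1)/μ^{N+1}`** (`0 < μ ≤ 1`): at most `N + 1` injections of slot
`i`, each propagated at least `j − 1 − (i + N)` times.  The constant is UNIFORM IN THE SCALE but EXPONENTIAL IN N — a fixed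
window only. [folklore] -/
theorem srcMod_windowSrc_le {ℓ μ : ℝ} (hℓ : 0 ≤ ℓ) (hμ : 0 < μ) (hμ1 : μ ≤ 1) (N : ℕ) {j i : ℕ} (hij : i ≤ j) :
    srcMod (windowSrc ℓ N) μ j i ≤ ℓ * (N + 1) / μ ^ (N + 1) * μ ^ (j - i) := by
  unfold srcMod
  set B := ℓ / μ ^ (N + 1) * μ ^ (j - i) with hB
  have hB0 : 0 ≤ B := by positivity
  have hterm : ∀ s ∈ Finset.Ico i j,
      windowSrc ℓ N s i * μ ^ (j - 1 - s) ≤ if s ≤ i + N then B else 0 := by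
    intro s hs
    rw [Finset.mem_Ico] at hs
    unfold windowSrc
    split_ifs with h
    · rw [hB, div_mul_eq_mul_div, le_div_iff₀ (pow_pos hμ _), mul_assoc, ← pow_add]
      exact mul_le_mul_of_nonneg_left (pow_le_pow_of_le_one hμ.le hμ1 (by omega)) hℓ
    · rw [zero_mul]
  have hsub : (Finset.Ico i j).filter (fun s => s ≤ i + N) ⊆ Finset.Icc i (i + N) := by
    intro s hs
    simp only [Finset.mem_filter, Finset.mem_Ico, Finset.mem_Icc] at hs ⊢
    omega
  have hcard : (((Finset.Ico i j).filter (fun s => s ≤ i + N)).card : ℝ) ≤ N + 1 := by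
    have h1 := Finset.card_le_card hsub
    rw [Nat.card_Icc] at h1
    have h2 : ((Finset.Ico i j).filter (fun s => s ≤ i + N)).card ≤ N + 1 := by omega
    exact_mod_cast h2
  calc ∑ s ∈ Finset.Ico i j, windowSrc ℓ N s i * μ ^ (j - 1 - s)
      ≤ ∑ s ∈ Finset.Ico i j, (if s ≤ i + N then B else 0) := Finset.sum_le_sum hterm
    _ = ∑ s ∈ (Finset.Ico i j).filter (fun s => s ≤ i + N), B := (Finset.sum_filter _ _).symm
    _ = (((Finset.Ico i j).filter (fun s => s ≤ i + N)).card : ℝ) * B := by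
        rw [Finset.sum_const, nsmul_eq_mul]
    _ ≤ (N + 1 : ℝ) * B := mul_le_mul_of_nonneg_right hcard hB0
    _ = ℓ * (N + 1) / μ ^ (N + 1) * μ ^ (j - i) := by
        rw [hB]
        ring

/-- **FadingMemory of the window moduli**: `FadingMemory (ℓ(N+1)/μ^{N+1}) μ (srcMod (windowSrc ℓ N) μ)` for `0 < μ ≤ 1`,
`ℓ ≥ 0`. [folklore] -/
theorem fadingMemory_windowSrc {ℓ μ : ℝ} (hℓ : 0 ≤ ℓ) (hμ : 0 < μ) (hμ1 : μ ≤ 1) (N : ℕ) :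
    FadingMemory (ℓ * (N + 1) / μ ^ (N + 1)) μ (srcMod (windowSrc ℓ N) μ) := fun k i hik =>
  ⟨srcMod_nonneg (fun s i _ => windowSrc_nonneg hℓ N s i) hμ.le k i, srcMod_windowSrc_le hℓ hμ hμ1 N hik⟩

/-- **The window route's bookkeeping end to end**: `StepTransferN V W ℓ a ω₀ N` (+ coupling-free scale 0, + evaluation) and
`0 < ω₀ + a ≤ 1` give `NE9 E W κ Λ` and `FadingMemory (ℓ(N+1)/μ^{N+1}) μ Λ` with `μ = ω₀ + a`,
`Λ = srcMod (windowSrc ℓ N) μ`.  NOT PRINTED; NOT summit progress. [folklore] -/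
theorem ne9_and_fadingMemory_of_stepTransferN {Bg : Type} {E : Functional C Bg} {V : ℕ → (ℕ → ℝ) → F}
    {W : Set (ℕ → ℝ)} {κ ℓ a ω₀ : ℝ} {N : ℕ} (ev : F → Bg → C.Dom → ℝ)
    (hev : ∀ (b b' : F) (U : Bg) (X : C.Dom), |ev b U X - ev b' U X| ≤ Real.exp (-(κ * C.d X)) * ‖b - b'‖)
    (hE : ∀ g ∈ W, ∀ (U : Bg) (X : C.Dom), E g U X = ev (V (C.scale X) g) U X)
    (hℓ : 0 ≤ ℓ) (ha : 0 ≤ a) (hω : 0 ≤ ω₀) (hμ : 0 < ω₀ + a) (hμ1 : ω₀ + a ≤ 1)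
    (h0 : ∀ g ∈ W, ∀ g' ∈ W, V 0 g = V 0 g') (hstep : StepTransferN V W ℓ a ω₀ N) :
    NE9 E W κ (srcMod (windowSrc ℓ N) (ω₀ + a)) ∧
      FadingMemory (ℓ * (N + 1) / (ω₀ + a) ^ (N + 1)) (ω₀ + a) (srcMod (windowSrc ℓ N) (ω₀ + a)) :=
  ⟨ne9_of_stepTransferS ev hev hE ha hω h0 (stepTransferS_of_stepTransferN hstep), fadingMemory_windowSrc hℓ hμ hμ1 N⟩

/-- The convolution identity of two geometric sequences: `(μ − ν)·Σ_{i≤s<j} ν^{s−i}μ^{j−1−s} = μ^{j−i} − ν^{j−i}` (`i ≤ j`).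
[folklore] -/
theorem geomConv_eq (ν μ : ℝ) {i j : ℕ} (hij : i ≤ j) :
    (μ - ν) * ∑ s ∈ Finset.Ico i j, ν ^ (s - i) * μ ^ (j - 1 - s) = μ ^ (j - i) - ν ^ (j - i) := by
  induction j, hij using Nat.le_induction with
  | base => simp
  | succ j hij ih =>
    rw [Finset.sum_Ico_succ_top hij, mul_add]
    have hsplit : ∑ s ∈ Finset.Ico i j, ν ^ (s - i) * μ ^ (j + 1 - 1 - s)
        = μ * ∑ s ∈ Finset.Ico i j, ν ^ (s - i) * μ ^ (j - 1 - s) := by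
      rw [Finset.mul_sum]
      refine Finset.sum_congr rfl fun s hs => ?_
      rw [Finset.mem_Ico] at hs
      rw [show j + 1 - 1 - s = (j - 1 - s) + 1 by omega, pow_succ]
      ring
    rw [hsplit, show (μ - ν) * (μ * ∑ s ∈ Finset.Ico i j, ν ^ (s - i) * μ ^ (j - 1 - s))
        = μ * ((μ - ν) * ∑ s ∈ Finset.Ico i j, ν ^ (s - i) * μ ^ (j - 1 - s)) by ring, ih,
      show j + 1 - 1 - j = 0 by omega, pow_zero, mul_one, show j + 1 - i = (j - i) + 1 by omega, pow_succ, pow_succ]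
    ring

/-- **Geometric (strata-type) sources have fading memory**: if `0 ≤ σ s i ≤ σ₀ν^{s−i}` for `i ≤ s` and `0 ≤ ν < μ`, then
`FadingMemory (σ₀/(μ−ν)) μ (srcMod σ μ)`.  The decay hypothesis on `σ` is the typed form of the UNPRINTED age-decaying
insertion bound of the strata channel (S) (cell GAPS G-ne9p1-11). [folklore] -/
theorem fadingMemory_srcMod_of_geom {σ : ℕ → ℕ → ℝ} {σ₀ ν μ : ℝ} (hν : 0 ≤ ν) (hνμ : ν < μ)
    (hσ : ∀ s i, i ≤ s → 0 ≤ σ s i ∧ σ s i ≤ σ₀ * ν ^ (s - i)) :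
    FadingMemory (σ₀ / (μ - ν)) μ (srcMod σ μ) := by
  have hμ : 0 < μ := lt_of_le_of_lt hν hνμ
  have hd : 0 < μ - ν := sub_pos.2 hνμ
  have hd' : μ - ν ≠ 0 := hd.ne'
  have hσ₀ : 0 ≤ σ₀ := by
    have h := hσ 0 0 le_rfl
    have h2 : σ 0 0 ≤ σ₀ * ν ^ (0 - 0) := h.2
    rw [Nat.sub_self, pow_zero, mul_one] at h2
    exact h.1.trans h2
  intro k i hik
  refine ⟨srcMod_nonneg (fun s i h => (hσ s i h).1) hμ.le k i, ?_⟩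
  unfold srcMod
  calc ∑ s ∈ Finset.Ico i k, σ s i * μ ^ (k - 1 - s)
      ≤ ∑ s ∈ Finset.Ico i k, σ₀ * ν ^ (s - i) * μ ^ (k - 1 - s) :=
        Finset.sum_le_sum fun s hs =>
          mul_le_mul_of_nonneg_right (hσ s i (Finset.mem_Ico.1 hs).1).2 (pow_nonneg hμ.le _)
    _ = σ₀ / (μ - ν) * ((μ - ν) * ∑ s ∈ Finset.Ico i k, ν ^ (s - i) * μ ^ (k - 1 - s)) := by
        rw [Finset.mul_sum, Finset.mul_sum]
        refine Finset.sum_congr rfl fun s _ => ?_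
        rw [← mul_assoc, div_mul_cancel₀ _ hd']
        ring
    _ = σ₀ / (μ - ν) * (μ ^ (k - i) - ν ^ (k - i)) := by rw [geomConv_eq ν μ hik]
    _ ≤ σ₀ / (μ - ν) * μ ^ (k - i) :=
        mul_le_mul_of_nonneg_left (sub_le_self _ (pow_nonneg hν _)) (div_nonneg hσ₀ hd.le)

/-- **The strata route's bookkeeping end to end**: `StepTransferS` with geometrically decaying nonnegative sources
(`σ s i ≤ σ₀ν^{s−i}`, `0 ≤ ν < ω₀ + a`) gives NE9 with moduli `srcMod σ (ω₀+a)` and `FadingMemory (σ₀/(ω₀+a−ν)) (ω₀+a)`.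
NOT PRINTED; NOT summit progress. [folklore] -/
theorem ne9_and_fadingMemory_of_geomSources {Bg : Type} {E : Functional C Bg} {V : ℕ → (ℕ → ℝ) → F}
    {W : Set (ℕ → ℝ)} {κ : ℝ} {σ : ℕ → ℕ → ℝ} {σ₀ ν a ω₀ : ℝ} (ev : F → Bg → C.Dom → ℝ)
    (hev : ∀ (b b' : F) (U : Bg) (X : C.Dom), |ev b U X - ev b' U X| ≤ Real.exp (-(κ * C.d X)) * ‖b - b'‖)
    (hE : ∀ g ∈ W, ∀ (U : Bg) (X : C.Dom), E g U X = ev (V (C.scale X) g) U X)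
    (ha : 0 ≤ a) (hω : 0 ≤ ω₀) (hν : 0 ≤ ν) (hνμ : ν < ω₀ + a)
    (hσ : ∀ s i, i ≤ s → 0 ≤ σ s i ∧ σ s i ≤ σ₀ * ν ^ (s - i))
    (h0 : ∀ g ∈ W, ∀ g' ∈ W, V 0 g = V 0 g') (hstep : StepTransferS V W σ a ω₀) :
    NE9 E W κ (srcMod σ (ω₀ + a)) ∧ FadingMemory (σ₀ / (ω₀ + a - ν)) (ω₀ + a) (srcMod σ (ω₀ + a)) :=
  ⟨ne9_of_stepTransferS ev hev hE ha hω h0 hstep, fadingMemory_srcMod_of_geom hν hνμ hσ⟩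

/-- **Telescoping through the hybrid histories**: if `Ψ` depends only on the slots `≤ j` and is Lipschitz in each slot
`m ≤ j` with constant `L m` (uniformly over admissible base histories), then
`‖Ψ h − Ψ h′‖ ≤ Σ_{m≤j} L m·|h_m − h′_m|` on the box. [folklore] -/
theorem norm_sub_le_sum_slots {G : Type*} [SeminormedAddCommGroup G] {I : Set ℝ} (Ψ : (ℕ → ℝ) → G) (L : ℕ → ℝ)
    (j : ℕ) (hpre : ∀ h h' : ℕ → ℝ, (∀ m, m ≤ j → h m = h' m) → Ψ h = Ψ h')
    (hslot : ∀ H ∈ BoxWindow I, ∀ m, m ≤ j → ∀ s ∈ I, ∀ s' ∈ I,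
      ‖Ψ (Function.update H m s) - Ψ (Function.update H m s')‖ ≤ L m * |s - s'|) :
    ∀ h ∈ BoxWindow I, ∀ h' ∈ BoxWindow I, ‖Ψ h - Ψ h'‖ ≤ ∑ m ∈ Finset.range (j + 1), L m * |h m - h' m| := by
  intro h hh h' hh'
  set f : ℕ → G := fun m => Ψ (hybrid h h' m) with hf
  have h0 : f 0 = Ψ h := by
    simp only [hf, hybrid_zero]
  have hfin : f (j + 1) = Ψ h' := by
    simp only [hf]
    exact hpre _ _ fun m hm => hybrid_apply_lt h h' (Nat.lt_succ_of_le hm)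
  have htel : Ψ h - Ψ h' = ∑ m ∈ Finset.range (j + 1), (f m - f (m + 1)) := by
    rw [Finset.sum_range_sub', h0, hfin]
  have hstep : ∀ m ∈ Finset.range (j + 1), ‖f m - f (m + 1)‖ ≤ L m * |h m - h' m| := by
    intro m hm
    rw [Finset.mem_range] at hm
    have e1 : f m = Ψ (Function.update (hybrid h h' m) m (h m)) := by
      rw [update_hybrid_self]
    have e2 : f (m + 1) = Ψ (Function.update (hybrid h h' m) m (h' m)) := by
      simp only [hf, hybrid_succ]
    rw [e1, e2]
    exact hslot _ (hybrid_mem_boxWindow hh hh' m) m (Nat.le_of_lt_succ hm) _ (hh m) _ (hh' m)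
  calc ‖Ψ h - Ψ h'‖ = ‖∑ m ∈ Finset.range (j + 1), (f m - f (m + 1))‖ := by rw [htel]
    _ ≤ ∑ m ∈ Finset.range (j + 1), ‖f m - f (m + 1)‖ := norm_sum_le _ _
    _ ≤ ∑ m ∈ Finset.range (j + 1), L m * |h m - h' m| := Finset.sum_le_sum hstep

/-- **Per-slot Lipschitz constants of the step map ⇒ `StepTransferS`**: the step `V (j+1) g = Φ j g (T j g)` with `Φ j`
depending on the history only through the slots `≤ j`, Lipschitz in slot `m` with constant `σ j m` at admissible old data,
`a`-Lipschitz in the old data on the transported admissible set, and (CONTR). One triangle inequality and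
`norm_sub_le_sum_slots`. [folklore] -/
theorem stepTransferS_of_slotLipschitz {V : ℕ → (ℕ → ℝ) → F} {I : Set ℝ} (T : ℕ → (ℕ → ℝ) → F)
    (Φ : ℕ → (ℕ → ℝ) → F → F) (σ : ℕ → ℕ → ℝ) {a ω₀ : ℝ} (ha : 0 ≤ a)
    (hV : ∀ j, ∀ g ∈ BoxWindow I, V (j + 1) g = Φ j g (T j g))
    (hpre : ∀ j (w : F) (h h' : ℕ → ℝ), (∀ m, m ≤ j → h m = h' m) → Φ j h w = Φ j h' w)
    (hslot : ∀ j, ∀ g ∈ BoxWindow I, ∀ H ∈ BoxWindow I, ∀ m, m ≤ j → ∀ s ∈ I, ∀ s' ∈ I,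
      ‖Φ j (Function.update H m s) (T j g) - Φ j (Function.update H m s') (T j g)‖ ≤ σ j m * |s - s'|)
    (hold : ∀ j, ∀ H ∈ BoxWindow I, ∀ g ∈ BoxWindow I, ∀ g' ∈ BoxWindow I,
      ‖Φ j H (T j g) - Φ j H (T j g')‖ ≤ a * ‖T j g - T j g'‖)
    (hT : ∀ j, ∀ g ∈ BoxWindow I, ∀ g' ∈ BoxWindow I,
      ‖T j g - T j g'‖ ≤ ∑ m ∈ Finset.range (j + 1), ω₀ ^ (j - m) * ‖V m g - V m g'‖) :
    StepTransferS V (BoxWindow I) σ a ω₀ := by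
  intro j g hg g' hg'
  have h1 : ‖Φ j g (T j g) - Φ j g' (T j g)‖ ≤ ∑ m ∈ Finset.range (j + 1), σ j m * |g m - g' m| :=
    norm_sub_le_sum_slots (fun h => Φ j h (T j g)) (σ j) j (fun h h' hh => hpre j _ h h' hh)
      (fun H hH m hm s hs s' hs' => hslot j g hg H hH m hm s hs s' hs') g hg g' hg'
  have h2 : ‖Φ j g' (T j g) - Φ j g' (T j g')‖ ≤ a * ‖T j g - T j g'‖ := hold j g' hg' g hg g' hg'
  rw [hV j g hg, hV j g' hg']
  calc ‖Φ j g (T j g) - Φ j g' (T j g')‖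
      ≤ ‖Φ j g (T j g) - Φ j g' (T j g)‖ + ‖Φ j g' (T j g) - Φ j g' (T j g')‖ :=
        norm_sub_le_norm_sub_add_norm_sub _ _ _
    _ ≤ ∑ m ∈ Finset.range (j + 1), σ j m * |g m - g' m| + a * ‖T j g - T j g'‖ := add_le_add h1 h2
    _ ≤ ∑ m ∈ Finset.range (j + 1), σ j m * |g m - g' m|
          + a * ∑ m ∈ Finset.range (j + 1), ω₀ ^ (j - m) * ‖V m g - V m g'‖ :=
        add_le_add le_rfl (mul_le_mul_of_nonneg_left (hT j g hg g' hg') ha)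

end Sources

section WindowAnalytic

variable {F : Type*} [NormedAddCommGroup F] [NormedSpace ℂ F] [CompleteSpace F]

/-- **The Cauchy constants of the WINDOW step map ⇒ `StepTransferN`** (the analytic route for the 𝐑-kind's explicit recent
couplings, in t-coordinates over `[t₀, ∞[` with DILATION radii): the step is `V (j+1) g = Φ j g (T j g)` with `Φ j` seeing
the history ONLY through the window slots `j − N ≤ m ≤ j` (`hwin`); (AN-WIN-dil) for every admissible `g`, base history `H`
and window slot `m`, `s ↦ Φ j (H[m := s]) (T j g)` extends analytically to the relative discs `|z − s| ≤ c·s`, `s ≥ t₀`, with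
sup bound `M₁`; (AN-OLD) `w ↦ Φ j H w` analytic on a `ϱ`-margin of the admissible old data with sup bound `M₂`; (CONTR).
Then `StepTransferN V (BoxWindow [t₀,∞[) (4M₁/(c·t₀)) (4M₂/ϱ) ω₀ N` — `Dimock2015.real_param_lipschitz` per window slot,
exact independence below the window, `Dimock2015.norm_sub_le_of_margin` for the old data.  Every analytic hypothesis is NOT
PRINTED for Bałaban's 𝐑-operation ([H-dil-N], (W2-R), (W3)); the mechanism is Dimock's printed one.
[cite: Dimock2015, Sect. 7 proof of Lemma 25 (arXiv:1512.04373 TeX ll. 5647–5679)] -/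
theorem stepTransferN_of_analyticOn {V : ℕ → (ℕ → ℝ) → F} {t₀ c : ℝ} (T : ℕ → (ℕ → ℝ) → F)
    (Φ : ℕ → (ℕ → ℝ) → F → F) {N : ℕ} {M₁ M₂ ϱ ω₀ : ℝ} (ht₀ : 0 < t₀) (hc : 0 < c) (hϱ : 0 < ϱ) (hM₂ : 0 ≤ M₂)
    (hV : ∀ j, ∀ g ∈ BoxWindow (Set.Ici t₀), V (j + 1) g = Φ j g (T j g))
    (hwin : ∀ j (w : F) (h h' : ℕ → ℝ), (∀ m ∈ Finset.Icc (j - N) j, h m = h' m) → Φ j h w = Φ j h' w)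
    (hlast : ∀ j, ∀ g ∈ BoxWindow (Set.Ici t₀), ∀ H ∈ BoxWindow (Set.Ici t₀), ∀ m ∈ Finset.Icc (j - N) j,
      ∃ (G : ℂ → F) (D : Set ℂ), DifferentiableOn ℂ G D ∧ (∀ z ∈ D, ‖G z‖ ≤ M₁) ∧
        (∀ s ∈ Set.Ici t₀, closedBall (s : ℂ) (c * s) ⊆ D) ∧
        ∀ s ∈ Set.Ici t₀, G s = Φ j (Function.update H m s) (T j g))
    (hold : ∀ j, ∀ H ∈ BoxWindow (Set.Ici t₀), ∃ D : Set F, DifferentiableOn ℂ (Φ j H) D ∧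
      (∀ w ∈ D, ‖Φ j H w‖ ≤ M₂) ∧ ∀ g ∈ BoxWindow (Set.Ici t₀), closedBall (T j g) ϱ ⊆ D)
    (hT : ∀ j, ∀ g ∈ BoxWindow (Set.Ici t₀), ∀ g' ∈ BoxWindow (Set.Ici t₀),
      ‖T j g - T j g'‖ ≤ ∑ m ∈ Finset.range (j + 1), ω₀ ^ (j - m) * ‖V m g - V m g'‖) :
    StepTransferN V (BoxWindow (Set.Ici t₀)) (4 * M₁ / (c * t₀)) (4 * M₂ / ϱ) ω₀ N := by
  have hS : StepTransferS V (BoxWindow (Set.Ici t₀)) (windowSrc (4 * M₁ / (c * t₀)) N) (4 * M₂ / ϱ) ω₀ := by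
    refine stepTransferS_of_slotLipschitz T Φ _ (by positivity) hV ?_ ?_ ?_ hT
    · -- dependence on the slots ≤ j only, from the window dependence
      intro j w h h' hh
      exact hwin j w h h' fun m hm => hh m (Finset.mem_Icc.1 hm).2
    · -- per-slot Lipschitz constants: Cauchy on the window slots, exact independence below the window
      intro j g hg H hH m hm s hs s' hs'
      by_cases hwm : j ≤ m + N
      · have hmI : m ∈ Finset.Icc (j - N) j := Finset.mem_Icc.2 ⟨by omega, hm⟩
        obtain ⟨G, D, hG, hGM, hD, hGE⟩ := hlast j g hg H hH m hmI
        have hDab : ∀ u ∈ Icc (min s s') (max s s'), closedBall (u : ℂ) (c * t₀) ⊆ D := by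
          intro u hu
          have ht₀u : t₀ ≤ u := le_trans (le_min hs hs') hu.1
          exact (closedBall_subset_closedBall (mul_le_mul_of_nonneg_left ht₀u hc.le)).trans (hD u ht₀u)
        have key := real_param_lipschitz (g := G) (mul_pos hc ht₀) hG hGM hDab
          (s := s) (t := s') ⟨min_le_left _ _, le_max_left _ _⟩ ⟨min_le_right _ _, le_max_right _ _⟩
        rw [hGE s hs, hGE s' hs'] at key
        have hsrc : windowSrc (4 * M₁ / (c * t₀)) N j m = 4 * M₁ / (c * t₀) := if_pos hwm
        rw [hsrc]
        exact key
      · have hEq : Φ j (Function.update H m s) (T j g) = Φ j (Function.update H m s') (T j g) := by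
          refine hwin j _ _ _ fun m' hm' => ?_
          have hne : m' ≠ m := by
            intro h'
            rw [Finset.mem_Icc] at hm'
            omega
          simp [hne]
        have hsrc : windowSrc (4 * M₁ / (c * t₀)) N j m = 0 := if_neg hwm
        rw [hEq, hsrc, sub_self, norm_zero, zero_mul]
    · -- old data: the margin Cauchy estimate
      intro j H hH g hg g' hg'
      obtain ⟨D, hD, hM, hball⟩ := hold j H hH
      have hSS : ∀ y ∈ (fun h : ℕ → ℝ => T j h) '' BoxWindow (Set.Ici t₀), closedBall y ϱ ⊆ D := by
        rintro _ ⟨h, hh, rfl⟩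
        exact hball h hh
      exact norm_sub_le_of_margin hϱ hD hM hSS (mem_image_of_mem _ hg) (mem_image_of_mem _ hg')
  intro j g hg g' hg'
  have h := hS j g hg g' hg'
  rwa [sum_windowSrc] at h

/-- **The window route END TO END in t-coordinates with dilation radii** (the analytic member for the 𝐑-kind's explicit recent
couplings): (AN-WIN-dil) + exact independence outside the window + (AN-OLD) + (CONTR) + coupling-free scale 0 + evaluation +
`0 < ω₀ + 4M₂/ϱ ≤ 1` give `NE9 E (BoxWindow [t₀,∞[) κ Λ` and `FadingMemory (ℓ(N+1)/μ^{N+1}) μ Λ` with `ℓ = 4M₁/(c·t₀)`,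
`μ = ω₀ + 4M₂/ϱ`, `Λ = srcMod (windowSrc ℓ N) μ` — every constant explicit, the window length N entering ONLY the fading-memory
constant (uniform in the scale iff N is fixed).  Every analytic hypothesis is NOT PRINTED ([H-dil-N], (W2-R), (W3), (W4),
(WIN)); NOT summit progress. [folklore] -/
theorem ne9T_of_dilationStepN {Bg : Type} {E : Functional C Bg} {V : ℕ → (ℕ → ℝ) → F} {t₀ κ c : ℝ}
    (T : ℕ → (ℕ → ℝ) → F) (Φ : ℕ → (ℕ → ℝ) → F → F) (ev : F → Bg → C.Dom → ℝ)
    {N : ℕ} {M₁ M₂ ϱ ω₀ : ℝ} (ht₀ : 0 < t₀) (hc : 0 < c) (hϱ : 0 < ϱ) (hM₁ : 0 ≤ M₁) (hM₂ : 0 ≤ M₂) (hω : 0 ≤ ω₀)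
    (hμ : 0 < ω₀ + 4 * M₂ / ϱ) (hμ1 : ω₀ + 4 * M₂ / ϱ ≤ 1)
    (hev : ∀ (b b' : F) (U : Bg) (X : C.Dom), |ev b U X - ev b' U X| ≤ Real.exp (-(κ * C.d X)) * ‖b - b'‖)
    (hE : ∀ g ∈ BoxWindow (Set.Ici t₀), ∀ (U : Bg) (X : C.Dom), E g U X = ev (V (C.scale X) g) U X)
    (h0 : ∀ g ∈ BoxWindow (Set.Ici t₀), ∀ g' ∈ BoxWindow (Set.Ici t₀), V 0 g = V 0 g')
    (hV : ∀ j, ∀ g ∈ BoxWindow (Set.Ici t₀), V (j + 1) g = Φ j g (T j g))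
    (hwin : ∀ j (w : F) (h h' : ℕ → ℝ), (∀ m ∈ Finset.Icc (j - N) j, h m = h' m) → Φ j h w = Φ j h' w)
    (hlast : ∀ j, ∀ g ∈ BoxWindow (Set.Ici t₀), ∀ H ∈ BoxWindow (Set.Ici t₀), ∀ m ∈ Finset.Icc (j - N) j,
      ∃ (G : ℂ → F) (D : Set ℂ), DifferentiableOn ℂ G D ∧ (∀ z ∈ D, ‖G z‖ ≤ M₁) ∧
        (∀ s ∈ Set.Ici t₀, closedBall (s : ℂ) (c * s) ⊆ D) ∧
        ∀ s ∈ Set.Ici t₀, G s = Φ j (Function.update H m s) (T j g))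
    (hold : ∀ j, ∀ H ∈ BoxWindow (Set.Ici t₀), ∃ D : Set F, DifferentiableOn ℂ (Φ j H) D ∧
      (∀ w ∈ D, ‖Φ j H w‖ ≤ M₂) ∧ ∀ g ∈ BoxWindow (Set.Ici t₀), closedBall (T j g) ϱ ⊆ D)
    (hT : ∀ j, ∀ g ∈ BoxWindow (Set.Ici t₀), ∀ g' ∈ BoxWindow (Set.Ici t₀),
      ‖T j g - T j g'‖ ≤ ∑ m ∈ Finset.range (j + 1), ω₀ ^ (j - m) * ‖V m g - V m g'‖) :
    NE9 E (BoxWindow (Set.Ici t₀)) κ (srcMod (windowSrc (4 * M₁ / (c * t₀)) N) (ω₀ + 4 * M₂ / ϱ)) ∧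
      FadingMemory (4 * M₁ / (c * t₀) * (N + 1) / (ω₀ + 4 * M₂ / ϱ) ^ (N + 1)) (ω₀ + 4 * M₂ / ϱ)
        (srcMod (windowSrc (4 * M₁ / (c * t₀)) N) (ω₀ + 4 * M₂ / ϱ)) := by
  have hstep := stepTransferN_of_analyticOn T Φ ht₀ hc hϱ hM₂ hV hwin hlast hold hT
  have ha : 0 ≤ 4 * M₂ / ϱ := by positivity
  have hℓ : 0 ≤ 4 * M₁ / (c * t₀) := by positivity
  exact ne9_and_fadingMemory_of_stepTransferN ev hev hE hℓ ha hω hμ hμ1 h0 hstep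

end WindowAnalytic

/-! ## §13  Non-vacuity of the v1.5 shapes -/

/-- The source shapes are satisfiable (zero activities in `ℂ`, any nonnegative source table, any window), so no v1.5
theorem is vacuously true by contradiction. [folklore] -/
theorem shapes_nonvacuous₄ (W : Set (ℕ → ℝ)) {σ : ℕ → ℕ → ℝ} (hσ : ∀ s i, 0 ≤ σ s i) {ℓ : ℝ} (hℓ : 0 ≤ ℓ) (N : ℕ) :
    ∃ V : ℕ → (ℕ → ℝ) → ℂ, StepTransferS V W σ 0 0 ∧ StepTransferN V W ℓ 0 0 N := by
  refine ⟨fun _ _ => 0, ?_, ?_⟩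
  · intro j g _ g' _
    simp only [sub_self, norm_zero, zero_mul, add_zero]
    exact Finset.sum_nonneg fun i _ => mul_nonneg (hσ j i) (abs_nonneg _)
  · intro j g _ g' _
    simp only [sub_self, norm_zero, zero_mul, add_zero]
    exact mul_nonneg hℓ (Finset.sum_nonneg fun i _ => abs_nonneg _)

/-! ## §14  [v1.6] (WIN) on the kernel side: the k-DEPENDENT coupling window of the R-operation ABSORBED into the printed weight

WHY (located on the ×2 renders, generation 6; [R] = read as an image; CORRECTS v1.5's reading of (WIN)).  Print restricts the
window length N TWO-SIDEDLY AND k-DEPENDENTLY.  Upper: [Balaban1989LargeFieldI] p. 198 [R p024] (quoted in §12).  Lower: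
[Balaban1989LargeFieldII] p. 363 [R p009]: *"The number multiplying g_k² is small if L^{−N} is small enough, for example if
L^{−N} ≤ (log g_k^{−2})^{−ν} for sufficiently large ν, or N ≥ (ν/log L) log log g_k^{−2}. For the smallness of the above
bound we need ν ≥ 2p₀ + dr₀."*, and [Balaban1989LargeFieldI] p. 179 [R p005]: *"Take the smallest positive integer N₀ such,
that L^{−N₀+1}MR_{k−N₀+1} = M. … We assume that N > N₀, in fact it will become clear later that N is much greater than
N₀."*  Hence N = N(k) → ∞ in the ultraviolet, a FIXED window (§12 `fadingMemory_windowSrc`, C₉ = ℓ(N+1)/μ^{N+1}) is NOT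
admissible uniformly in the scale, and v1.5's "(WIN) N fixed" misread p. 198's *"N has to be sufficiently large"* (cell GAPS
G-ne9p1-10 → G-ne9p1-10′).  THE REPAIR: the window term born at step k + 1 carries a printed WEIGHT — [Balaban1989LargeFieldII]
(1.100) p. 390 *"|𝐑′^{(k)}(X,(𝐔,𝐉))| ≤ exp(−p₀(g_k))exp(−κd_k(X))"* with [Balaban1989LargeFieldI] p. 175 [R p001] *"p₀(g₀) =
A₀(log g₀^{−2})^{p₀} with a positive integer p₀"*, resp. [Balaban1988Convergent] (2.31) p. 260 *"|R^{(j)}(X,(U,J))| ≤ g_j^{κ₀}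
exp(−κd_j(X))"* — so under [H-dil-N] WITH THE WEIGHT PRESERVED (NOT PRINTED, inspection-level, unchanged) the per-slot Cauchy
constant of the window term is ℓ_k = 4M·w_k/(c·t₀), w_k = exp(−A₀G_k^{p₀}) resp. exp(−(κ₀/2)G_k), G_k = log g_k^{−2} = log t_k,
and ℓ_k·ν^{−N(k)} is BOUNDED UNIFORMLY IN k once N(k) ≤ A·G_k^v + b with v < p₀ (`polyWindow_absorbed`; such N lie in the
printed window for g_k small — its lower end is log log — and the cell's NE7b wants N low in the window, cell GAPS G-t4-U4-2 (b)),
or N(k) ≤ a·log G_k + b against any exponential weight (`logWindow_absorbed`).  An absorbed window source is dominated by a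
GEOMETRIC source, and geometric sources have fading memory UNIFORMLY in the scale (§12 `fadingMemory_srcMod_of_geom`).

SHAPES AND THEOREMS (kernel; bookkeeping over the abstract activities of §3/§12 plus pure real analysis; NOT PRINTED as
statements about Bałaban's terms; NOT summit progress): `vwinSrc ℓ N` / `StepTransferV` (step-dependent modulus `ℓ s` and
length `N s`; constant data = §12), `sum_vwinSrc`, `stepTransferS_of_stepTransferV`; ABSORPTION `vwinSrc_le_geom`,
`fadingMemory_vwinSrc` (C₉ = σ₀/(μ−ν) — NO dependence on the window length), `ne9_and_fadingMemory_of_stepTransferV`; PROFILES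
`logWindow_absorbed`, `polyWindow_absorbed` (λ = log ν⁻¹; proofs: log G ≤ 2√G and a square, resp. the regimes G ≤ X₁ / G > X₁ =
max(1, Aλ/A₀)), bridges `windowWeight_absorbed_poly/log` (⇒ the absorption hypothesis 4M₁ j/(c·t₀) ≤ σ₀ν^{N j}, σ₀ explicit);
SUPPLIER `stepTransferV_of_analyticOn` (Cauchy per slot of the step-dependent window, step-dependent sup bound M₁ j) and
`ne9T_of_dilationStepV` (END TO END ⇒ NE9 ∧ FadingMemory (σ₀/(μ−ν)) μ, μ = ω₀ + 4M₂/ϱ, UNIFORM IN THE SCALE although N j is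
unbounded).  §15 `shapes_nonvacuous₅`.  UNPRINTED AND
UNTOUCHED: [H-dil-N] WITH the weight, (W2-R/B), (W3), (W4), (STRATA).  (WIN) is thus no separate wall but the real-variable
side condition "N(k) ≤ A(log g_k^{−2})^v + b, v < p₀ (or log-log)" on the synchronised choice of N in the printed window (D8),
proved sufficient here. -/

section VarWindow

variable {F : Type*} [SeminormedAddCommGroup F]

/-- The VARIABLE-WINDOW SOURCE: `vwinSrc ℓ N s i = ℓ s` if `s ≤ i + N s`, else `0` — at step `s + 1` the slots
`s − N s ≤ i ≤ s` of the step-dependent window carry the step-dependent modulus `ℓ s`; the typed form of the explicit recent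
couplings of the R-operation (1.2)/(1.6), `h = k − N`, with N = N(k) in the printed k-dependent window.
[cite: Balaban1989LargeFieldI, (1.2) and (1.6) p.178, p.179, (1.94) p.198; Balaban1989LargeFieldII, p.363] -/
def vwinSrc (ℓ : ℕ → ℝ) (N : ℕ → ℕ) (s i : ℕ) : ℝ := if s ≤ i + N s then ℓ s else 0

/-- Consistency with §12: constant modulus and constant length give back `windowSrc`. [folklore] -/
theorem vwinSrc_const (ℓ : ℝ) (N : ℕ) : vwinSrc (fun _ => ℓ) (fun _ => N) = windowSrc ℓ N := by
  funext s i
  rfl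

/-- Nonnegativity of the variable-window source for `ℓ ≥ 0`. [folklore] -/
theorem vwinSrc_nonneg {ℓ : ℕ → ℝ} (hℓ : ∀ s, 0 ≤ ℓ s) (N : ℕ → ℕ) (s i : ℕ) : 0 ≤ vwinSrc ℓ N s i := by
  unfold vwinSrc
  split_ifs
  · exact hℓ s
  · exact le_rfl

/-- HYPOTHESIS SHAPE `StepTransferV` (NOT PRINTED): `StepTransferN` with a STEP-DEPENDENT window `j − N j ≤ m ≤ j` and
modulus `ℓ j`: `‖V (j+1) g − V (j+1) g′‖ ≤ ℓ j·Σ_{j−N j ≤ m ≤ j} |g_m − g′_m| + a·Σ_{m≤j} ω₀^{j−m}‖V m g − V m g′‖`.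
[cite: Balaban1989LargeFieldI, (1.2) and (1.6) p.178 and (1.94) p.198; Balaban1989LargeFieldII, (1.100) p.390 and p.363] -/
def StepTransferV (V : ℕ → (ℕ → ℝ) → F) (W : Set (ℕ → ℝ)) (ℓ : ℕ → ℝ) (a ω₀ : ℝ) (N : ℕ → ℕ) : Prop :=
  ∀ j, ∀ g ∈ W, ∀ g' ∈ W,
    ‖V (j + 1) g - V (j + 1) g'‖ ≤
      ℓ j * ∑ m ∈ Finset.Icc (j - N j) j, |g m - g' m|
        + a * ∑ m ∈ Finset.range (j + 1), ω₀ ^ (j - m) * ‖V m g - V m g'‖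

/-- Consistency with §12: constant modulus and length is `StepTransferN`. [folklore] -/
theorem stepTransferV_const_iff {V : ℕ → (ℕ → ℝ) → F} {W : Set (ℕ → ℝ)} {ℓ a ω₀ : ℝ} {N : ℕ} :
    StepTransferV V W (fun _ => ℓ) a ω₀ (fun _ => N) ↔ StepTransferN V W ℓ a ω₀ N := Iff.rfl

/-- The variable-window sum is the source sum of `vwinSrc`. [folklore] -/
theorem sum_vwinSrc (ℓ : ℕ → ℝ) (N : ℕ → ℕ) (j : ℕ) (g g' : ℕ → ℝ) :
    ∑ i ∈ Finset.range (j + 1), vwinSrc ℓ N j i * |g i - g' i|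
      = ℓ j * ∑ m ∈ Finset.Icc (j - N j) j, |g m - g' m| := by
  have hset : (Finset.range (j + 1)).filter (fun i => j ≤ i + N j) = Finset.Icc (j - N j) j := by
    ext i
    simp only [Finset.mem_filter, Finset.mem_range, Finset.mem_Icc]
    omega
  rw [← hset, Finset.sum_filter, Finset.mul_sum]
  refine Finset.sum_congr rfl fun i _ => ?_
  unfold vwinSrc
  split_ifs <;> simp

/-- `StepTransferV` is `StepTransferS` with the variable-window source. [folklore] -/
theorem stepTransferS_of_stepTransferV {V : ℕ → (ℕ → ℝ) → F} {W : Set (ℕ → ℝ)} {ℓ : ℕ → ℝ} {a ω₀ : ℝ}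
    {N : ℕ → ℕ} (h : StepTransferV V W ℓ a ω₀ N) : StepTransferS V W (vwinSrc ℓ N) a ω₀ := by
  intro j g hg g' hg'
  rw [sum_vwinSrc]
  exact h j g hg g' hg'

/-- **ABSORPTION**: `0 ≤ ℓ s ≤ σ₀·ν^{N s}` with `0 ≤ ν ≤ 1`, `σ₀ ≥ 0` ⇒ the variable-window source is dominated by a
GEOMETRIC one, `0 ≤ vwinSrc ℓ N s i ≤ σ₀·ν^{s−i}` for `i ≤ s` (in the window `s − i ≤ N s`, so `ν^{N s} ≤ ν^{s−i}`) — the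
hypothesis of `fadingMemory_srcMod_of_geom`. [folklore] -/
theorem vwinSrc_le_geom {ℓ : ℕ → ℝ} {N : ℕ → ℕ} {σ₀ ν : ℝ} (hσ₀ : 0 ≤ σ₀) (hν : 0 ≤ ν) (hν1 : ν ≤ 1)
    (hℓ : ∀ s, 0 ≤ ℓ s ∧ ℓ s ≤ σ₀ * ν ^ N s) :
    ∀ s i, i ≤ s → 0 ≤ vwinSrc ℓ N s i ∧ vwinSrc ℓ N s i ≤ σ₀ * ν ^ (s - i) := by
  intro s i _
  unfold vwinSrc
  split_ifs with h
  · exact ⟨(hℓ s).1, (hℓ s).2.trans (mul_le_mul_of_nonneg_left (pow_le_pow_of_le_one hν hν1 (by omega)) hσ₀)⟩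
  · exact ⟨le_rfl, mul_nonneg hσ₀ (pow_nonneg hν _)⟩

/-- **FadingMemory of the absorbed variable window, UNIFORMLY IN THE SCALE**: `0 ≤ ℓ s ≤ σ₀ν^{N s}`, `0 ≤ ν < μ`, `ν ≤ 1`
⇒ `FadingMemory (σ₀/(μ−ν)) μ (srcMod (vwinSrc ℓ N) μ)` — no dependence on the (unbounded) window length, in contrast with
`fadingMemory_windowSrc`'s `ℓ(N+1)/μ^{N+1}`. [folklore] -/
theorem fadingMemory_vwinSrc {ℓ : ℕ → ℝ} {N : ℕ → ℕ} {σ₀ ν μ : ℝ} (hσ₀ : 0 ≤ σ₀) (hν : 0 ≤ ν) (hν1 : ν ≤ 1)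
    (hνμ : ν < μ) (hℓ : ∀ s, 0 ≤ ℓ s ∧ ℓ s ≤ σ₀ * ν ^ N s) :
    FadingMemory (σ₀ / (μ - ν)) μ (srcMod (vwinSrc ℓ N) μ) :=
  fadingMemory_srcMod_of_geom hν hνμ (vwinSrc_le_geom hσ₀ hν hν1 hℓ)

/-- **Bookkeeping end to end**: `StepTransferV V W ℓ a ω₀ N`, the absorption `0 ≤ ℓ s ≤ σ₀ν^{N s}`, `0 ≤ ν < ω₀ + a ≤ 1`
(+ coupling-free scale 0, + evaluation) ⇒ `NE9 E W κ Λ ∧ FadingMemory (σ₀/(ω₀+a−ν)) (ω₀+a) Λ`, `Λ = srcMod (vwinSrc ℓ N)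
(ω₀+a)` — uniform in the scale for an UNBOUNDED window length.  NOT PRINTED; NOT summit progress. [folklore] -/
theorem ne9_and_fadingMemory_of_stepTransferV {Bg : Type} {E : Functional C Bg} {V : ℕ → (ℕ → ℝ) → F}
    {W : Set (ℕ → ℝ)} {κ a ω₀ σ₀ ν : ℝ} {ℓ : ℕ → ℝ} {N : ℕ → ℕ} (ev : F → Bg → C.Dom → ℝ)
    (hev : ∀ (b b' : F) (U : Bg) (X : C.Dom), |ev b U X - ev b' U X| ≤ Real.exp (-(κ * C.d X)) * ‖b - b'‖)
    (hE : ∀ g ∈ W, ∀ (U : Bg) (X : C.Dom), E g U X = ev (V (C.scale X) g) U X)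
    (ha : 0 ≤ a) (hω : 0 ≤ ω₀) (hσ₀ : 0 ≤ σ₀) (hν : 0 ≤ ν) (hνμ : ν < ω₀ + a) (hμ1 : ω₀ + a ≤ 1)
    (hℓ : ∀ s, 0 ≤ ℓ s ∧ ℓ s ≤ σ₀ * ν ^ N s)
    (h0 : ∀ g ∈ W, ∀ g' ∈ W, V 0 g = V 0 g') (hstep : StepTransferV V W ℓ a ω₀ N) :
    NE9 E W κ (srcMod (vwinSrc ℓ N) (ω₀ + a)) ∧
      FadingMemory (σ₀ / (ω₀ + a - ν)) (ω₀ + a) (srcMod (vwinSrc ℓ N) (ω₀ + a)) :=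
  ⟨ne9_of_stepTransferS ev hev hE ha hω h0 (stepTransferS_of_stepTransferV hstep),
    fadingMemory_vwinSrc hσ₀ hν (hνμ.le.trans hμ1) hνμ hℓ⟩

end VarWindow

section Profiles

/-- **A LOG-LOG window is absorbed by ANY exponential weight** (real variables; G = log g⁻² = log t ≥ 1): `N ≤ a·log G + b`
(`a ≥ 0`; the growth of the printed LOWER restriction *"N ≥ (ν/log L) log log g_k^{−2}"*, [Balaban1989LargeFieldII] p. 363),
`0 < ν ≤ 1`, `κ > 0` ⇒ `exp(−κG) ≤ exp(b·log ν⁻¹ + 4(a·log ν⁻¹)²/κ)·ν^N` (weight `g^{κ₀} = exp(−(κ₀/2)G)` of (2.31)).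
Proof: `log G ≤ 2√G` and a square. [folklore] -/
theorem logWindow_absorbed {ν a b κ G : ℝ} {N : ℕ} (hν : 0 < ν) (hν1 : ν ≤ 1) (ha : 0 ≤ a) (hκ : 0 < κ)
    (hG : 1 ≤ G) (hN : (N : ℝ) ≤ a * Real.log G + b) :
    Real.exp (-(κ * G)) ≤ Real.exp (Real.log ν⁻¹ * b + 4 * (a * Real.log ν⁻¹) ^ 2 / κ) * ν ^ N := by
  set lam := Real.log ν⁻¹ with hlam
  have hlam0 : 0 ≤ lam := by
    rw [hlam, Real.log_inv]
    exact neg_nonneg.2 (Real.log_nonpos hν.le hν1)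
  have hνN : ν ^ N = Real.exp (-(lam * N)) := by
    rw [hlam, Real.log_inv, neg_mul, neg_neg, mul_comm, Real.exp_nat_mul, Real.exp_log hν]
  rw [hνN, ← Real.exp_add, Real.exp_le_exp]
  have hG0 : 0 < G := by linarith
  have hsq : Real.log G ≤ 2 * Real.sqrt G := by
    have h1 : Real.log (Real.sqrt G) ≤ Real.sqrt G - 1 := Real.log_le_sub_one_of_pos (Real.sqrt_pos.2 hG0)
    have h2 : Real.log (Real.sqrt G) = Real.log G / 2 := Real.log_sqrt hG0.le
    linarith
  have hN' : lam * (N : ℝ) ≤ lam * a * Real.log G + lam * b := by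
    have h := mul_le_mul_of_nonneg_left hN hlam0
    have e : lam * (a * Real.log G + b) = lam * a * Real.log G + lam * b := by ring
    linarith
  have hkey : lam * a * Real.log G - κ * G ≤ 4 * (a * lam) ^ 2 / κ := by
    set u := Real.sqrt G with hu
    have hsG : G = u * u := (Real.mul_self_sqrt hG0.le).symm
    have hs0 : 0 ≤ u := Real.sqrt_nonneg G
    have hla : 0 ≤ lam * a := mul_nonneg hlam0 ha
    have h3 : lam * a * Real.log G ≤ 2 * (lam * a) * u := by nlinarith
    have h4 : 2 * (lam * a) * u - κ * G ≤ 4 * (a * lam) ^ 2 / κ := by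
      rw [le_div_iff₀ hκ, hsG]
      have h5 : 0 ≤ lam * a * κ * u := mul_nonneg (mul_nonneg hla hκ.le) hs0
      nlinarith [sq_nonneg (2 * a * lam - κ * u)]
    linarith
  linarith

/-- **A POLYNOMIAL window below the profile degree is absorbed by the profile weight** (real variables; G = log g⁻² ≥ 1):
natural `v < p`, `N ≤ A·G^v + b` (`A ≥ 0`; the printed UPPER restriction *"N ≤ O(1)(log g_k^{−2})^ν"*, [Balaban1989LargeFieldI]
p. 198), `0 < ν ≤ 1`, `A₀ > 0` ⇒ `exp(−A₀G^p) ≤ exp(b·log ν⁻¹ + A·log ν⁻¹·max(1, A·log ν⁻¹/A₀)^v)·ν^N` (weight `exp(−p₀(g))`,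
`p₀(g) = A₀(log g^{−2})^{p₀}`, (1.100) and [Balaban1989LargeFieldI] p. 175).  Proof: regimes `G ≤ X₁` / `G > X₁ := max(1,
Aλ/A₀)`, where `A₀G^p ≥ A₀G·G^v ≥ AλG^v`. [folklore] -/
theorem polyWindow_absorbed {ν A A₀ b G : ℝ} {v p N : ℕ} (hν : 0 < ν) (hν1 : ν ≤ 1) (hA : 0 ≤ A) (hA₀ : 0 < A₀)
    (hvp : v < p) (hG : 1 ≤ G) (hN : (N : ℝ) ≤ A * G ^ v + b) :
    Real.exp (-(A₀ * G ^ p)) ≤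
      Real.exp (Real.log ν⁻¹ * b + A * Real.log ν⁻¹ * max 1 (A * Real.log ν⁻¹ / A₀) ^ v) * ν ^ N := by
  set lam := Real.log ν⁻¹ with hlam
  have hlam0 : 0 ≤ lam := by
    rw [hlam, Real.log_inv]
    exact neg_nonneg.2 (Real.log_nonpos hν.le hν1)
  have hνN : ν ^ N = Real.exp (-(lam * N)) := by
    rw [hlam, Real.log_inv, neg_mul, neg_neg, mul_comm, Real.exp_nat_mul, Real.exp_log hν]
  rw [hνN, ← Real.exp_add, Real.exp_le_exp]
  set X₁ := max 1 (A * lam / A₀) with hX₁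
  have hX1 : 1 ≤ X₁ := le_max_left _ _
  have hX2 : A * lam / A₀ ≤ X₁ := le_max_right _ _
  have hG0 : 0 ≤ G := by linarith
  have hGv : 0 ≤ G ^ v := pow_nonneg hG0 v
  have hN' : lam * (N : ℝ) ≤ lam * A * G ^ v + lam * b := by
    have h := mul_le_mul_of_nonneg_left hN hlam0
    have e : lam * (A * G ^ v + b) = lam * A * G ^ v + lam * b := by ring
    linarith
  have hkey : lam * A * G ^ v - A₀ * G ^ p ≤ A * lam * X₁ ^ v := by
    rcases le_or_gt G X₁ with hle | hlt
    · have h1 : G ^ v ≤ X₁ ^ v := pow_le_pow_left₀ hG0 hle v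
      have h2 : 0 ≤ A₀ * G ^ p := mul_nonneg hA₀.le (pow_nonneg hG0 p)
      have h3 : lam * A * G ^ v ≤ lam * A * X₁ ^ v := mul_le_mul_of_nonneg_left h1 (mul_nonneg hlam0 hA)
      have e : lam * A * X₁ ^ v = A * lam * X₁ ^ v := by ring
      linarith
    · have h1 : A * lam ≤ A₀ * G := by
        have h := (div_le_iff₀ hA₀).1 (hX2.trans hlt.le)
        linarith
      have h2 : G ^ (v + 1) ≤ G ^ p := pow_le_pow_right₀ hG (by omega)
      have h4 : A * lam * G ^ v ≤ A₀ * G ^ p :=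
        calc A * lam * G ^ v ≤ A₀ * G * G ^ v := mul_le_mul_of_nonneg_right h1 hGv
          _ = A₀ * G ^ (v + 1) := by ring
          _ ≤ A₀ * G ^ p := mul_le_mul_of_nonneg_left h2 hA₀.le
      have h5 : 0 ≤ A * lam * X₁ ^ v := mul_nonneg (mul_nonneg hA hlam0) (pow_nonneg (by linarith) v)
      have e : lam * A * G ^ v = A * lam * G ^ v := by ring
      linarith
  linarith

/-- **Bridge, polynomial window** (to `habs` of `ne9T_of_dilationStepV`): weighted sup bounds `M₁ j ≤ M·exp(−A₀(G j)^p)`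
(shape of (1.100)), `N j ≤ A(G j)^v + b`, `v < p`, `G j ≥ 1` ⇒ `4M₁ j/(c·t₀) ≤ σ₀·ν^{N j}`,
`σ₀ = (4M/(c·t₀))·exp(b·log ν⁻¹ + A·log ν⁻¹·max(1, A·log ν⁻¹/A₀)^v)`. [folklore] -/
theorem windowWeight_absorbed_poly {M₁ G : ℕ → ℝ} {N : ℕ → ℕ} {M c t₀ ν A A₀ b : ℝ} {v p : ℕ}
    (hM : 0 ≤ M) (hc : 0 < c) (ht₀ : 0 < t₀) (hν : 0 < ν) (hν1 : ν ≤ 1) (hA : 0 ≤ A) (hA₀ : 0 < A₀) (hvp : v < p)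
    (hG : ∀ j, 1 ≤ G j) (hN : ∀ j, (N j : ℝ) ≤ A * G j ^ v + b) (hM₁ : ∀ j, M₁ j ≤ M * Real.exp (-(A₀ * G j ^ p))) :
    ∀ j, 4 * M₁ j / (c * t₀) ≤
      4 * M / (c * t₀) * Real.exp (Real.log ν⁻¹ * b + A * Real.log ν⁻¹ * max 1 (A * Real.log ν⁻¹ / A₀) ^ v)
        * ν ^ N j := by
  intro j
  have h := polyWindow_absorbed hν hν1 hA hA₀ hvp (hG j) (hN j)
  have hct : 0 < c * t₀ := mul_pos hc ht₀
  have h1 : M₁ j ≤ M * (Real.exp (Real.log ν⁻¹ * b + A * Real.log ν⁻¹ * max 1 (A * Real.log ν⁻¹ / A₀) ^ v)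
      * ν ^ N j) := (hM₁ j).trans (mul_le_mul_of_nonneg_left h hM)
  have h2 : 4 * M₁ j / (c * t₀) ≤ 4 * (M * (Real.exp (Real.log ν⁻¹ * b + A * Real.log ν⁻¹ *
      max 1 (A * Real.log ν⁻¹ / A₀) ^ v) * ν ^ N j)) / (c * t₀) :=
    div_le_div_of_nonneg_right (by linarith) hct.le
  calc 4 * M₁ j / (c * t₀) ≤ _ := h2
    _ = _ := by ring

/-- **Bridge, log-log window** (any exponential weight): `M₁ j ≤ M·exp(−κ·G j)`, `N j ≤ a·log(G j) + b`, `G j ≥ 1` ⇒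
`4M₁ j/(c·t₀) ≤ σ₀·ν^{N j}`, `σ₀ = (4M/(c·t₀))·exp(b·log ν⁻¹ + 4(a·log ν⁻¹)²/κ)`. [folklore] -/
theorem windowWeight_absorbed_log {M₁ G : ℕ → ℝ} {N : ℕ → ℕ} {M c t₀ ν a b κ : ℝ}
    (hM : 0 ≤ M) (hc : 0 < c) (ht₀ : 0 < t₀) (hν : 0 < ν) (hν1 : ν ≤ 1) (ha : 0 ≤ a) (hκ : 0 < κ)
    (hG : ∀ j, 1 ≤ G j) (hN : ∀ j, (N j : ℝ) ≤ a * Real.log (G j) + b) (hM₁ : ∀ j, M₁ j ≤ M * Real.exp (-(κ * G j))) :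
    ∀ j, 4 * M₁ j / (c * t₀) ≤
      4 * M / (c * t₀) * Real.exp (Real.log ν⁻¹ * b + 4 * (a * Real.log ν⁻¹) ^ 2 / κ) * ν ^ N j := by
  intro j
  have h := logWindow_absorbed hν hν1 ha hκ (hG j) (hN j)
  have hct : 0 < c * t₀ := mul_pos hc ht₀
  have h1 : M₁ j ≤ M * (Real.exp (Real.log ν⁻¹ * b + 4 * (a * Real.log ν⁻¹) ^ 2 / κ) * ν ^ N j) :=
    (hM₁ j).trans (mul_le_mul_of_nonneg_left h hM)
  have h2 : 4 * M₁ j / (c * t₀)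
      ≤ 4 * (M * (Real.exp (Real.log ν⁻¹ * b + 4 * (a * Real.log ν⁻¹) ^ 2 / κ) * ν ^ N j)) / (c * t₀) :=
    div_le_div_of_nonneg_right (by linarith) hct.le
  calc 4 * M₁ j / (c * t₀) ≤ _ := h2
    _ = _ := by ring

end Profiles

section VarWindowAnalytic

variable {F : Type*} [NormedAddCommGroup F] [NormedSpace ℂ F] [CompleteSpace F]

/-- **Cauchy constants of the VARIABLE-WINDOW step map ⇒ `StepTransferV`**: as `stepTransferN_of_analyticOn` with a
STEP-DEPENDENT window `j − N j ≤ m ≤ j` (`hwin`) and sup bound `M₁ j` on the relative discs `|z − s| ≤ c·s`, `s ≥ t₀`, of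
each window slot ((AN-WIN-dil) with the weighted bound = [H-dil-N] WITH THE PRINTED WEIGHT — NOT PRINTED, inspection-level);
(AN-OLD) margin `ϱ`, bound `M₂`; (CONTR) ⇒ `StepTransferV V (BoxWindow [t₀,∞[) (fun j ↦ 4M₁ j/(c·t₀)) (4M₂/ϱ) ω₀ N`.
Mechanism: Dimock's printed Cauchy argument per slot, exact independence below the window, `norm_sub_le_of_margin`.
[cite: Dimock2015, Sect. 7 proof of Lemma 25 (arXiv:1512.04373 TeX ll. 5647–5679)] -/
theorem stepTransferV_of_analyticOn {V : ℕ → (ℕ → ℝ) → F} {t₀ c : ℝ} (T : ℕ → (ℕ → ℝ) → F)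
    (Φ : ℕ → (ℕ → ℝ) → F → F) {N : ℕ → ℕ} {M₁ : ℕ → ℝ} {M₂ ϱ ω₀ : ℝ} (ht₀ : 0 < t₀) (hc : 0 < c) (hϱ : 0 < ϱ)
    (hM₂ : 0 ≤ M₂)
    (hV : ∀ j, ∀ g ∈ BoxWindow (Set.Ici t₀), V (j + 1) g = Φ j g (T j g))
    (hwin : ∀ j (w : F) (h h' : ℕ → ℝ), (∀ m ∈ Finset.Icc (j - N j) j, h m = h' m) → Φ j h w = Φ j h' w)
    (hlast : ∀ j, ∀ g ∈ BoxWindow (Set.Ici t₀), ∀ H ∈ BoxWindow (Set.Ici t₀), ∀ m ∈ Finset.Icc (j - N j) j,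
      ∃ (G : ℂ → F) (D : Set ℂ), DifferentiableOn ℂ G D ∧ (∀ z ∈ D, ‖G z‖ ≤ M₁ j) ∧
        (∀ s ∈ Set.Ici t₀, closedBall (s : ℂ) (c * s) ⊆ D) ∧
        ∀ s ∈ Set.Ici t₀, G s = Φ j (Function.update H m s) (T j g))
    (hold : ∀ j, ∀ H ∈ BoxWindow (Set.Ici t₀), ∃ D : Set F, DifferentiableOn ℂ (Φ j H) D ∧
      (∀ w ∈ D, ‖Φ j H w‖ ≤ M₂) ∧ ∀ g ∈ BoxWindow (Set.Ici t₀), closedBall (T j g) ϱ ⊆ D)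
    (hT : ∀ j, ∀ g ∈ BoxWindow (Set.Ici t₀), ∀ g' ∈ BoxWindow (Set.Ici t₀),
      ‖T j g - T j g'‖ ≤ ∑ m ∈ Finset.range (j + 1), ω₀ ^ (j - m) * ‖V m g - V m g'‖) :
    StepTransferV V (BoxWindow (Set.Ici t₀)) (fun j => 4 * M₁ j / (c * t₀)) (4 * M₂ / ϱ) ω₀ N := by
  have hS : StepTransferS V (BoxWindow (Set.Ici t₀)) (vwinSrc (fun j => 4 * M₁ j / (c * t₀)) N) (4 * M₂ / ϱ) ω₀ := by
    refine stepTransferS_of_slotLipschitz T Φ _ (by positivity) hV ?_ ?_ ?_ hT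
    · -- dependence on the slots ≤ j only, from the window dependence
      intro j w h h' hh
      exact hwin j w h h' fun m hm => hh m (Finset.mem_Icc.1 hm).2
    · -- per-slot Lipschitz constants: Cauchy on the window slots, exact independence below the window
      intro j g hg H hH m hm s hs s' hs'
      by_cases hwm : j ≤ m + N j
      · have hmI : m ∈ Finset.Icc (j - N j) j := Finset.mem_Icc.2 ⟨by omega, hm⟩
        obtain ⟨G, D, hG, hGM, hD, hGE⟩ := hlast j g hg H hH m hmI
        have hDab : ∀ u ∈ Icc (min s s') (max s s'), closedBall (u : ℂ) (c * t₀) ⊆ D := by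
          intro u hu
          have ht₀u : t₀ ≤ u := le_trans (le_min hs hs') hu.1
          exact (closedBall_subset_closedBall (mul_le_mul_of_nonneg_left ht₀u hc.le)).trans (hD u ht₀u)
        have key := real_param_lipschitz (g := G) (mul_pos hc ht₀) hG hGM hDab
          (s := s) (t := s') ⟨min_le_left _ _, le_max_left _ _⟩ ⟨min_le_right _ _, le_max_right _ _⟩
        rw [hGE s hs, hGE s' hs'] at key
        have hsrc : vwinSrc (fun j => 4 * M₁ j / (c * t₀)) N j m = 4 * M₁ j / (c * t₀) := if_pos hwm
        rw [hsrc]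
        exact key
      · have hEq : Φ j (Function.update H m s) (T j g) = Φ j (Function.update H m s') (T j g) := by
          refine hwin j _ _ _ fun m' hm' => ?_
          have hne : m' ≠ m := by
            intro h'
            rw [Finset.mem_Icc] at hm'
            omega
          simp [hne]
        have hsrc : vwinSrc (fun j => 4 * M₁ j / (c * t₀)) N j m = 0 := if_neg hwm
        rw [hEq, hsrc, sub_self, norm_zero, zero_mul]
    · -- old data: the margin Cauchy estimate
      intro j H hH g hg g' hg'
      obtain ⟨D, hD, hM, hball⟩ := hold j H hH
      have hSS : ∀ y ∈ (fun h : ℕ → ℝ => T j h) '' BoxWindow (Set.Ici t₀), closedBall y ϱ ⊆ D := by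
        rintro _ ⟨h, hh, rfl⟩
        exact hball h hh
      exact norm_sub_le_of_margin hϱ hD hM hSS (mem_image_of_mem _ hg) (mem_image_of_mem _ hg')
  intro j g hg g' hg'
  have h := hS j g hg g' hg'
  rwa [sum_vwinSrc] at h

/-- **The absorbed variable-window route END TO END** (t-coordinates, dilation radii): (AN-WIN-dil) with step-dependent
window `N j` and weighted sup bounds `M₁ j ≥ 0` + independence outside the window + (AN-OLD) + (CONTR) + coupling-free scale
0 + evaluation + `0 ≤ ν < μ := ω₀ + 4M₂/ϱ ≤ 1` + the ABSORPTION `4M₁ j/(c·t₀) ≤ σ₀·ν^{N j}`, `σ₀ ≥ 0` (from printed growth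
data: `windowWeight_absorbed_poly/log`) ⇒ `NE9 E (BoxWindow [t₀,∞[) κ Λ ∧ FadingMemory (σ₀/(μ−ν)) μ Λ`, `Λ = srcMod (vwinSrc
(fun j ↦ 4M₁ j/(c·t₀)) N) μ` — UNIFORM IN THE SCALE although `N j` is unbounded.  Every analytic hypothesis is NOT PRINTED
([H-dil-N] weighted, (W2-R), (W3), (W4)); NOT summit progress. [folklore] -/
theorem ne9T_of_dilationStepV {Bg : Type} {E : Functional C Bg} {V : ℕ → (ℕ → ℝ) → F} {t₀ κ c : ℝ}
    (T : ℕ → (ℕ → ℝ) → F) (Φ : ℕ → (ℕ → ℝ) → F → F) (ev : F → Bg → C.Dom → ℝ)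
    {N : ℕ → ℕ} {M₁ : ℕ → ℝ} {M₂ ϱ ω₀ σ₀ ν : ℝ} (ht₀ : 0 < t₀) (hc : 0 < c) (hϱ : 0 < ϱ) (hM₁ : ∀ j, 0 ≤ M₁ j)
    (hM₂ : 0 ≤ M₂) (hω : 0 ≤ ω₀) (hσ₀ : 0 ≤ σ₀) (hν : 0 ≤ ν) (hνμ : ν < ω₀ + 4 * M₂ / ϱ)
    (hμ1 : ω₀ + 4 * M₂ / ϱ ≤ 1) (habs : ∀ j, 4 * M₁ j / (c * t₀) ≤ σ₀ * ν ^ N j)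
    (hev : ∀ (b b' : F) (U : Bg) (X : C.Dom), |ev b U X - ev b' U X| ≤ Real.exp (-(κ * C.d X)) * ‖b - b'‖)
    (hE : ∀ g ∈ BoxWindow (Set.Ici t₀), ∀ (U : Bg) (X : C.Dom), E g U X = ev (V (C.scale X) g) U X)
    (h0 : ∀ g ∈ BoxWindow (Set.Ici t₀), ∀ g' ∈ BoxWindow (Set.Ici t₀), V 0 g = V 0 g')
    (hV : ∀ j, ∀ g ∈ BoxWindow (Set.Ici t₀), V (j + 1) g = Φ j g (T j g))
    (hwin : ∀ j (w : F) (h h' : ℕ → ℝ), (∀ m ∈ Finset.Icc (j - N j) j, h m = h' m) → Φ j h w = Φ j h' w)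
    (hlast : ∀ j, ∀ g ∈ BoxWindow (Set.Ici t₀), ∀ H ∈ BoxWindow (Set.Ici t₀), ∀ m ∈ Finset.Icc (j - N j) j,
      ∃ (G : ℂ → F) (D : Set ℂ), DifferentiableOn ℂ G D ∧ (∀ z ∈ D, ‖G z‖ ≤ M₁ j) ∧
        (∀ s ∈ Set.Ici t₀, closedBall (s : ℂ) (c * s) ⊆ D) ∧
        ∀ s ∈ Set.Ici t₀, G s = Φ j (Function.update H m s) (T j g))
    (hold : ∀ j, ∀ H ∈ BoxWindow (Set.Ici t₀), ∃ D : Set F, DifferentiableOn ℂ (Φ j H) D ∧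
      (∀ w ∈ D, ‖Φ j H w‖ ≤ M₂) ∧ ∀ g ∈ BoxWindow (Set.Ici t₀), closedBall (T j g) ϱ ⊆ D)
    (hT : ∀ j, ∀ g ∈ BoxWindow (Set.Ici t₀), ∀ g' ∈ BoxWindow (Set.Ici t₀),
      ‖T j g - T j g'‖ ≤ ∑ m ∈ Finset.range (j + 1), ω₀ ^ (j - m) * ‖V m g - V m g'‖) :
    NE9 E (BoxWindow (Set.Ici t₀)) κ (srcMod (vwinSrc (fun j => 4 * M₁ j / (c * t₀)) N) (ω₀ + 4 * M₂ / ϱ)) ∧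
      FadingMemory (σ₀ / (ω₀ + 4 * M₂ / ϱ - ν)) (ω₀ + 4 * M₂ / ϱ)
        (srcMod (vwinSrc (fun j => 4 * M₁ j / (c * t₀)) N) (ω₀ + 4 * M₂ / ϱ)) := by
  have hstep := stepTransferV_of_analyticOn T Φ ht₀ hc hϱ hM₂ hV hwin hlast hold hT
  have ha : 0 ≤ 4 * M₂ / ϱ := by positivity
  have hℓ : ∀ s, 0 ≤ 4 * M₁ s / (c * t₀) ∧ 4 * M₁ s / (c * t₀) ≤ σ₀ * ν ^ N s := fun s =>
    ⟨by have := hM₁ s; positivity, habs s⟩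
  exact ne9_and_fadingMemory_of_stepTransferV ev hev hE ha hω hσ₀ hν hνμ hμ1 hℓ h0 hstep

end VarWindowAnalytic

/-! ## §15  Non-vacuity of the v1.6 shapes -/

/-- The variable-window shape and the absorption hypothesis are jointly satisfiable (zero activities in `ℂ`, zero
moduli, any window profile), so no v1.6 theorem is vacuously true by contradiction. [folklore] -/
theorem shapes_nonvacuous₅ (W : Set (ℕ → ℝ)) (N : ℕ → ℕ) (ν : ℝ) :
    ∃ (V : ℕ → (ℕ → ℝ) → ℂ) (ℓ : ℕ → ℝ), StepTransferV V W ℓ 0 0 N ∧ ∀ s, 0 ≤ ℓ s ∧ ℓ s ≤ 0 * ν ^ N s := by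
  refine ⟨fun _ _ => 0, fun _ => 0, ?_, fun s => ⟨le_rfl, (zero_mul _).symm.le⟩⟩
  intro j g _ g' _
  simp

end Literature.MathematicalPhysics.QuantumFieldTheory.Balaban1983to89.T4CouplingAnalyticity

end
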